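import Literature.NumberTheory.Automorphic.ArchRankOneSplitCasimirAlgebra               -- ★ p850694 (this seat) FILE 1: `casimirJ_bilinear_eq_flows`, `casimirJ_conj_eq_of_mem`, `casimirJ_firstOrder_conj_eq`, frame units; brings ★ p850353 (`isClosedEmbedding_coe_unitaryGroupOfForm_of_eq_over`), ★ p850189 (`integral_prod_conj_hypBlockGL_half_eq_exp_smul`, `hypBlockGL_mem_of_eq_over`, `exists_glDiagonal_eq_hypBlockGL`), ★ Z1 (`RankOneCasimir.hasDerivAt_boost`)
import Literature.NumberTheory.Automorphic.ArchRankOneSplitOrbitSmooth                 -- ★ p850603 (F0P3a-p05 (g20)) (A0-smooth): `contDiff_coe_hypBlockGL`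
import Literature.Analysis.FunctionSpaces.ParametricIntegralSmooth                      -- ★ engine: `contDiff_parametric_integral`, `differentiable_parametric_integral`, `fderiv_parametric_integral_apply`
import Literature.NumberTheory.Automorphic.ArchConjugationCurveIntegralDeriv            -- ★ Z2 (A-p18): `ConjugationCurve.hasDerivAt_comp_conj_curve`, `…_fderiv_comp_conj_curve`, `eq_zero_of_notMem_tsupport`
import HarnessLib

/-!
# (A0-CASIMIR-∞) FILE 2: Harish-Chandra's RADIAL EQUATION on the SPLIT torus of `U(J) = U(1,1)` — the `K × N` chart integral intertwines the Casimir with `∂_x² + 2∂_x`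
# (full-torus chart) resp. `∂_x² − 1` (the half chart of ★ p850603): `Ψ_{Ωg} = Ψ_g″ + 2Ψ_g′` at EVERY `x`, no singular set (Varadarajan 1989 §6.4 Thm 23; Knapp 1986 Ch. VIII §5)

Topic `NumberTheory/Automorphic`; namespace `Literature.NumberTheory.Automorphic.UnitaryGroup`.  THEOREMS ONLY (no `def`, no instance, no notation, no axiom, no named fact, no
`sorry`).  Cell `pub/hodgecm-mathlib`, crux H413 (`stmt-HodgeConjecture-24833`), line LH3 (closer stub `stub_N9`, direct road), letter L1∕L3′ pay-down brick **(A0-CASIMIR-∞)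
FILE 2** (F0P3a-p09 (g6); LH3-plan (g3) 2026-09-02T08:51:42Z «=»; FILE 1 = ★ p850694 `ArchRankOneSplitCasimirAlgebra`).

THE MATHEMATICS.  `G = U(J)(ℂ)`, `hJ : J = (StdForm.antidiagonal 2).over ℂ`, `K ≤ G` compact, `N = unipotentU` (`n = 1 + yE`, `y ∈ ℝ·i`), `κ`, `μ_N` Haar measures, `g ∈ C_c^∞(M₂(ℂ), E)`,
`Ω = Ω_J` the `½tr`-Casimir in the split frame (FILE 1: a BOUND operator with defining hypothesis `hΩ`).  With `t_x = hypBlockGL x θ = e^{iθ}e^{xH}` put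
`Ψ_g(x) = ∫_{K×N} g(k·(t_x n)·k⁻¹) d(κ ⊗ μ_N)` — ★ p850189's full-torus chart integral (`|eˣ − e⁻ˣ|·Φ^T = C·eˣ·Ψ` off the centre, `Λ = eˣΨ` its half form, ★
`integral_prod_conj_hypBlockGL_half_eq_exp_smul`).  At `Y = k (t_x n) k⁻¹` the left-invariant fields are `Y·Xᵢ = k (t_x n · Ad_{k⁻¹}Xᵢ) k⁻¹`; by the `Ad(U(J))`-invariance
of `Ω` (FILE 1) and the flow decomposition `Ω = H̃² − 2H̃ − 4ẼF̃˜` (FILE 1) the integrand `(Ωg)(Y)` is the sum of (§4)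
  `∂_s²|₀ g(k (t_x n e^{sH}) k⁻¹) − 2 ∂_s|₀ g(k (t_x n e^{sH}) k⁻¹) − 4 ∂_r|₀ Dg(k (t_x n u_r) k⁻¹)[k (t_x n u_r F̃) k⁻¹]`,  `u_r = 1 + rE ∈ N`.
Under `∫_{K×N}` (differentiation under the integral sign on a compact carrier, §1): the `Ẽ`-term is the derivative of a function CONSTANT in `r` (`n u_r`, right-invariance of
`μ_N` on the abelian `N`), hence `0`; the `H̃`-flow satisfies `t_x n e^{sH} = t_{x+s} (e^{−sH} n e^{sH})` and `n ↦ e^{−sH}ne^{sH}` scales `μ_N` by `e^{2s}` (§3, ★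
`map_conj_eq_smul_two`), so `∫ g(k (t_x n e^{sH}) k⁻¹) = e^{2s} Ψ_g(x+s)`, whose first two `s`-derivatives at `0` are `Ψ′ + 2Ψ` and `Ψ″ + 4Ψ′ + 4Ψ`.  Total:
  **`Ψ_{Ωg}(x) = (Ψ″ + 4Ψ′ + 4Ψ) − 2(Ψ′ + 2Ψ) − 0 = Ψ_g″(x) + 2Ψ_g′(x)`**, i.e. `Λ_{Ωg} = Λ_g″ − Λ_g` for `Λ = eˣΨ` — Harish-Chandra's homomorphism `Ω ↦ ∂² − ρ²` on the
split Cartan (`ρ = 1` after the `eˣ` shift), at ALL points (the split side has no singular set; the all-orders `x`-jets at the centre follow by iteration, FILE 3).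

WHAT IS PROVED.
* §1 `exists_isCompact_carrier_conj` (one compact `s ⊆ K × N` carrying `k·(a(r) n c(r))·k⁻¹ ∈ S₀` for `|r − r₀| ≤ 1`); **`contDiffAt_hasDerivAt_integral_prod_of_support`** (THE LOCAL
  ENGINE: one derivative under `∫_{K×N}` for a smooth `Φ((↑k, ↑k⁻¹, ↑n), r)` supported in a fixed compact — ★ `Literature.Analysis.FunctionSpaces.fderiv_parametric_integral_apply` on
  the canonical space `(Fin 2 → Fin 2 → ℂ)³`); `integral_prod_comp_mul_right_eq` (right-invariance on the `N` factor).
* §2 the boost `e^{sH} = ch s·1 + sh s·H = hypBlockGL s 0` and its derivative `e^{sH}H` (★ Z1 `RankOneCasimir.hasDerivAt_boost`); the chain rule along the unipotent line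
  `hasDerivAt_fderiv_comp_conj_unipotent` (the boost chain rules are ★ Z2 `ConjugationCurve.hasDerivAt_comp_conj_curve ∕ hasDerivAt_fderiv_comp_conj_curve`).
* §3 **`integral_prod_conj_mul_hypBlockGL_eq_exp_smul`**: `∫_{K×N} F(k·(t_x n h_s)·k⁻¹) = e^{2s} • ∫_{K×N} F(k·(t_{x+s} n)·k⁻¹)` for every Banach-valued `F`.
* §4 `casimirJ_linearMap₂_eq_flows` (FILE 1's flow decomposition for plain bilinear maps) and **`casimirJ_apply_conj_eq_flows`**: `(Ω_J g)(↑k W ↑k⁻¹)` in the rotated flow form.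
* §5 HEAD **`casimir_integral_prod_conj_hypBlockGL_eq … (hΨ) (hΨΩ) : ContDiff ℝ ∞ Ψ ∧ ∀ x, Ψ_Ω x = deriv (deriv Ψ) x + 2 • deriv Ψ x`** (`Ψ`, `Ψ_Ω` bound functions with their
  defining hypotheses; one `maxHeartbeats` raise for the size of the assembled terms, statement untouched).
HONEST LABEL: count-neutral analysis toward letter L1∕L3′ (the split-side input of the all-orders rank-one jump relation); HC_CM is proved only modulo the printed citations
(2 remaining named inputs: hLiu418 = `stmt-HodgeConjecture-24832`, h413 = `stmt-HodgeConjecture-24833`) until rung 0 closes.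

## References
* [Varadarajan1989] V. S. Varadarajan, *An Introduction to Harmonic Analysis on Semisimple Lie Groups*, Cambridge Stud. Adv. Math. 16 (1989), §6.3 (radial components), §6.4 Thm 23
  (`F_f` on the split Cartan: `e^{ρ}∫_N f̄(an) dn`, smooth, `F_{Ωf} = (∂² − ρ²)F_f`).
* [Knapp1986] A. W. Knapp, *Representation Theory of Semisimple Groups* (1986), Ch. V §3, Ch. VIII §5 (Harish-Chandra homomorphism `Ω ↦ H² − ρ²`).
* [Rogawski1990] J. D. Rogawski, *Automorphic Representations of Unitary Groups in Three Variables*, Ann. of Math. Stud. 123 (1990), §3.6 p. 31, §8.2 pp. 119–122.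
* [HormanderALPDO1] L. Hörmander, *The Analysis of Linear Partial Differential Operators I* (1990), Thm. 1.1.9 (differentiation under the integral sign).
* [Folland1995] G. B. Folland, *A Course in Abstract Harmonic Analysis* (1995), §2.6 (invariant integration on groups and homogeneous spaces).
* [Hall2015] B. C. Hall, *Lie Groups, Lie Algebras, and Representations*, GTM 222 (2015), §3.6, Prop. 3.24.
-/

set_option autoImplicit false

noncomputable section

open MeasureTheory Measure Set Filter Topology Complex Metric
open scoped ENNReal NNReal ComplexConjugate ContDiff Matrix.Norms.Operator MatrixGroups

namespace Literature.NumberTheory.Automorphic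

open Literature.MeasureTheory.Group Literature.Analysis.FunctionSpaces

namespace UnitaryGroup

open Literature.NumberTheory.Automorphic.UnitaryGroup.HeisRing Literature.NumberTheory.Automorphic.UnitaryGroup.LineRing

section SplitRadial

variable {J : Matrix (Fin 2) (Fin 2) ℂ} (hJ : J = (StdForm.antidiagonal 2).over ℂ)
  [MeasurableSpace ↥(unitaryGroupOfForm (starRingEnd ℂ) J)] [BorelSpace ↥(unitaryGroupOfForm (starRingEnd ℂ) J)]
  {K : Subgroup ↥(unitaryGroupOfForm (starRingEnd ℂ) J)} (κ : Measure ↥K)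
  (μN : Measure ↥(unipotentU (starRingEnd ℂ) J)) {E : Type*} [NormedAddCommGroup E] [NormedSpace ℝ E]

/-! ## §1 Plumbing on the `K × N` chart: a compact carrier, the local engine (one derivative under `∫_{K×N}`), right-invariance on the `N`-factor -/

omit [MeasurableSpace ↥(unitaryGroupOfForm (starRingEnd ℂ) J)] [BorelSpace ↥(unitaryGroupOfForm (starRingEnd ℂ) J)] in
/-- **COMPACT CARRIER.**  For continuous `a, c : ℝ → U(J)`, a compact `S₀ ⊆ U(J)` and `r₀`: ONE compact `s ⊆ K × N` containing every `(k, n)` with `k·(a(r) n c(r))·k⁻¹ ∈ S₀` for some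
`|r − r₀| ≤ 1` (`n = a(r)⁻¹ (k⁻¹ Z k) c(r)⁻¹` ranges in the continuous image of a compact; `N` is closed). [cite: Varadarajan1989, §6.4] -/
theorem exists_isCompact_carrier_conj (hK : IsCompact (K : Set ↥(unitaryGroupOfForm (starRingEnd ℂ) J)))
    (a c : ℝ → ↥(unitaryGroupOfForm (starRingEnd ℂ) J)) (ha : Continuous a) (hc : Continuous c)
    {S₀ : Set ↥(unitaryGroupOfForm (starRingEnd ℂ) J)} (hS₀ : IsCompact S₀) (r₀ : ℝ) :
    ∃ s : Set (↥K × ↥(unipotentU (starRingEnd ℂ) J)), IsCompact s ∧ ∀ r ∈ closedBall r₀ 1, ∀ p : ↥K × ↥(unipotentU (starRingEnd ℂ) J),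
      (p.1 : ↥(unitaryGroupOfForm (starRingEnd ℂ) J)) * (a r * (p.2 : ↥(unitaryGroupOfForm (starRingEnd ℂ) J)) * c r) *
          (p.1 : ↥(unitaryGroupOfForm (starRingEnd ℂ) J))⁻¹ ∈ S₀ → p ∈ s := by
  have hN : IsClosed (unipotentU (starRingEnd ℂ) J : Set ↥(unitaryGroupOfForm (starRingEnd ℂ) J)) := isClosed_unipotentU _ _
  haveI : CompactSpace ↥K := isCompact_iff_compactSpace.1 hK
  obtain ⟨Ψ, hΨ⟩ : ∃ Ψ : ℝ × ↥K × ↥(unitaryGroupOfForm (starRingEnd ℂ) J) → ↥(unitaryGroupOfForm (starRingEnd ℂ) J),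
      Ψ = fun q => (a q.1)⁻¹ * (((q.2.1 : ↥K) : ↥(unitaryGroupOfForm (starRingEnd ℂ) J))⁻¹ * q.2.2 *
        ((q.2.1 : ↥K) : ↥(unitaryGroupOfForm (starRingEnd ℂ) J))) * (c q.1)⁻¹ := ⟨_, rfl⟩
  have hΨc : Continuous Ψ := by
    rw [hΨ]
    have h1 : Continuous fun q : ℝ × ↥K × ↥(unitaryGroupOfForm (starRingEnd ℂ) J) => ((q.2.1 : ↥K) : ↥(unitaryGroupOfForm (starRingEnd ℂ) J)) :=
      continuous_subtype_val.comp (continuous_fst.comp continuous_snd)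
    exact ((ha.comp continuous_fst).inv.mul ((h1.inv.mul (continuous_snd.comp continuous_snd)).mul h1)).mul (hc.comp continuous_fst).inv
  set S₁ : Set ↥(unitaryGroupOfForm (starRingEnd ℂ) J) := Ψ '' (closedBall r₀ 1 ×ˢ (univ ×ˢ S₀)) with hS₁
  have hS₁c : IsCompact S₁ := (((isCompact_closedBall r₀ 1).prod (isCompact_univ.prod hS₀)).image hΨc)
  refine ⟨univ ×ˢ (Subtype.val ⁻¹' S₁), isCompact_univ.prod (hN.isClosedEmbedding_subtypeVal.isCompact_preimage hS₁c), fun r hr p hp => ?_⟩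
  refine mk_mem_prod (mem_univ _) ?_
  change ((p.2 : ↥(unipotentU (starRingEnd ℂ) J)) : ↥(unitaryGroupOfForm (starRingEnd ℂ) J)) ∈ S₁
  refine ⟨(r, p.1, (p.1 : ↥(unitaryGroupOfForm (starRingEnd ℂ) J)) * (a r * (p.2 : ↥(unitaryGroupOfForm (starRingEnd ℂ) J)) * c r) *
    (p.1 : ↥(unitaryGroupOfForm (starRingEnd ℂ) J))⁻¹), mk_mem_prod hr (mk_mem_prod (mem_univ _) hp), ?_⟩
  rw [hΨ]
  simp only
  group

/-- **THE LOCAL ENGINE ON `K × N` (one derivative under the integral sign).**  `K` compact, `κ`, `μ_N` Haar; `Φ : (M₂(ℂ)³) × ℝ → E` smooth, read at the continuous datum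
`(↑k, ↑k⁻¹, ↑n)`; if for `r` near `r₀` the integrand vanishes off ONE compact `s ⊆ K × N`, then `r ↦ ∫_{K×N} Φ((↑k, ↑k⁻¹, ↑n), r)` is `C^∞` at `r₀` and
**`HasDerivAt (r ↦ ∫ Φ(…, r)) (∫ ∂_r Φ(…, r₀)) r₀`** — localisation to `(κ ⊗ μ_N)|_s` (finite, concentrated on the compact `ι(s)` of the canonical space `(Fin 2 → Fin 2 → ℂ)³`) and
the engine ★ `fderiv_parametric_integral_apply` ∕ `contDiff_parametric_integral`; off `s` the `r`-derivative vanishes too. [cite: HormanderALPDO1, Thm. 1.1.9] [cite: Folland1995, §2.6] -/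
theorem contDiffAt_hasDerivAt_integral_prod_of_support [IsHaarMeasure κ] [IsHaarMeasure μN]
    {Φ : (Matrix (Fin 2) (Fin 2) ℂ × Matrix (Fin 2) (Fin 2) ℂ × Matrix (Fin 2) (Fin 2) ℂ) × ℝ → E} (hΦ : ContDiff ℝ ∞ Φ)
    {s : Set (↥K × ↥(unipotentU (starRingEnd ℂ) J))} (hs : IsCompact s) {r₀ : ℝ} {U : Set ℝ} (hU : U ∈ 𝓝 r₀)
    (hzero : ∀ r ∈ U, ∀ p : ↥K × ↥(unipotentU (starRingEnd ℂ) J), p ∉ s →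
      Φ (((((p.1 : ↥(unitaryGroupOfForm (starRingEnd ℂ) J)) : GL (Fin 2) ℂ) : Matrix (Fin 2) (Fin 2) ℂ),
          ((((p.1 : ↥(unitaryGroupOfForm (starRingEnd ℂ) J))⁻¹ : ↥(unitaryGroupOfForm (starRingEnd ℂ) J)) : GL (Fin 2) ℂ) : Matrix (Fin 2) (Fin 2) ℂ),
          (((p.2 : ↥(unitaryGroupOfForm (starRingEnd ℂ) J)) : GL (Fin 2) ℂ) : Matrix (Fin 2) (Fin 2) ℂ)), r) = 0) :
    ContDiffAt ℝ ∞ (fun r : ℝ => ∫ p : ↥K × ↥(unipotentU (starRingEnd ℂ) J),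
      Φ (((((p.1 : ↥(unitaryGroupOfForm (starRingEnd ℂ) J)) : GL (Fin 2) ℂ) : Matrix (Fin 2) (Fin 2) ℂ),
          ((((p.1 : ↥(unitaryGroupOfForm (starRingEnd ℂ) J))⁻¹ : ↥(unitaryGroupOfForm (starRingEnd ℂ) J)) : GL (Fin 2) ℂ) : Matrix (Fin 2) (Fin 2) ℂ),
          (((p.2 : ↥(unitaryGroupOfForm (starRingEnd ℂ) J)) : GL (Fin 2) ℂ) : Matrix (Fin 2) (Fin 2) ℂ)), r) ∂(κ.prod μN)) r₀ ∧
    HasDerivAt (fun r : ℝ => ∫ p : ↥K × ↥(unipotentU (starRingEnd ℂ) J),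
      Φ (((((p.1 : ↥(unitaryGroupOfForm (starRingEnd ℂ) J)) : GL (Fin 2) ℂ) : Matrix (Fin 2) (Fin 2) ℂ),
          ((((p.1 : ↥(unitaryGroupOfForm (starRingEnd ℂ) J))⁻¹ : ↥(unitaryGroupOfForm (starRingEnd ℂ) J)) : GL (Fin 2) ℂ) : Matrix (Fin 2) (Fin 2) ℂ),
          (((p.2 : ↥(unitaryGroupOfForm (starRingEnd ℂ) J)) : GL (Fin 2) ℂ) : Matrix (Fin 2) (Fin 2) ℂ)), r) ∂(κ.prod μN))
      (∫ p : ↥K × ↥(unipotentU (starRingEnd ℂ) J), deriv (fun r : ℝ =>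
        Φ (((((p.1 : ↥(unitaryGroupOfForm (starRingEnd ℂ) J)) : GL (Fin 2) ℂ) : Matrix (Fin 2) (Fin 2) ℂ),
          ((((p.1 : ↥(unitaryGroupOfForm (starRingEnd ℂ) J))⁻¹ : ↥(unitaryGroupOfForm (starRingEnd ℂ) J)) : GL (Fin 2) ℂ) : Matrix (Fin 2) (Fin 2) ℂ),
          (((p.2 : ↥(unitaryGroupOfForm (starRingEnd ℂ) J)) : GL (Fin 2) ℂ) : Matrix (Fin 2) (Fin 2) ℂ)), r)) r₀ ∂(κ.prod μN)) r₀ := by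
  haveI : LocallyCompactSpace ↥(unitaryGroupOfForm (starRingEnd ℂ) J) := locallyCompactSpace_unitaryGroupOfForm_complex J
  haveI : SecondCountableTopology ↥(unitaryGroupOfForm (starRingEnd ℂ) J) := secondCountableTopology_unitaryGroupOfForm_complex J
  have hN : IsClosed (unipotentU (starRingEnd ℂ) J : Set ↥(unitaryGroupOfForm (starRingEnd ℂ) J)) := isClosed_unipotentU _ _
  haveI : LocallyCompactSpace ↥(unipotentU (starRingEnd ℂ) J) := hN.isClosedEmbedding_subtypeVal.locallyCompactSpace
  haveI : SecondCountableTopology ↥(unipotentU (starRingEnd ℂ) J) := TopologicalSpace.Subtype.secondCountableTopology _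
  haveI : SecondCountableTopology ↥K := TopologicalSpace.Subtype.secondCountableTopology _
  haveI : BorelSpace ↥(unipotentU (starRingEnd ℂ) J) := Subtype.borelSpace _
  haveI : BorelSpace ↥K := Subtype.borelSpace _
  haveI : BorelSpace (↥K × ↥(unipotentU (starRingEnd ℂ) J)) := Prod.borelSpace
  -- the ambient readings `G → M₂(ℂ)` and `G → (Fin 2 → Fin 2 → ℂ)` (canonical normed space for the engine)
  obtain ⟨Ebar, hEbar⟩ : ∃ Ebar : ↥(unitaryGroupOfForm (starRingEnd ℂ) J) → Matrix (Fin 2) (Fin 2) ℂ,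
      Ebar = fun g : ↥(unitaryGroupOfForm (starRingEnd ℂ) J) => ((g : GL (Fin 2) ℂ) : Matrix (Fin 2) (Fin 2) ℂ) := ⟨_, rfl⟩
  have hEcont : Continuous Ebar := by rw [hEbar]; exact Units.continuous_val.comp continuous_subtype_val
  let Λ : (Fin 2 → Fin 2 → ℂ) →L[ℝ] Matrix (Fin 2) (Fin 2) ℂ :=
    LinearMap.toContinuousLinearMap (Matrix.ofLinearEquiv ℝ : (Fin 2 → Fin 2 → ℂ) ≃ₗ[ℝ] Matrix (Fin 2) (Fin 2) ℂ).toLinearMap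
  obtain ⟨Eent, hEent⟩ : ∃ Eent : ↥(unitaryGroupOfForm (starRingEnd ℂ) J) → (Fin 2 → Fin 2 → ℂ), Eent = fun g i j => Ebar g i j := ⟨_, rfl⟩
  have hΛE : ∀ g, Λ (Eent g) = Ebar g := fun g => by rw [hEent]; rfl
  have hEentc : Continuous Eent := by
    rw [hEent]
    exact continuous_pi fun i => continuous_pi fun j => hEcont.matrix_elem i j
  obtain ⟨ι, hι⟩ : ∃ ι : ↥K × ↥(unipotentU (starRingEnd ℂ) J) → (Fin 2 → Fin 2 → ℂ) × (Fin 2 → Fin 2 → ℂ) × (Fin 2 → Fin 2 → ℂ),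
      ι = fun p => (Eent (p.1 : ↥(unitaryGroupOfForm (starRingEnd ℂ) J)), Eent ((p.1 : ↥(unitaryGroupOfForm (starRingEnd ℂ) J))⁻¹),
        Eent (p.2 : ↥(unitaryGroupOfForm (starRingEnd ℂ) J))) := ⟨_, rfl⟩
  have hιc : Continuous ι := by
    rw [hι]
    have h1 : Continuous fun p : ↥K × ↥(unipotentU (starRingEnd ℂ) J) => ((p.1 : ↥K) : ↥(unitaryGroupOfForm (starRingEnd ℂ) J)) :=
      continuous_subtype_val.comp continuous_fst
    have h2 : Continuous fun p : ↥K × ↥(unipotentU (starRingEnd ℂ) J) =>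
        ((p.2 : ↥(unipotentU (starRingEnd ℂ) J)) : ↥(unitaryGroupOfForm (starRingEnd ℂ) J)) := continuous_subtype_val.comp continuous_snd
    exact (hEentc.comp h1).prodMk ((hEentc.comp h1.inv).prodMk (hEentc.comp h2))
  -- the smooth integrand on the canonical space
  obtain ⟨Gf, hGf⟩ : ∃ Gf : ((Fin 2 → Fin 2 → ℂ) × (Fin 2 → Fin 2 → ℂ) × (Fin 2 → Fin 2 → ℂ)) × ℝ → E,
      Gf = fun q => Φ ((Λ q.1.1, Λ q.1.2.1, Λ q.1.2.2), q.2) := ⟨_, rfl⟩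
  have hG : ContDiff ℝ ∞ Gf := by
    rw [hGf]
    refine hΦ.comp (ContDiff.prodMk ?_ contDiff_snd)
    exact (Λ.contDiff.comp (contDiff_fst.comp contDiff_fst)).prodMk
      ((Λ.contDiff.comp (contDiff_fst.comp (contDiff_snd.comp contDiff_fst))).prodMk (Λ.contDiff.comp (contDiff_snd.comp (contDiff_snd.comp contDiff_fst))))
  have hGι : ∀ p r, Gf (ι p, r) =
      Φ (((((p.1 : ↥(unitaryGroupOfForm (starRingEnd ℂ) J)) : GL (Fin 2) ℂ) : Matrix (Fin 2) (Fin 2) ℂ),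
          ((((p.1 : ↥(unitaryGroupOfForm (starRingEnd ℂ) J))⁻¹ : ↥(unitaryGroupOfForm (starRingEnd ℂ) J)) : GL (Fin 2) ℂ) : Matrix (Fin 2) (Fin 2) ℂ),
          (((p.2 : ↥(unitaryGroupOfForm (starRingEnd ℂ) J)) : GL (Fin 2) ℂ) : Matrix (Fin 2) (Fin 2) ℂ)), r) := by
    intro p r
    rw [hGf, hι]
    simp only [hΛE]
    rw [hEbar]
  -- the localised integral
  haveI : IsFiniteMeasure ((κ.prod μN).restrict s) := isFiniteMeasure_restrict.2 hs.measure_lt_top.ne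
  have hιm : Measurable ι := hιc.measurable
  have hιK : ∀ᵐ w ∂((κ.prod μN).restrict s), ι w ∈ ι '' s :=
    (ae_restrict_mem hs.isClosed.measurableSet).mono fun w hw => mem_image_of_mem ι hw
  have hsmooth : ContDiff ℝ ∞ fun r : ℝ => ∫ w, Gf (ι w, r) ∂((κ.prod μN).restrict s) :=
    contDiff_parametric_integral hιm (hs.image hιc) hιK hG
  have hdiff : Differentiable ℝ fun r : ℝ => ∫ w, Gf (ι w, r) ∂((κ.prod μN).restrict s) :=
    differentiable_parametric_integral hιm (hs.image hιc) hιK hG (by simp)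
  have hfd : ∀ r v, fderiv ℝ (fun r : ℝ => ∫ w, Gf (ι w, r) ∂((κ.prod μN).restrict s)) r v =
      ∫ w, fderiv ℝ Gf (ι w, r) ((0 : (Fin 2 → Fin 2 → ℂ) × (Fin 2 → Fin 2 → ℂ) × (Fin 2 → Fin 2 → ℂ)), v) ∂((κ.prod μN).restrict s) :=
    fun r v => fderiv_parametric_integral_apply hιm (hs.image hιc) hιK hG (by simp) r v
  -- agreement near `r₀`
  have hEq : ∀ r ∈ U, (∫ p : ↥K × ↥(unipotentU (starRingEnd ℂ) J),
      Φ (((((p.1 : ↥(unitaryGroupOfForm (starRingEnd ℂ) J)) : GL (Fin 2) ℂ) : Matrix (Fin 2) (Fin 2) ℂ),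
          ((((p.1 : ↥(unitaryGroupOfForm (starRingEnd ℂ) J))⁻¹ : ↥(unitaryGroupOfForm (starRingEnd ℂ) J)) : GL (Fin 2) ℂ) : Matrix (Fin 2) (Fin 2) ℂ),
          (((p.2 : ↥(unitaryGroupOfForm (starRingEnd ℂ) J)) : GL (Fin 2) ℂ) : Matrix (Fin 2) (Fin 2) ℂ)), r) ∂(κ.prod μN)) =
        ∫ w, Gf (ι w, r) ∂((κ.prod μN).restrict s) := by
    intro r hr
    rw [← setIntegral_eq_integral_of_forall_compl_eq_zero fun p hp => hzero r hr p hp]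
    exact integral_congr_ae (Eventually.of_forall fun p => (hGι p r).symm)
  have hEv : (fun r : ℝ => ∫ p : ↥K × ↥(unipotentU (starRingEnd ℂ) J),
      Φ (((((p.1 : ↥(unitaryGroupOfForm (starRingEnd ℂ) J)) : GL (Fin 2) ℂ) : Matrix (Fin 2) (Fin 2) ℂ),
          ((((p.1 : ↥(unitaryGroupOfForm (starRingEnd ℂ) J))⁻¹ : ↥(unitaryGroupOfForm (starRingEnd ℂ) J)) : GL (Fin 2) ℂ) : Matrix (Fin 2) (Fin 2) ℂ),
          (((p.2 : ↥(unitaryGroupOfForm (starRingEnd ℂ) J)) : GL (Fin 2) ℂ) : Matrix (Fin 2) (Fin 2) ℂ)), r) ∂(κ.prod μN)) =ᶠ[𝓝 r₀]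
        fun r : ℝ => ∫ w, Gf (ι w, r) ∂((κ.prod μN).restrict s) := by
    filter_upwards [hU] with r hr
    exact hEq r hr
  refine ⟨hsmooth.contDiffAt.congr_of_eventuallyEq hEv, ?_⟩
  -- the derivative, read pointwise and off `s`
  have hpt : ∀ p : ↥K × ↥(unipotentU (starRingEnd ℂ) J),
      fderiv ℝ Gf (ι p, r₀) ((0 : (Fin 2 → Fin 2 → ℂ) × (Fin 2 → Fin 2 → ℂ) × (Fin 2 → Fin 2 → ℂ)), (1 : ℝ)) =
        deriv (fun r : ℝ => Φ (((((p.1 : ↥(unitaryGroupOfForm (starRingEnd ℂ) J)) : GL (Fin 2) ℂ) : Matrix (Fin 2) (Fin 2) ℂ),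
          ((((p.1 : ↥(unitaryGroupOfForm (starRingEnd ℂ) J))⁻¹ : ↥(unitaryGroupOfForm (starRingEnd ℂ) J)) : GL (Fin 2) ℂ) : Matrix (Fin 2) (Fin 2) ℂ),
          (((p.2 : ↥(unitaryGroupOfForm (starRingEnd ℂ) J)) : GL (Fin 2) ℂ) : Matrix (Fin 2) (Fin 2) ℂ)), r)) r₀ := by
    intro p
    have h1 : HasDerivAt (Gf ∘ fun r : ℝ => (ι p, r))
        (fderiv ℝ Gf (ι p, r₀) ((0 : (Fin 2 → Fin 2 → ℂ) × (Fin 2 → Fin 2 → ℂ) × (Fin 2 → Fin 2 → ℂ)), (1 : ℝ))) r₀ :=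
      ((hG.differentiable (by simp)) _).hasFDerivAt.comp_hasDerivAt r₀ ((hasDerivAt_const r₀ (ι p)).prodMk (hasDerivAt_id r₀))
    have h2 : (Gf ∘ fun r : ℝ => (ι p, r)) = fun r : ℝ => Φ (((((p.1 : ↥(unitaryGroupOfForm (starRingEnd ℂ) J)) : GL (Fin 2) ℂ) : Matrix (Fin 2) (Fin 2) ℂ),
          ((((p.1 : ↥(unitaryGroupOfForm (starRingEnd ℂ) J))⁻¹ : ↥(unitaryGroupOfForm (starRingEnd ℂ) J)) : GL (Fin 2) ℂ) : Matrix (Fin 2) (Fin 2) ℂ),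
          (((p.2 : ↥(unitaryGroupOfForm (starRingEnd ℂ) J)) : GL (Fin 2) ℂ) : Matrix (Fin 2) (Fin 2) ℂ)), r) := funext fun r => hGι p r
    rw [h2] at h1
    exact h1.deriv.symm
  have hoff : ∀ p : ↥K × ↥(unipotentU (starRingEnd ℂ) J), p ∉ s →
      deriv (fun r : ℝ => Φ (((((p.1 : ↥(unitaryGroupOfForm (starRingEnd ℂ) J)) : GL (Fin 2) ℂ) : Matrix (Fin 2) (Fin 2) ℂ),
          ((((p.1 : ↥(unitaryGroupOfForm (starRingEnd ℂ) J))⁻¹ : ↥(unitaryGroupOfForm (starRingEnd ℂ) J)) : GL (Fin 2) ℂ) : Matrix (Fin 2) (Fin 2) ℂ),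
          (((p.2 : ↥(unitaryGroupOfForm (starRingEnd ℂ) J)) : GL (Fin 2) ℂ) : Matrix (Fin 2) (Fin 2) ℂ)), r)) r₀ = 0 := by
    intro p hp
    have hev : (fun r : ℝ => Φ (((((p.1 : ↥(unitaryGroupOfForm (starRingEnd ℂ) J)) : GL (Fin 2) ℂ) : Matrix (Fin 2) (Fin 2) ℂ),
          ((((p.1 : ↥(unitaryGroupOfForm (starRingEnd ℂ) J))⁻¹ : ↥(unitaryGroupOfForm (starRingEnd ℂ) J)) : GL (Fin 2) ℂ) : Matrix (Fin 2) (Fin 2) ℂ),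
          (((p.2 : ↥(unitaryGroupOfForm (starRingEnd ℂ) J)) : GL (Fin 2) ℂ) : Matrix (Fin 2) (Fin 2) ℂ)), r)) =ᶠ[𝓝 r₀] fun _ => (0 : E) := by
      filter_upwards [hU] with r hr
      exact hzero r hr p hp
    rw [hev.deriv_eq]
    exact deriv_const r₀ (0 : E)
  have hval : deriv (fun r : ℝ => ∫ w, Gf (ι w, r) ∂((κ.prod μN).restrict s)) r₀ =
      ∫ p : ↥K × ↥(unipotentU (starRingEnd ℂ) J), deriv (fun r : ℝ =>
        Φ (((((p.1 : ↥(unitaryGroupOfForm (starRingEnd ℂ) J)) : GL (Fin 2) ℂ) : Matrix (Fin 2) (Fin 2) ℂ),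
          ((((p.1 : ↥(unitaryGroupOfForm (starRingEnd ℂ) J))⁻¹ : ↥(unitaryGroupOfForm (starRingEnd ℂ) J)) : GL (Fin 2) ℂ) : Matrix (Fin 2) (Fin 2) ℂ),
          (((p.2 : ↥(unitaryGroupOfForm (starRingEnd ℂ) J)) : GL (Fin 2) ℂ) : Matrix (Fin 2) (Fin 2) ℂ)), r)) r₀ ∂(κ.prod μN) := by
    rw [← fderiv_apply_one_eq_deriv, hfd, ← setIntegral_eq_integral_of_forall_compl_eq_zero hoff]
    exact integral_congr_ae (Eventually.of_forall fun p => hpt p)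
  have hD : HasDerivAt (fun r : ℝ => ∫ w, Gf (ι w, r) ∂((κ.prod μN).restrict s))
      (∫ p : ↥K × ↥(unipotentU (starRingEnd ℂ) J), deriv (fun r : ℝ =>
        Φ (((((p.1 : ↥(unitaryGroupOfForm (starRingEnd ℂ) J)) : GL (Fin 2) ℂ) : Matrix (Fin 2) (Fin 2) ℂ),
          ((((p.1 : ↥(unitaryGroupOfForm (starRingEnd ℂ) J))⁻¹ : ↥(unitaryGroupOfForm (starRingEnd ℂ) J)) : GL (Fin 2) ℂ) : Matrix (Fin 2) (Fin 2) ℂ),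
          (((p.2 : ↥(unitaryGroupOfForm (starRingEnd ℂ) J)) : GL (Fin 2) ℂ) : Matrix (Fin 2) (Fin 2) ℂ)), r)) r₀ ∂(κ.prod μN)) r₀ := by
    rw [← hval]
    exact (hdiff r₀).hasDerivAt
  exact hD.congr_of_eventuallyEq hEv

/-- **RIGHT-INVARIANCE ON THE `N`-FACTOR**: `∫_{K×N} F(k, n·u) d(κ ⊗ μ_N) = ∫_{K×N} F(k, n) d(κ ⊗ μ_N)` for `u ∈ N` (`N` is abelian, ★ `mul_comm_two`, so a Haar measure is right
invariant; the product map `id × (·u)` preserves `κ ⊗ μ_N`). [cite: Folland1995, §2.6] -/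
theorem integral_prod_comp_mul_right_eq [SFinite κ] [IsHaarMeasure μN] (u : ↥(unipotentU (starRingEnd ℂ) J))
    (F : ↥K × ↥(unipotentU (starRingEnd ℂ) J) → E) :
    ∫ p : ↥K × ↥(unipotentU (starRingEnd ℂ) J), F (p.1, p.2 * u) ∂(κ.prod μN) = ∫ p : ↥K × ↥(unipotentU (starRingEnd ℂ) J), F p ∂(κ.prod μN) := by
  haveI : LocallyCompactSpace ↥(unitaryGroupOfForm (starRingEnd ℂ) J) := locallyCompactSpace_unitaryGroupOfForm_complex J
  haveI : SecondCountableTopology ↥(unitaryGroupOfForm (starRingEnd ℂ) J) := secondCountableTopology_unitaryGroupOfForm_complex J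
  have hN : IsClosed (unipotentU (starRingEnd ℂ) J : Set ↥(unitaryGroupOfForm (starRingEnd ℂ) J)) := isClosed_unipotentU _ _
  haveI : LocallyCompactSpace ↥(unipotentU (starRingEnd ℂ) J) := hN.isClosedEmbedding_subtypeVal.locallyCompactSpace
  haveI : SecondCountableTopology ↥(unipotentU (starRingEnd ℂ) J) := TopologicalSpace.Subtype.secondCountableTopology _
  haveI : SecondCountableTopology ↥K := TopologicalSpace.Subtype.secondCountableTopology _
  haveI : BorelSpace ↥(unipotentU (starRingEnd ℂ) J) := Subtype.borelSpace _
  haveI : BorelSpace ↥K := Subtype.borelSpace _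
  haveI : BorelSpace (↥K × ↥(unipotentU (starRingEnd ℂ) J)) := Prod.borelSpace
  have hright : μN.map (fun h : ↥(unipotentU (starRingEnd ℂ) J) => h * u) = μN := by
    have e : (fun h : ↥(unipotentU (starRingEnd ℂ) J) => h * u) = fun h => u * h := funext fun h => mul_comm_two (starRingEnd ℂ) h u
    rw [e]
    exact map_mul_left_eq_self μN u
  set Ψ : ↥K × ↥(unipotentU (starRingEnd ℂ) J) ≃ₜ ↥K × ↥(unipotentU (starRingEnd ℂ) J) := (Homeomorph.refl ↥K).prodCongr (Homeomorph.mulRight u) with hΨ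
  have hΨe : (Ψ : ↥K × ↥(unipotentU (starRingEnd ℂ) J) → ↥K × ↥(unipotentU (starRingEnd ℂ) J)) = Prod.map id fun h => h * u := rfl
  have hmap : (κ.prod μN).map Ψ = κ.prod μN := by
    rw [hΨe, ← Measure.map_prod_map _ _ measurable_id (measurable_mul_const u), Measure.map_id, hright]
  have hint := Ψ.measurableEmbedding.integral_map (μ := κ.prod μN) F
  rw [hmap] at hint
  rw [hint]
  rfl

/-! ## §2 Curves: the boost `e^{sH} = ch s·1 + sh s·H = hypBlockGL s 0`, the unipotent line `1 + r·E`, and the chain rules along `A · curve · B` -/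

/-- `(ch s·1 + sh s·H)·H = sh s·1 + ch s·H` (`H² = 1`): the boost is `exp(sH)`, its derivative is right multiplication by `H`. [cite: Hall2015, §2.1] [cite: Knapp1986, Ch. V §3] -/
theorem boost_splitFrame_mul_H (s : ℝ) :
    (Complex.cosh (s : ℂ) • (1 : Matrix (Fin 2) (Fin 2) ℂ) + Complex.sinh (s : ℂ) • !![1, 0; 0, -1]) * !![1, 0; 0, -1] =
      Complex.sinh (s : ℂ) • (1 : Matrix (Fin 2) (Fin 2) ℂ) + Complex.cosh (s : ℂ) • !![1, 0; 0, -1] := by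
  rw [add_mul, smul_mul_assoc, smul_mul_assoc, one_mul, splitFrame_H_mul_H, add_comm]

/-- **`hypBlockGL s 0 = ch s·1 + sh s·H`** as matrices (`e^{±s} = ch s ± sh s`). [cite: Rogawski1990, §3.6 p. 31] [cite: Knapp1986, Ch. V §3] -/
theorem coe_hypBlockGL_zero_eq_boost (s : ℝ) :
    ((hypBlockGL s 0 : GL (Fin 2) ℂ) : Matrix (Fin 2) (Fin 2) ℂ) = Complex.cosh (s : ℂ) • (1 : Matrix (Fin 2) (Fin 2) ℂ) + Complex.sinh (s : ℂ) • !![1, 0; 0, -1] := by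
  rw [coe_hypBlockGL, Complex.ofReal_zero, zero_mul, add_zero, add_zero, Complex.cosh, Complex.sinh]
  ext i j; fin_cases i <;> fin_cases j <;> simp <;> ring

/-- `d∕ds e^{sH} = e^{sH}·H` for the boost `e^{sH} = ch s·1 + sh s·H` (★ `RankOneCasimir.hasDerivAt_boost` + `H² = 1`). [cite: Hall2015, §2.1] -/
theorem hasDerivAt_boost_splitFrame (s : ℝ) :
    HasDerivAt (fun s : ℝ => Complex.cosh (s : ℂ) • (1 : Matrix (Fin 2) (Fin 2) ℂ) + Complex.sinh (s : ℂ) • !![1, 0; 0, -1])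
      ((Complex.cosh (s : ℂ) • (1 : Matrix (Fin 2) (Fin 2) ℂ) + Complex.sinh (s : ℂ) • !![1, 0; 0, -1]) * !![1, 0; 0, -1]) s := by
  have h := RankOneCasimir.hasDerivAt_boost (!![1, 0; 0, -1] : Matrix (Fin 2) (Fin 2) ℂ) s
  rw [← boost_splitFrame_mul_H s] at h
  exact h

/-- `d∕ds (e^{sH}·H) = e^{sH}·H·H`. [cite: Hall2015, §2.1] -/
theorem hasDerivAt_boost_splitFrame_mul_H (s : ℝ) :
    HasDerivAt (fun s : ℝ => (Complex.cosh (s : ℂ) • (1 : Matrix (Fin 2) (Fin 2) ℂ) + Complex.sinh (s : ℂ) • !![1, 0; 0, -1]) * !![1, 0; 0, -1])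
      ((Complex.cosh (s : ℂ) • (1 : Matrix (Fin 2) (Fin 2) ℂ) + Complex.sinh (s : ℂ) • !![1, 0; 0, -1]) * !![1, 0; 0, -1] * !![1, 0; 0, -1]) s :=
  (hasDerivAt_boost_splitFrame s).mul_const _

/-- **Chain rule along the unipotent line**: `d∕dr Dg(A(P(1 + rE))B)[A(P(1 + rE)F̃)B] = D²g(…)[A(PE)B, A(P(1+rE)F̃)B] + Dg(…)[A(P·EF̃)B]`. [cite: Varadarajan1989, §6.4] -/
theorem hasDerivAt_fderiv_comp_conj_unipotent {g : Matrix (Fin 2) (Fin 2) ℂ → E} (hg : ContDiff ℝ ∞ g) (A P B : Matrix (Fin 2) (Fin 2) ℂ) (r : ℝ) :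
    HasDerivAt (fun r : ℝ => fderiv ℝ g (A * (P * ((1 : Matrix (Fin 2) (Fin 2) ℂ) + (r : ℂ) • !![0, I; 0, 0])) * B)
        (A * (P * (((1 : Matrix (Fin 2) (Fin 2) ℂ) + (r : ℂ) • !![0, I; 0, 0]) * !![0, 0; I, 0])) * B))
      (fderiv ℝ (fderiv ℝ g) (A * (P * ((1 : Matrix (Fin 2) (Fin 2) ℂ) + (r : ℂ) • !![0, I; 0, 0])) * B) (A * (P * !![0, I; 0, 0]) * B)
          (A * (P * (((1 : Matrix (Fin 2) (Fin 2) ℂ) + (r : ℂ) • !![0, I; 0, 0]) * !![0, 0; I, 0])) * B) +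
        fderiv ℝ g (A * (P * ((1 : Matrix (Fin 2) (Fin 2) ℂ) + (r : ℂ) • !![0, I; 0, 0])) * B) (A * (P * (!![0, I; 0, 0] * !![0, 0; I, 0])) * B)) r := by
  have hg' := (contDiff_infty_iff_fderiv.1 hg).2
  have hu : HasDerivAt (fun r : ℝ => (1 : Matrix (Fin 2) (Fin 2) ℂ) + (r : ℂ) • (!![0, I; 0, 0] : Matrix (Fin 2) (Fin 2) ℂ)) (!![0, I; 0, 0]) r := by
    have h := (((hasDerivAt_id r).ofReal_comp).smul_const (!![0, I; 0, 0] : Matrix (Fin 2) (Fin 2) ℂ)).const_add (1 : Matrix (Fin 2) (Fin 2) ℂ)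
    have h1 : ((((1 : ℝ) : ℝ) : ℂ) • (!![0, I; 0, 0] : Matrix (Fin 2) (Fin 2) ℂ)) = !![0, I; 0, 0] := by
      rw [Complex.ofReal_one, one_smul]
    rw [h1] at h
    exact h
  have hc : HasDerivAt (fun r : ℝ => A * (P * ((1 : Matrix (Fin 2) (Fin 2) ℂ) + (r : ℂ) • !![0, I; 0, 0])) * B) (A * (P * !![0, I; 0, 0]) * B) r :=
    ((hu.const_mul P).const_mul A).mul_const B
  have h1 := ((hg'.differentiable (by simp)) _).hasFDerivAt.comp_hasDerivAt r hc
  have hw : HasDerivAt (fun r : ℝ => A * (P * (((1 : Matrix (Fin 2) (Fin 2) ℂ) + (r : ℂ) • !![0, I; 0, 0]) * !![0, 0; I, 0])) * B)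
      (A * (P * (!![0, I; 0, 0] * !![0, 0; I, 0])) * B) r := (((hu.mul_const _).const_mul P).const_mul A).mul_const B
  exact h1.clm_apply hw

/-! ## §3 The `H̃`-flow rescales the `N`-factor: `∫_{K×N} F(k·(t_x n e^{sH})·k⁻¹) = e^{2s} • ∫_{K×N} F(k·(t_{x+s} n)·k⁻¹)` -/

include hJ in
/-- **THE `H̃`-FLOW ON THE CHART**: `t_x · n · e^{sH} = t_{x+s} · (e^{−sH} n e^{sH})` and `n ↦ e^{−sH} n e^{sH}` scales `μ_N` by `e^{2s}` (★ `map_conj_eq_smul_two`, module `χ⁻(e^{−2s})⁻¹ = e^{2s}`), so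
for EVERY Banach-valued `F` on the group: **`∫_{K×N} F(k·(t_x n h_s)·k⁻¹) d(κ ⊗ μ_N) = e^{2s} • ∫_{K×N} F(k·(t_{x+s} n)·k⁻¹) d(κ ⊗ μ_N)`**, `t_x = hypBlockGL x θ`, `h_s = hypBlockGL s 0`.
[cite: Varadarajan1989, §6.4] [cite: Rogawski1990, §8.2 p. 119] -/
theorem integral_prod_conj_mul_hypBlockGL_eq_exp_smul [SFinite κ] [IsHaarMeasure μN] (F : ↥(unitaryGroupOfForm (starRingEnd ℂ) J) → E) (x θ s : ℝ) :
    ∫ p : ↥K × ↥(unipotentU (starRingEnd ℂ) J),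
        F ((p.1 : ↥(unitaryGroupOfForm (starRingEnd ℂ) J)) *
          ((⟨hypBlockGL x θ, hypBlockGL_mem_of_eq_over hJ x θ⟩ : ↥(unitaryGroupOfForm (starRingEnd ℂ) J)) * (p.2 : ↥(unitaryGroupOfForm (starRingEnd ℂ) J)) *
            (⟨hypBlockGL s 0, hypBlockGL_mem_of_eq_over hJ s 0⟩ : ↥(unitaryGroupOfForm (starRingEnd ℂ) J))) *
          (p.1 : ↥(unitaryGroupOfForm (starRingEnd ℂ) J))⁻¹) ∂(κ.prod μN) =
      Real.exp (2 * s) • ∫ p : ↥K × ↥(unipotentU (starRingEnd ℂ) J),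
        F ((p.1 : ↥(unitaryGroupOfForm (starRingEnd ℂ) J)) *
          ((⟨hypBlockGL (x + s) θ, hypBlockGL_mem_of_eq_over hJ (x + s) θ⟩ : ↥(unitaryGroupOfForm (starRingEnd ℂ) J)) * (p.2 : ↥(unitaryGroupOfForm (starRingEnd ℂ) J))) *
          (p.1 : ↥(unitaryGroupOfForm (starRingEnd ℂ) J))⁻¹) ∂(κ.prod μN) := by
  haveI : LocallyCompactSpace ↥(unitaryGroupOfForm (starRingEnd ℂ) J) := locallyCompactSpace_unitaryGroupOfForm_complex J
  haveI : SecondCountableTopology ↥(unitaryGroupOfForm (starRingEnd ℂ) J) := secondCountableTopology_unitaryGroupOfForm_complex J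
  have hN : IsClosed (unipotentU (starRingEnd ℂ) J : Set ↥(unitaryGroupOfForm (starRingEnd ℂ) J)) := isClosed_unipotentU _ _
  haveI : LocallyCompactSpace ↥(unipotentU (starRingEnd ℂ) J) := hN.isClosedEmbedding_subtypeVal.locallyCompactSpace
  haveI : SecondCountableTopology ↥(unipotentU (starRingEnd ℂ) J) := TopologicalSpace.Subtype.secondCountableTopology _
  haveI : SecondCountableTopology ↥K := TopologicalSpace.Subtype.secondCountableTopology _
  haveI : BorelSpace ↥(unipotentU (starRingEnd ℂ) J) := Subtype.borelSpace _
  haveI : BorelSpace ↥K := Subtype.borelSpace _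
  haveI : BorelSpace (↥K × ↥(unipotentU (starRingEnd ℂ) J)) := Prod.borelSpace
  -- the torus element `a = h_s` and its data
  set a : ↥(unitaryGroupOfForm (starRingEnd ℂ) J) := ⟨hypBlockGL s 0, hypBlockGL_mem_of_eq_over hJ s 0⟩ with ha
  set t : ↥(unitaryGroupOfForm (starRingEnd ℂ) J) := ⟨hypBlockGL x θ, hypBlockGL_mem_of_eq_over hJ x θ⟩ with htdef
  set t' : ↥(unitaryGroupOfForm (starRingEnd ℂ) J) := ⟨hypBlockGL (x + s) θ, hypBlockGL_mem_of_eq_over hJ (x + s) θ⟩ with ht'def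
  have haT : a ∈ torusU (starRingEnd ℂ) J := hypBlockGL_mem_torusU hJ s 0
  obtain ⟨d, hd, hdd⟩ := exists_glDiagonal_eq_hypBlockGL s 0
  have hd' : glDiagonal 2 ℂ d = (a : GL (Fin 2) ℂ) := hd
  -- `t a = t′`
  have hta : t * a = t' := by
    apply Subtype.ext
    change hypBlockGL x θ * hypBlockGL s 0 = hypBlockGL (x + s) θ
    rw [← hypBlockGL_add, add_zero]
  clear_value a t t'
  -- the module: `χ⁻(e^{−2s})⁻¹ = e^{2s}`
  have hmod : ((skewModulus (starRingEnd ℂ) Complex.continuous_conj ((d 0)⁻¹ * d 1)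
      (map_torusScalar_two (starRingEnd ℂ) hJ ⟨a, haT⟩ hd'))⁻¹ : ℝ≥0) = (Real.exp (2 * s)).toNNReal := by
    rw [skewModulus_conj_eq_nnnorm, hdd]
    apply NNReal.eq
    rw [NNReal.coe_inv, coe_nnnorm, Complex.norm_real, Real.norm_eq_abs, abs_of_pos (Real.exp_pos _), ← Real.exp_neg,
      Real.coe_toNNReal _ (Real.exp_pos _).le]
    congr 1
    ring
  -- the conjugation homeomorphism on the `N` factor of `K × N`
  obtain ⟨c, hc⟩ := LineRing.exists_homeomorph_torusConj (starRingEnd ℂ) (J := J) haT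
  have hce : (c : ↥(unipotentU (starRingEnd ℂ) J) → ↥(unipotentU (starRingEnd ℂ) J)) =
      fun u : ↥(unipotentU (starRingEnd ℂ) J) => (⟨a⁻¹ * u * a, (torus_inv_conj_mem_unipotentU_iff (starRingEnd ℂ) J haT _).2 u.2⟩ :
        ↥(unipotentU (starRingEnd ℂ) J)) := funext hc
  set Ψ : ↥K × ↥(unipotentU (starRingEnd ℂ) J) ≃ₜ ↥K × ↥(unipotentU (starRingEnd ℂ) J) := (Homeomorph.refl ↥K).prodCongr c with hΨ
  have hΨe : (Ψ : ↥K × ↥(unipotentU (starRingEnd ℂ) J) → ↥K × ↥(unipotentU (starRingEnd ℂ) J)) = Prod.map id c := rfl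
  have hmapΨ : (κ.prod μN).map Ψ = (Real.exp (2 * s)).toNNReal • κ.prod μN := by
    rw [hΨe, ← Measure.map_prod_map _ _ measurable_id c.continuous.measurable, Measure.map_id, hce,
      map_conj_eq_smul_two (starRingEnd ℂ) Complex.continuous_conj hJ μN haT hd', hmod, Measure.prod_smul_right]
  have hint := Ψ.measurableEmbedding.integral_map (μ := κ.prod μN)
    (fun p : ↥K × ↥(unipotentU (starRingEnd ℂ) J) => F ((p.1 : ↥(unitaryGroupOfForm (starRingEnd ℂ) J)) *
      (t' * (p.2 : ↥(unitaryGroupOfForm (starRingEnd ℂ) J))) * (p.1 : ↥(unitaryGroupOfForm (starRingEnd ℂ) J))⁻¹))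
  rw [hmapΨ, integral_smul_nnreal_measure] at hint
  have hcG : ∀ u : ↥(unipotentU (starRingEnd ℂ) J), ((c u : ↥(unipotentU (starRingEnd ℂ) J)) : ↥(unitaryGroupOfForm (starRingEnd ℂ) J)) =
      a⁻¹ * (u : ↥(unitaryGroupOfForm (starRingEnd ℂ) J)) * a := fun u => by rw [hc]
  have hcomp : ∀ p : ↥K × ↥(unipotentU (starRingEnd ℂ) J),
      F ((p.1 : ↥(unitaryGroupOfForm (starRingEnd ℂ) J)) * (t * (p.2 : ↥(unitaryGroupOfForm (starRingEnd ℂ) J)) * a) *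
          (p.1 : ↥(unitaryGroupOfForm (starRingEnd ℂ) J))⁻¹) =
        F (((Ψ p).1 : ↥(unitaryGroupOfForm (starRingEnd ℂ) J)) * (t' * ((Ψ p).2 : ↥(unitaryGroupOfForm (starRingEnd ℂ) J))) *
          ((Ψ p).1 : ↥(unitaryGroupOfForm (starRingEnd ℂ) J))⁻¹) := by
    intro p
    rw [hΨe, Prod.map_fst, Prod.map_snd, id, hcG, ← hta]
    exact congrArg F (by group)
  simp_rw [hcomp]
  rw [← hint, NNReal.smul_def, Real.coe_toNNReal _ (Real.exp_pos _).le]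

/-- **`Ω_J = H̃² − 2H̃ − 4ẼF̃˜`, ℝ-BILINEAR (algebraic) FORM** — ★ FILE 1 `casimirJ_bilinear_eq_flows` restated for plain `ℝ`-bilinear `B` and linear `ℓ` (no topology on the maps;
the proof is the same bookkeeping). [cite: Varadarajan1989, §6.3] [cite: Knapp1986, Ch. VIII §5] -/
theorem casimirJ_linearMap₂_eq_flows {E : Type*} [AddCommGroup E] [Module ℝ E] (B : Matrix (Fin 2) (Fin 2) ℂ →ₗ[ℝ] Matrix (Fin 2) (Fin 2) ℂ →ₗ[ℝ] E) (ℓ : Matrix (Fin 2) (Fin 2) ℂ →ₗ[ℝ] E)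
    (Y : Matrix (Fin 2) (Fin 2) ℂ) (hB : B (Y * !![0, I; 0, 0]) (Y * !![0, 0; I, 0]) = B (Y * !![0, 0; I, 0]) (Y * !![0, I; 0, 0])) :
    -(B (Y * !![0, I; I, 0]) (Y * !![0, I; I, 0]) + ℓ (Y * !![0, I; I, 0] * !![0, I; I, 0])) +
        (B (Y * !![1, 0; 0, -1]) (Y * !![1, 0; 0, -1]) + ℓ (Y * !![1, 0; 0, -1] * !![1, 0; 0, -1])) +
        (B (Y * !![0, I; -I, 0]) (Y * !![0, I; -I, 0]) + ℓ (Y * !![0, I; -I, 0] * !![0, I; -I, 0])) =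
      (B (Y * !![1, 0; 0, -1]) (Y * !![1, 0; 0, -1]) + ℓ (Y * !![1, 0; 0, -1] * !![1, 0; 0, -1])) -
        (2 : ℝ) • ℓ (Y * !![1, 0; 0, -1]) -
        (4 : ℝ) • (B (Y * !![0, I; 0, 0]) (Y * !![0, 0; I, 0]) + ℓ (Y * (!![0, I; 0, 0] * !![0, 0; I, 0]))) := by
  rw [mul_splitFrame_Y₁_mul_Y₁, mul_splitFrame_H_mul_H, mul_splitFrame_Y₃_mul_Y₃, mul_splitFrame_H_eq Y]
  have h1 : Y * !![0, I; I, 0] = Y * !![0, I; 0, 0] + Y * !![0, 0; I, 0] := by rw [← Matrix.mul_add, ← splitFrame_Y₁_eq_add]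
  have h3 : Y * !![0, I; -I, 0] = Y * !![0, I; 0, 0] - Y * !![0, 0; I, 0] := by rw [← Matrix.mul_sub, ← splitFrame_Y₃_eq_sub]
  have hH : B (-Y - (2 : ℝ) • (Y * (!![0, I; 0, 0] * !![0, 0; I, 0]))) (-Y - (2 : ℝ) • (Y * (!![0, I; 0, 0] * !![0, 0; I, 0]))) =
      B (Y * !![1, 0; 0, -1]) (Y * !![1, 0; 0, -1]) := by rw [← mul_splitFrame_H_eq Y]
  rw [hH, h1, h3]
  simp only [map_add, map_sub, map_neg, map_smul, LinearMap.add_apply, LinearMap.sub_apply]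
  rw [← hB]
  module

/-! ## §4 Pointwise: the Casimir at a conjugated point `Y = k·W·k⁻¹` (`k ∈ U(J)`) in the ROTATED flow form `H̃² − 2H̃ − 4ẼF̃˜` read inside the chart -/

omit [MeasurableSpace ↥(unitaryGroupOfForm (starRingEnd ℂ) J)] [BorelSpace ↥(unitaryGroupOfForm (starRingEnd ℂ) J)] in
include hJ in
/-- **THE CASIMIR AT `Y = k W k⁻¹` THROUGH THE CHART** (`k ∈ U(J)`, `W` any matrix, `g ∈ C^∞`): with `C = ↑k`, `C′ = ↑k⁻¹`,
`(Ω_J g)(C W C′) = (D²g[C W H C′, C W H C′] + Dg[C W H² C′]) − 2•Dg[C W H C′] − 4•(D²g[C W E C′, C W F̃ C′] + Dg[C W (EF̃) C′])` (all derivatives at `Y`): the left-invariant fields at `Y`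
are `Y·Xᵢ = C W (Ad(k⁻¹)Xᵢ) C′`, `Ω_J` is `Ad(U(J))`-invariant (★ FILE 1 `casimirJ_conj_eq_of_mem`, `casimirJ_firstOrder_conj_eq`), and then ★ `casimirJ_bilinear_eq_flows` at the point `W`
for the transported bilinear map `(U,V) ↦ D²g(Y)[C U C′, C V C′]`. [cite: Varadarajan1989, §6.3] [cite: Hall2015, §3.6, Prop. 3.24] -/
theorem casimirJ_apply_conj_eq_flows {g : Matrix (Fin 2) (Fin 2) ℂ → E} (hg : ContDiff ℝ ∞ g)
    {Ω : (Matrix (Fin 2) (Fin 2) ℂ → E) → Matrix (Fin 2) (Fin 2) ℂ → E}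
    (hΩ : ∀ (g : Matrix (Fin 2) (Fin 2) ℂ → E) (Y : Matrix (Fin 2) (Fin 2) ℂ), Ω g Y =
      -(fderiv ℝ (fderiv ℝ g) Y (Y * !![0, I; I, 0]) (Y * !![0, I; I, 0]) + fderiv ℝ g Y (Y * !![0, I; I, 0] * !![0, I; I, 0])) +
        (fderiv ℝ (fderiv ℝ g) Y (Y * !![1, 0; 0, -1]) (Y * !![1, 0; 0, -1]) + fderiv ℝ g Y (Y * !![1, 0; 0, -1] * !![1, 0; 0, -1])) +
        (fderiv ℝ (fderiv ℝ g) Y (Y * !![0, I; -I, 0]) (Y * !![0, I; -I, 0]) + fderiv ℝ g Y (Y * !![0, I; -I, 0] * !![0, I; -I, 0])))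
    (k : ↥(unitaryGroupOfForm (starRingEnd ℂ) J)) (W : Matrix (Fin 2) (Fin 2) ℂ) :
    Ω g (((k : GL (Fin 2) ℂ) : Matrix (Fin 2) (Fin 2) ℂ) * W * (((k⁻¹ : ↥(unitaryGroupOfForm (starRingEnd ℂ) J)) : GL (Fin 2) ℂ) : Matrix (Fin 2) (Fin 2) ℂ)) =
      (fderiv ℝ (fderiv ℝ g) (((k : GL (Fin 2) ℂ) : Matrix (Fin 2) (Fin 2) ℂ) * W * (((k⁻¹ : ↥(unitaryGroupOfForm (starRingEnd ℂ) J)) : GL (Fin 2) ℂ) : Matrix (Fin 2) (Fin 2) ℂ))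
          (((k : GL (Fin 2) ℂ) : Matrix (Fin 2) (Fin 2) ℂ) * (W * !![1, 0; 0, -1]) * (((k⁻¹ : ↥(unitaryGroupOfForm (starRingEnd ℂ) J)) : GL (Fin 2) ℂ) : Matrix (Fin 2) (Fin 2) ℂ))
          (((k : GL (Fin 2) ℂ) : Matrix (Fin 2) (Fin 2) ℂ) * (W * !![1, 0; 0, -1]) * (((k⁻¹ : ↥(unitaryGroupOfForm (starRingEnd ℂ) J)) : GL (Fin 2) ℂ) : Matrix (Fin 2) (Fin 2) ℂ)) +
        fderiv ℝ g (((k : GL (Fin 2) ℂ) : Matrix (Fin 2) (Fin 2) ℂ) * W * (((k⁻¹ : ↥(unitaryGroupOfForm (starRingEnd ℂ) J)) : GL (Fin 2) ℂ) : Matrix (Fin 2) (Fin 2) ℂ))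
          (((k : GL (Fin 2) ℂ) : Matrix (Fin 2) (Fin 2) ℂ) * (W * !![1, 0; 0, -1] * !![1, 0; 0, -1]) * (((k⁻¹ : ↥(unitaryGroupOfForm (starRingEnd ℂ) J)) : GL (Fin 2) ℂ) : Matrix (Fin 2) (Fin 2) ℂ))) -
      (2 : ℝ) • fderiv ℝ g (((k : GL (Fin 2) ℂ) : Matrix (Fin 2) (Fin 2) ℂ) * W * (((k⁻¹ : ↥(unitaryGroupOfForm (starRingEnd ℂ) J)) : GL (Fin 2) ℂ) : Matrix (Fin 2) (Fin 2) ℂ))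
          (((k : GL (Fin 2) ℂ) : Matrix (Fin 2) (Fin 2) ℂ) * (W * !![1, 0; 0, -1]) * (((k⁻¹ : ↥(unitaryGroupOfForm (starRingEnd ℂ) J)) : GL (Fin 2) ℂ) : Matrix (Fin 2) (Fin 2) ℂ)) -
      (4 : ℝ) • (fderiv ℝ (fderiv ℝ g) (((k : GL (Fin 2) ℂ) : Matrix (Fin 2) (Fin 2) ℂ) * W * (((k⁻¹ : ↥(unitaryGroupOfForm (starRingEnd ℂ) J)) : GL (Fin 2) ℂ) : Matrix (Fin 2) (Fin 2) ℂ))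
          (((k : GL (Fin 2) ℂ) : Matrix (Fin 2) (Fin 2) ℂ) * (W * !![0, I; 0, 0]) * (((k⁻¹ : ↥(unitaryGroupOfForm (starRingEnd ℂ) J)) : GL (Fin 2) ℂ) : Matrix (Fin 2) (Fin 2) ℂ))
          (((k : GL (Fin 2) ℂ) : Matrix (Fin 2) (Fin 2) ℂ) * (W * !![0, 0; I, 0]) * (((k⁻¹ : ↥(unitaryGroupOfForm (starRingEnd ℂ) J)) : GL (Fin 2) ℂ) : Matrix (Fin 2) (Fin 2) ℂ)) +
        fderiv ℝ g (((k : GL (Fin 2) ℂ) : Matrix (Fin 2) (Fin 2) ℂ) * W * (((k⁻¹ : ↥(unitaryGroupOfForm (starRingEnd ℂ) J)) : GL (Fin 2) ℂ) : Matrix (Fin 2) (Fin 2) ℂ))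
          (((k : GL (Fin 2) ℂ) : Matrix (Fin 2) (Fin 2) ℂ) * (W * (!![0, I; 0, 0] * !![0, 0; I, 0])) * (((k⁻¹ : ↥(unitaryGroupOfForm (starRingEnd ℂ) J)) : GL (Fin 2) ℂ) : Matrix (Fin 2) (Fin 2) ℂ))) := by
  -- names
  set C : Matrix (Fin 2) (Fin 2) ℂ := ((k : GL (Fin 2) ℂ) : Matrix (Fin 2) (Fin 2) ℂ) with hCdef
  set C' : Matrix (Fin 2) (Fin 2) ℂ := (((k⁻¹ : ↥(unitaryGroupOfForm (starRingEnd ℂ) J)) : GL (Fin 2) ℂ) : Matrix (Fin 2) (Fin 2) ℂ) with hC'def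
  have hC'val : C' = (((k : GL (Fin 2) ℂ)⁻¹ : GL (Fin 2) ℂ) : Matrix (Fin 2) (Fin 2) ℂ) := by rw [hC'def, Subgroup.coe_inv]
  have hCC' : C * C' = 1 := by rw [hC'val, hCdef, ← Units.val_mul, mul_inv_cancel, Units.val_one]
  set Y : Matrix (Fin 2) (Fin 2) ℂ := C * W * C' with hYdef
  -- `k′ = k⁻¹` in `GL₂(ℂ)`: `↑k′ = C′`, `↑k′⁻¹ = C`
  have hk' : ((k : GL (Fin 2) ℂ)⁻¹ : GL (Fin 2) ℂ) ∈ unitaryGroupOfForm (starRingEnd ℂ) J := (k⁻¹ : ↥(unitaryGroupOfForm (starRingEnd ℂ) J)).2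
  have hk'val : ((((k : GL (Fin 2) ℂ)⁻¹ : GL (Fin 2) ℂ)) : Matrix (Fin 2) (Fin 2) ℂ) = C' := hC'val.symm
  have hk'inv : (((((k : GL (Fin 2) ℂ)⁻¹ : GL (Fin 2) ℂ))⁻¹ : GL (Fin 2) ℂ) : Matrix (Fin 2) (Fin 2) ℂ) = C := by rw [inv_inv]
  -- the fields at `Y`: `Y X = C W (C′ X C) C′`, `Y X X = C W ((C′XC)(C′XC)) C′`
  have hrot : ∀ X : Matrix (Fin 2) (Fin 2) ℂ, Y * X = C * W * (C' * X * C) * C' := fun X => by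
    calc Y * X = C * W * C' * X * (C * C') := by rw [hCC', Matrix.mul_one]
      _ = C * W * (C' * X * C) * C' := by simp only [Matrix.mul_assoc]
  have hrot2 : ∀ X : Matrix (Fin 2) (Fin 2) ℂ, Y * X * X = C * W * ((C' * X * C) * (C' * X * C)) * C' := fun X => by
    calc Y * X * X = C * W * C' * X * (C * C') * X * (C * C') := by rw [hCC', Matrix.mul_one, Matrix.mul_one]
      _ = C * W * ((C' * X * C) * (C' * X * C)) * C' := by simp only [Matrix.mul_assoc]
  rw [hΩ, hrot2 !![0, I; I, 0], hrot2 !![1, 0; 0, -1], hrot2 !![0, I; -I, 0], hrot !![0, I; I, 0], hrot !![1, 0; 0, -1], hrot !![0, I; -I, 0]]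
  -- §3 of FILE 1 (invariance), second order: `B(U,V) = D²g(Y)[C W U C′, C W V C′]`
  set B : Matrix (Fin 2) (Fin 2) ℂ →ₗ[ℝ] Matrix (Fin 2) (Fin 2) ℂ →ₗ[ℝ] E := LinearMap.mk₂ ℝ
      (fun U V : Matrix (Fin 2) (Fin 2) ℂ => fderiv ℝ (fderiv ℝ g) Y (C * W * U * C') (C * W * V * C'))
      (fun U₁ U₂ V => by simp only [Matrix.mul_add, Matrix.add_mul, map_add, _root_.add_apply])
      (fun c U V => by simp only [Matrix.mul_smul, Matrix.smul_mul, map_smul, _root_.smul_apply])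
      (fun U V₁ V₂ => by simp only [Matrix.mul_add, Matrix.add_mul, map_add])
      (fun c U V => by simp only [Matrix.mul_smul, Matrix.smul_mul, map_smul]) with hBdef
  have hB : ∀ U V : Matrix (Fin 2) (Fin 2) ℂ, B U V = fderiv ℝ (fderiv ℝ g) Y (C * W * U * C') (C * W * V * C') := fun U V => rfl
  have hinv := casimirJ_conj_eq_of_mem hJ B hk'
  simp only [hB, hk'val, hk'inv] at hinv
  -- first order: `ℓ(Z) = Dg(Y)[Z C′]`, `W′ = C W`
  set ℓ : Matrix (Fin 2) (Fin 2) ℂ →ₗ[ℝ] E := (fderiv ℝ g Y : Matrix (Fin 2) (Fin 2) ℂ →L[ℝ] E).toLinearMap ∘ₗ LinearMap.mulRight ℝ C' with hℓdef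
  have hℓ : ∀ Z : Matrix (Fin 2) (Fin 2) ℂ, ℓ Z = fderiv ℝ g Y (Z * C') := fun Z => rfl
  have hfirst := casimirJ_firstOrder_conj_eq ℓ ((k : GL (Fin 2) ℂ)⁻¹) (C * W)
  simp only [hℓ, hk'val, hk'inv] at hfirst
  have hW1 : ∀ X : Matrix (Fin 2) (Fin 2) ℂ, C * W * (C' * X * C) * (C' * X * C) * C' = C * W * ((C' * X * C) * (C' * X * C)) * C' := fun X => by
    simp only [Matrix.mul_assoc]
  have hW2 : ∀ X : Matrix (Fin 2) (Fin 2) ℂ, C * W * X * X * C' = C * W * (X * X) * C' := fun X => by simp only [Matrix.mul_assoc]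
  simp only [hW1, hW2] at hfirst
  rw [show -(fderiv ℝ (fderiv ℝ g) Y (C * W * (C' * !![0, I; I, 0] * C) * C') (C * W * (C' * !![0, I; I, 0] * C) * C') +
          fderiv ℝ g Y (C * W * ((C' * !![0, I; I, 0] * C) * (C' * !![0, I; I, 0] * C)) * C')) +
        (fderiv ℝ (fderiv ℝ g) Y (C * W * (C' * !![1, 0; 0, -1] * C) * C') (C * W * (C' * !![1, 0; 0, -1] * C) * C') +
          fderiv ℝ g Y (C * W * ((C' * !![1, 0; 0, -1] * C) * (C' * !![1, 0; 0, -1] * C)) * C')) +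
        (fderiv ℝ (fderiv ℝ g) Y (C * W * (C' * !![0, I; -I, 0] * C) * C') (C * W * (C' * !![0, I; -I, 0] * C) * C') +
          fderiv ℝ g Y (C * W * ((C' * !![0, I; -I, 0] * C) * (C' * !![0, I; -I, 0] * C)) * C')) =
      (-(fderiv ℝ (fderiv ℝ g) Y (C * W * (C' * !![0, I; I, 0] * C) * C') (C * W * (C' * !![0, I; I, 0] * C) * C')) +
          fderiv ℝ (fderiv ℝ g) Y (C * W * (C' * !![1, 0; 0, -1] * C) * C') (C * W * (C' * !![1, 0; 0, -1] * C) * C') +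
          fderiv ℝ (fderiv ℝ g) Y (C * W * (C' * !![0, I; -I, 0] * C) * C') (C * W * (C' * !![0, I; -I, 0] * C) * C')) +
        (-(fderiv ℝ g Y (C * W * ((C' * !![0, I; I, 0] * C) * (C' * !![0, I; I, 0] * C)) * C')) +
          fderiv ℝ g Y (C * W * ((C' * !![1, 0; 0, -1] * C) * (C' * !![1, 0; 0, -1] * C)) * C') +
          fderiv ℝ g Y (C * W * ((C' * !![0, I; -I, 0] * C) * (C' * !![0, I; -I, 0] * C)) * C')) by abel,
    hinv, hfirst]
  -- §2 (flows) at the point `W` for `B̂(U,V) = D²g(Y)[C U C′, C V C′]`, `ℓ̂(Z) = Dg(Y)[C Z C′]`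
  set Bh : Matrix (Fin 2) (Fin 2) ℂ →ₗ[ℝ] Matrix (Fin 2) (Fin 2) ℂ →ₗ[ℝ] E := LinearMap.mk₂ ℝ
      (fun U V : Matrix (Fin 2) (Fin 2) ℂ => fderiv ℝ (fderiv ℝ g) Y (C * U * C') (C * V * C'))
      (fun U₁ U₂ V => by simp only [Matrix.mul_add, Matrix.add_mul, map_add, _root_.add_apply])
      (fun c U V => by simp only [Matrix.mul_smul, Matrix.smul_mul, map_smul, _root_.smul_apply])
      (fun U V₁ V₂ => by simp only [Matrix.mul_add, Matrix.add_mul, map_add])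
      (fun c U V => by simp only [Matrix.mul_smul, Matrix.smul_mul, map_smul]) with hBhdef
  have hBh : ∀ U V : Matrix (Fin 2) (Fin 2) ℂ, Bh U V = fderiv ℝ (fderiv ℝ g) Y (C * U * C') (C * V * C') := fun U V => rfl
  set ℓh : Matrix (Fin 2) (Fin 2) ℂ →ₗ[ℝ] E := (fderiv ℝ g Y : Matrix (Fin 2) (Fin 2) ℂ →L[ℝ] E).toLinearMap ∘ₗ ((LinearMap.mulLeft ℝ C).comp (LinearMap.mulRight ℝ C')) with hℓhdef
  have hℓh : ∀ Z : Matrix (Fin 2) (Fin 2) ℂ, ℓh Z = fderiv ℝ g Y (C * Z * C') := fun Z => by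
    show fderiv ℝ g Y (C * (Z * C')) = _
    rw [Matrix.mul_assoc]
  have hsymm : Bh (W * !![0, I; 0, 0]) (W * !![0, 0; I, 0]) = Bh (W * !![0, 0; I, 0]) (W * !![0, I; 0, 0]) := by
    rw [hBh, hBh]
    exact ((contDiff_infty.1 hg 2).contDiffAt.isSymmSndFDerivAt (by simp)).eq _ _
  have hflow := casimirJ_linearMap₂_eq_flows Bh ℓh W hsymm
  simp only [hBh, hℓh] at hflow
  have hW3 : ∀ X : Matrix (Fin 2) (Fin 2) ℂ, C * (W * X) * C' = C * W * X * C' := fun X => by simp only [Matrix.mul_assoc]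
  have hW4 : ∀ X : Matrix (Fin 2) (Fin 2) ℂ, C * (W * X * X) * C' = C * W * (X * X) * C' := fun X => by simp only [Matrix.mul_assoc]
  rw [← hW4 !![0, I; I, 0], ← hW4 !![1, 0; 0, -1], ← hW4 !![0, I; -I, 0], ← hW3 !![0, I; I, 0], ← hW3 !![1, 0; 0, -1], ← hW3 !![0, I; -I, 0]]
  linear_combination (norm := module) hflow

/-! ## §5 HEAD: the radial equation on the full-torus chart `Ψ_{Ωg} = Ψ_g″ + 2Ψ_g′` and on ★ p850603's half chart `Λ_{Ωg} = Λ_g″ − Λ_g` -/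

set_option maxHeartbeats 1600000 in
include hJ in
/-- **HARISH-CHANDRA'S RADIAL EQUATION ON THE SPLIT TORUS, FULL-TORUS CHART.**  `K ≤ U(J)` compact, `κ`, `μ_N` Haar, `g ∈ C_c^∞(M₂(ℂ), E)`, `Ω` the split-frame Casimir (`hΩ`), `θ`
fixed; `Ψ_g(x) = ∫_{K×N} g(k·(t_x n)·k⁻¹)`, `t_x = hypBlockGL x θ`.  Then `Ψ_g ∈ C^∞(ℝ)` and **`Ψ_{Ωg}(x) = Ψ_g″(x) + 2 Ψ_g′(x)` for EVERY `x`** (no singular set): by §4 at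
`W = t_x n` the integrand `(Ωg)(k t_x n k⁻¹)` is `H̃² − 2H̃ − 4ẼF̃˜` read inside the chart; the `Ẽ`-term is the `r`-derivative at `0` of `∫ Dg(k t_x n u_r k⁻¹)[k t_x n u_r F̃ k⁻¹]`,
which is CONSTANT in `r` (`n u_r`, right-invariance of `μ_N`), hence `0`; the `H̃`-terms are the first two `s`-derivatives at `0` of `∫ g(k t_x n e^{sH} k⁻¹) = e^{2s} Ψ_g(x+s)`
(§3), i.e. `Ψ′ + 2Ψ` and `Ψ″ + 4Ψ′ + 4Ψ`; total `(Ψ″ + 4Ψ′ + 4Ψ) − 2(Ψ′ + 2Ψ) = Ψ″ + 2Ψ′`.  `Ψ, Ψ_Ω` are bound functions with their defining hypotheses.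
[cite: Varadarajan1989, §6.4 Thm 23] [cite: Knapp1986, Ch. VIII §5] [cite: Rogawski1990, §8.2 p. 119] -/
theorem casimir_integral_prod_conj_hypBlockGL_eq (hK : IsCompact (K : Set ↥(unitaryGroupOfForm (starRingEnd ℂ) J))) [IsHaarMeasure κ] [IsHaarMeasure μN]
    {g : Matrix (Fin 2) (Fin 2) ℂ → E} (hg : ContDiff ℝ ∞ g) (hgc : HasCompactSupport g)
    {Ω : (Matrix (Fin 2) (Fin 2) ℂ → E) → Matrix (Fin 2) (Fin 2) ℂ → E}
    (hΩ : ∀ (g : Matrix (Fin 2) (Fin 2) ℂ → E) (Y : Matrix (Fin 2) (Fin 2) ℂ), Ω g Y =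
      -(fderiv ℝ (fderiv ℝ g) Y (Y * !![0, I; I, 0]) (Y * !![0, I; I, 0]) + fderiv ℝ g Y (Y * !![0, I; I, 0] * !![0, I; I, 0])) +
        (fderiv ℝ (fderiv ℝ g) Y (Y * !![1, 0; 0, -1]) (Y * !![1, 0; 0, -1]) + fderiv ℝ g Y (Y * !![1, 0; 0, -1] * !![1, 0; 0, -1])) +
        (fderiv ℝ (fderiv ℝ g) Y (Y * !![0, I; -I, 0]) (Y * !![0, I; -I, 0]) + fderiv ℝ g Y (Y * !![0, I; -I, 0] * !![0, I; -I, 0])))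
    (θ : ℝ) {Ψ ΨΩ : ℝ → E}
    (hΨ : ∀ x : ℝ, Ψ x = ∫ p : ↥K × ↥(unipotentU (starRingEnd ℂ) J), g (((((p.1 : ↥K) : ↥(unitaryGroupOfForm (starRingEnd ℂ) J)) * ((⟨hypBlockGL x θ, hypBlockGL_mem_of_eq_over hJ x θ⟩ : ↥(unitaryGroupOfForm (starRingEnd ℂ) J)) * ((p.2 : ↥(unipotentU (starRingEnd ℂ) J)) : ↥(unitaryGroupOfForm (starRingEnd ℂ) J))) * ((p.1 : ↥K) : ↥(unitaryGroupOfForm (starRingEnd ℂ) J))⁻¹ : ↥(unitaryGroupOfForm (starRingEnd ℂ) J)) : GL (Fin 2) ℂ) : Matrix (Fin 2) (Fin 2) ℂ) ∂(κ.prod μN))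
    (hΨΩ : ∀ x : ℝ, ΨΩ x = ∫ p : ↥K × ↥(unipotentU (starRingEnd ℂ) J), Ω g (((((p.1 : ↥K) : ↥(unitaryGroupOfForm (starRingEnd ℂ) J)) * ((⟨hypBlockGL x θ, hypBlockGL_mem_of_eq_over hJ x θ⟩ : ↥(unitaryGroupOfForm (starRingEnd ℂ) J)) * ((p.2 : ↥(unipotentU (starRingEnd ℂ) J)) : ↥(unitaryGroupOfForm (starRingEnd ℂ) J))) * ((p.1 : ↥K) : ↥(unitaryGroupOfForm (starRingEnd ℂ) J))⁻¹ : ↥(unitaryGroupOfForm (starRingEnd ℂ) J)) : GL (Fin 2) ℂ) : Matrix (Fin 2) (Fin 2) ℂ) ∂(κ.prod μN)) :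
    ContDiff ℝ ∞ Ψ ∧ ∀ x : ℝ, ΨΩ x = deriv (deriv Ψ) x + (2 : ℝ) • deriv Ψ x := by
  haveI : LocallyCompactSpace ↥(unitaryGroupOfForm (starRingEnd ℂ) J) := locallyCompactSpace_unitaryGroupOfForm_complex J
  haveI : SecondCountableTopology ↥(unitaryGroupOfForm (starRingEnd ℂ) J) := secondCountableTopology_unitaryGroupOfForm_complex J
  have hN : IsClosed (unipotentU (starRingEnd ℂ) J : Set ↥(unitaryGroupOfForm (starRingEnd ℂ) J)) := isClosed_unipotentU _ _
  haveI : LocallyCompactSpace ↥(unipotentU (starRingEnd ℂ) J) := hN.isClosedEmbedding_subtypeVal.locallyCompactSpace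
  haveI : SecondCountableTopology ↥(unipotentU (starRingEnd ℂ) J) := TopologicalSpace.Subtype.secondCountableTopology _
  haveI : SecondCountableTopology ↥K := TopologicalSpace.Subtype.secondCountableTopology _
  haveI : BorelSpace ↥(unipotentU (starRingEnd ℂ) J) := Subtype.borelSpace _
  haveI : BorelSpace ↥K := Subtype.borelSpace _
  haveI : BorelSpace (↥K × ↥(unipotentU (starRingEnd ℂ) J)) := Prod.borelSpace
  haveI : CompactSpace ↥K := isCompact_iff_compactSpace.1 hK
  haveI : LocallyCompactSpace ↥K := hK.isClosed.isClosedEmbedding_subtypeVal.locallyCompactSpace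
  -- data
  have hg' := (contDiff_infty_iff_fderiv.1 hg).2
  have hgcont : Continuous g := hg.continuous
  have hDgcont := hg'.continuous
  have hS₀ : IsCompact {u : ↥(unitaryGroupOfForm (starRingEnd ℂ) J) | ((u : GL (Fin 2) ℂ) : Matrix (Fin 2) (Fin 2) ℂ) ∈ tsupport g} :=
    (isClosedEmbedding_coe_unitaryGroupOfForm_of_eq_over hJ).isCompact_preimage hgc
  -- group curves: the torus `tU`, the boost `hB`, the unipotent line `uN`
  obtain ⟨tU, htU⟩ : ∃ tU : ℝ → ↥(unitaryGroupOfForm (starRingEnd ℂ) J), tU = fun y => ⟨hypBlockGL y θ, hypBlockGL_mem_of_eq_over hJ y θ⟩ := ⟨_, rfl⟩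
  have htUc : Continuous tU := by rw [htU]; exact (continuous_hypBlockGL.comp (continuous_id.prodMk continuous_const)).subtype_mk _
  have htUval : ∀ y, ((tU y : GL (Fin 2) ℂ) : Matrix (Fin 2) (Fin 2) ℂ) = ((hypBlockGL y θ : GL (Fin 2) ℂ) : Matrix (Fin 2) (Fin 2) ℂ) := fun y => by rw [htU]
  obtain ⟨hB, hhB⟩ : ∃ hB : ℝ → ↥(unitaryGroupOfForm (starRingEnd ℂ) J), hB = fun s => ⟨hypBlockGL s 0, hypBlockGL_mem_of_eq_over hJ s 0⟩ := ⟨_, rfl⟩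
  have hhBc : Continuous hB := by rw [hhB]; exact (continuous_hypBlockGL.comp (continuous_id.prodMk continuous_const)).subtype_mk _
  have hhBval : ∀ s : ℝ, ((hB s : GL (Fin 2) ℂ) : Matrix (Fin 2) (Fin 2) ℂ) = Complex.cosh (s : ℂ) • (1 : Matrix (Fin 2) (Fin 2) ℂ) + Complex.sinh (s : ℂ) • !![1, 0; 0, -1] := fun s => by
    rw [hhB]; exact coe_hypBlockGL_zero_eq_boost s
  obtain ⟨eN, heN01, -⟩ := LineRing.exists_lineChart (starRingEnd ℂ) hJ
  have hsk : ∀ r : ℝ, ((r : ℂ) * I) ∈ HeisRing.skewPart (starRingEnd ℂ) := fun r => by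
    rw [HeisRing.mem_skewPart_iff, map_mul, Complex.conj_ofReal, Complex.conj_I, mul_neg]
  obtain ⟨uN, huN⟩ : ∃ uN : ℝ → ↥(unipotentU (starRingEnd ℂ) J), uN = fun r : ℝ => eN ⟨(r : ℂ) * I, hsk r⟩ := ⟨_, rfl⟩
  have huNc : Continuous fun r : ℝ => ((uN r : ↥(unipotentU (starRingEnd ℂ) J)) : ↥(unitaryGroupOfForm (starRingEnd ℂ) J)) := by
    rw [huN]
    exact continuous_subtype_val.comp (eN.continuous.comp ((Complex.continuous_ofReal.mul continuous_const).subtype_mk _))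
  have huNval : ∀ r : ℝ, ((((uN r : ↥(unipotentU (starRingEnd ℂ) J)) : ↥(unitaryGroupOfForm (starRingEnd ℂ) J)) : GL (Fin 2) ℂ) : Matrix (Fin 2) (Fin 2) ℂ) = (1 : Matrix (Fin 2) (Fin 2) ℂ) + (r : ℂ) • !![0, I; 0, 0] := fun r => by
    obtain ⟨h10, h00, h11⟩ := LineRing.umat_shape_two (starRingEnd ℂ) (uN r)
    have h01 : ((((uN r : ↥(unipotentU (starRingEnd ℂ) J)) : ↥(unitaryGroupOfForm (starRingEnd ℂ) J)) : GL (Fin 2) ℂ) : Matrix (Fin 2) (Fin 2) ℂ) 0 1 = (r : ℂ) * I := by rw [huN]; exact heN01 _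
    ext i j; fin_cases i <;> fin_cases j <;> simp [h10, h00, h11, h01]
  -- the coercion of a conjugate: `↑(k·(u n v)·k⁻¹) = ↑k·(↑u ↑n ↑v)·↑k⁻¹`, `↑(k·(u n)·k⁻¹) = ↑k·(↑u ↑n)·↑k⁻¹`
  have hcoe3 : ∀ (p : ↥K × ↥(unipotentU (starRingEnd ℂ) J)) (u v : ↥(unitaryGroupOfForm (starRingEnd ℂ) J)), (((((p.1 : ↥K) : ↥(unitaryGroupOfForm (starRingEnd ℂ) J)) * (u * ((p.2 : ↥(unipotentU (starRingEnd ℂ) J)) : ↥(unitaryGroupOfForm (starRingEnd ℂ) J)) * v) * ((p.1 : ↥K) : ↥(unitaryGroupOfForm (starRingEnd ℂ) J))⁻¹ : ↥(unitaryGroupOfForm (starRingEnd ℂ) J)) : GL (Fin 2) ℂ) : Matrix (Fin 2) (Fin 2) ℂ) =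
      ((((p.1 : ↥K) : ↥(unitaryGroupOfForm (starRingEnd ℂ) J)) : GL (Fin 2) ℂ) : Matrix (Fin 2) (Fin 2) ℂ) * (((u : GL (Fin 2) ℂ) : Matrix (Fin 2) (Fin 2) ℂ) * ((((p.2 : ↥(unipotentU (starRingEnd ℂ) J)) : ↥(unitaryGroupOfForm (starRingEnd ℂ) J)) : GL (Fin 2) ℂ) : Matrix (Fin 2) (Fin 2) ℂ) * ((v : GL (Fin 2) ℂ) : Matrix (Fin 2) (Fin 2) ℂ)) * (((((p.1 : ↥K) : ↥(unitaryGroupOfForm (starRingEnd ℂ) J))⁻¹ : ↥(unitaryGroupOfForm (starRingEnd ℂ) J)) : GL (Fin 2) ℂ) : Matrix (Fin 2) (Fin 2) ℂ) := fun p u v => by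
    simp only [Subgroup.coe_mul, Units.val_mul]
  have hcoe2 : ∀ (p : ↥K × ↥(unipotentU (starRingEnd ℂ) J)) (u : ↥(unitaryGroupOfForm (starRingEnd ℂ) J)), (((((p.1 : ↥K) : ↥(unitaryGroupOfForm (starRingEnd ℂ) J)) * (u * ((p.2 : ↥(unipotentU (starRingEnd ℂ) J)) : ↥(unitaryGroupOfForm (starRingEnd ℂ) J))) * ((p.1 : ↥K) : ↥(unitaryGroupOfForm (starRingEnd ℂ) J))⁻¹ : ↥(unitaryGroupOfForm (starRingEnd ℂ) J)) : GL (Fin 2) ℂ) : Matrix (Fin 2) (Fin 2) ℂ) =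
      ((((p.1 : ↥K) : ↥(unitaryGroupOfForm (starRingEnd ℂ) J)) : GL (Fin 2) ℂ) : Matrix (Fin 2) (Fin 2) ℂ) * (((u : GL (Fin 2) ℂ) : Matrix (Fin 2) (Fin 2) ℂ) * ((((p.2 : ↥(unipotentU (starRingEnd ℂ) J)) : ↥(unitaryGroupOfForm (starRingEnd ℂ) J)) : GL (Fin 2) ℂ) : Matrix (Fin 2) (Fin 2) ℂ)) * (((((p.1 : ↥K) : ↥(unitaryGroupOfForm (starRingEnd ℂ) J))⁻¹ : ↥(unitaryGroupOfForm (starRingEnd ℂ) J)) : GL (Fin 2) ℂ) : Matrix (Fin 2) (Fin 2) ℂ) := fun p u => by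
    simp only [Subgroup.coe_mul, Units.val_mul]
  -- vanishing off the support (g and Dg)
  have hvan : ∀ (Z : Matrix (Fin 2) (Fin 2) ℂ) (w : ↥(unitaryGroupOfForm (starRingEnd ℂ) J)), ((w : GL (Fin 2) ℂ) : Matrix (Fin 2) (Fin 2) ℂ) = Z → w ∉ {u : ↥(unitaryGroupOfForm (starRingEnd ℂ) J) | ((u : GL (Fin 2) ℂ) : Matrix (Fin 2) (Fin 2) ℂ) ∈ tsupport g} →
      g Z = 0 ∧ fderiv ℝ g Z = 0 := fun Z w hwZ hw => by
    have hZ : Z ∉ tsupport g := by rw [← hwZ]; exact hw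
    obtain ⟨h0, h1, -⟩ := ConjugationCurve.eq_zero_of_notMem_tsupport g hZ
    exact ⟨h0, h1⟩
  ------------------------------------------------------------------
  -- (Ψ) smoothness of `Ψ`
  ------------------------------------------------------------------
  have hΨfun : Ψ = fun y : ℝ => ∫ p : ↥K × ↥(unipotentU (starRingEnd ℂ) J), g (((((p.1 : ↥K) : ↥(unitaryGroupOfForm (starRingEnd ℂ) J)) : GL (Fin 2) ℂ) : Matrix (Fin 2) (Fin 2) ℂ) * (((hypBlockGL y θ : GL (Fin 2) ℂ) : Matrix (Fin 2) (Fin 2) ℂ) * ((((p.2 : ↥(unipotentU (starRingEnd ℂ) J)) : ↥(unitaryGroupOfForm (starRingEnd ℂ) J)) : GL (Fin 2) ℂ) : Matrix (Fin 2) (Fin 2) ℂ)) * (((((p.1 : ↥K) : ↥(unitaryGroupOfForm (starRingEnd ℂ) J))⁻¹ : ↥(unitaryGroupOfForm (starRingEnd ℂ) J)) : GL (Fin 2) ℂ) : Matrix (Fin 2) (Fin 2) ℂ)) ∂(κ.prod μN) := by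
    funext y; rw [hΨ]; exact integral_congr_ae (Eventually.of_forall fun p => by show g _ = g _; rw [hcoe2])
  have hTsm : ContDiff ℝ ∞ fun y : ℝ => ((hypBlockGL y θ : GL (Fin 2) ℂ) : Matrix (Fin 2) (Fin 2) ℂ) := contDiff_coe_hypBlockGL.comp (contDiff_id.prodMk contDiff_const)
  have hΨsm : ContDiff ℝ ∞ Ψ := by
    rw [hΨfun]
    refine contDiff_iff_contDiffAt.2 fun y₀ => ?_
    obtain ⟨s, hs, hsupp⟩ := exists_isCompact_carrier_conj hK tU (fun _ => (1 : ↥(unitaryGroupOfForm (starRingEnd ℂ) J))) htUc continuous_const hS₀ y₀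
    have hΦ : ContDiff ℝ ∞ fun q : (Matrix (Fin 2) (Fin 2) ℂ × Matrix (Fin 2) (Fin 2) ℂ × Matrix (Fin 2) (Fin 2) ℂ) × ℝ => g (q.1.1 * (((hypBlockGL q.2 θ : GL (Fin 2) ℂ) : Matrix (Fin 2) (Fin 2) ℂ) * q.1.2.2) * q.1.2.1) :=
      hg.comp (((contDiff_fst.comp contDiff_fst).mul ((hTsm.comp contDiff_snd).mul (contDiff_snd.comp (contDiff_snd.comp contDiff_fst)))).mul
        (contDiff_fst.comp (contDiff_snd.comp contDiff_fst)))
    have h := (contDiffAt_hasDerivAt_integral_prod_of_support κ μN (Φ := fun q : (Matrix (Fin 2) (Fin 2) ℂ × Matrix (Fin 2) (Fin 2) ℂ × Matrix (Fin 2) (Fin 2) ℂ) × ℝ =>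
      g (q.1.1 * (((hypBlockGL q.2 θ : GL (Fin 2) ℂ) : Matrix (Fin 2) (Fin 2) ℂ) * q.1.2.2) * q.1.2.1)) hΦ hs (closedBall_mem_nhds y₀ one_pos) ?_).1
    · exact h
    · intro r hr p hp
      have hw : ((p.1 : ↥K) : ↥(unitaryGroupOfForm (starRingEnd ℂ) J)) * (tU r * ((p.2 : ↥(unipotentU (starRingEnd ℂ) J)) : ↥(unitaryGroupOfForm (starRingEnd ℂ) J)) * 1) * ((p.1 : ↥K) : ↥(unitaryGroupOfForm (starRingEnd ℂ) J))⁻¹ ∉ {u : ↥(unitaryGroupOfForm (starRingEnd ℂ) J) | ((u : GL (Fin 2) ℂ) : Matrix (Fin 2) (Fin 2) ℂ) ∈ tsupport g} := fun hmem => hp (hsupp r hr p hmem)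
      refine (hvan _ _ ?_ hw).1
      rw [mul_one, hcoe2, htUval]
  have hΨd : ∀ y, HasDerivAt Ψ (deriv Ψ y) y := fun y => ((hΨsm.differentiable (by simp)) y).hasDerivAt
  have hΨ'sm : ContDiff ℝ ∞ (deriv Ψ) := by simpa using hΨsm.iterate_deriv 1
  have hΨ'd : ∀ y, HasDerivAt (deriv Ψ) (deriv (deriv Ψ) y) y := fun y => ((hΨ'sm.differentiable (by simp)) y).hasDerivAt
  refine ⟨hΨsm, fun x => ?_⟩
  ------------------------------------------------------------------
  -- (N) the `H̃`-flow: `Nf s = ∫ g(k (t_x n e^{sH}) k⁻¹)`, its derivative `N₁`, and the closed form `e^{2s} Ψ(x+s)`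
  ------------------------------------------------------------------
  obtain ⟨sN, hsN, hsuppN⟩ := exists_isCompact_carrier_conj hK (fun _ => tU x) hB continuous_const hhBc hS₀ (0 : ℝ)
  have hΦ₁ : ContDiff ℝ ∞ fun q : (Matrix (Fin 2) (Fin 2) ℂ × Matrix (Fin 2) (Fin 2) ℂ × Matrix (Fin 2) (Fin 2) ℂ) × ℝ =>
      g (q.1.1 * (((hypBlockGL x θ : GL (Fin 2) ℂ) : Matrix (Fin 2) (Fin 2) ℂ) * q.1.2.2 * (Complex.cosh (q.2 : ℂ) • (1 : Matrix (Fin 2) (Fin 2) ℂ) + Complex.sinh (q.2 : ℂ) • !![1, 0; 0, -1])) * q.1.2.1) := by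
    have hb : ContDiff ℝ ∞ fun q : (Matrix (Fin 2) (Fin 2) ℂ × Matrix (Fin 2) (Fin 2) ℂ × Matrix (Fin 2) (Fin 2) ℂ) × ℝ => Complex.cosh (q.2 : ℂ) • (1 : Matrix (Fin 2) (Fin 2) ℂ) + Complex.sinh (q.2 : ℂ) • (!![1, 0; 0, -1] : Matrix (Fin 2) (Fin 2) ℂ) :=
      (((Complex.contDiff_cosh.restrict_scalars ℝ).comp (ofRealCLM.contDiff.comp contDiff_snd)).smul contDiff_const).add
        (((Complex.contDiff_sinh.restrict_scalars ℝ).comp (ofRealCLM.contDiff.comp contDiff_snd)).smul contDiff_const)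
    exact hg.comp (((contDiff_fst.comp contDiff_fst).mul (((contDiff_const.mul (contDiff_snd.comp (contDiff_snd.comp contDiff_fst))).mul hb))).mul
      (contDiff_fst.comp (contDiff_snd.comp contDiff_fst)))
  -- (N-a) derivative of `Nf` at every `s₀` near `0`
  have hNa : ∀ s₀ : ℝ, s₀ ∈ closedBall (0 : ℝ) (1 / 2) → HasDerivAt
      (fun s : ℝ => ∫ p : ↥K × ↥(unipotentU (starRingEnd ℂ) J), g (((((p.1 : ↥K) : ↥(unitaryGroupOfForm (starRingEnd ℂ) J)) : GL (Fin 2) ℂ) : Matrix (Fin 2) (Fin 2) ℂ) * (((hypBlockGL x θ : GL (Fin 2) ℂ) : Matrix (Fin 2) (Fin 2) ℂ) * ((((p.2 : ↥(unipotentU (starRingEnd ℂ) J)) : ↥(unitaryGroupOfForm (starRingEnd ℂ) J)) : GL (Fin 2) ℂ) : Matrix (Fin 2) (Fin 2) ℂ) * (Complex.cosh (s : ℂ) • (1 : Matrix (Fin 2) (Fin 2) ℂ) + Complex.sinh (s : ℂ) • !![1, 0; 0, -1])) * (((((p.1 : ↥K) : ↥(unitaryGroupOfForm (starRingEnd ℂ)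 J))⁻¹ : ↥(unitaryGroupOfForm (starRingEnd ℂ) J)) : GL (Fin 2) ℂ) : Matrix (Fin 2) (Fin 2) ℂ)) ∂(κ.prod μN))
      (∫ p : ↥K × ↥(unipotentU (starRingEnd ℂ) J), fderiv ℝ g (((((p.1 : ↥K) : ↥(unitaryGroupOfForm (starRingEnd ℂ) J)) : GL (Fin 2) ℂ) : Matrix (Fin 2) (Fin 2) ℂ) * (((hypBlockGL x θ : GL (Fin 2) ℂ) : Matrix (Fin 2) (Fin 2) ℂ) * ((((p.2 : ↥(unipotentU (starRingEnd ℂ) J)) : ↥(unitaryGroupOfForm (starRingEnd ℂ) J)) : GL (Fin 2) ℂ) : Matrix (Fin 2) (Fin 2) ℂ) * (Complex.cosh (s₀ : ℂ) • (1 : Matrix (Fin 2) (Fin 2) ℂ) + Complex.sinh (s₀ : ℂ) • !![1, 0; 0, -1])) * (((((p.1 : ↥K) : ↥(unitaryGroupOfForm (starRingEnd ℂ) J))⁻¹ : ↥(unitaryGroupOfForm (starRingEnd ℂ) J)) : GL (Fin 2) ℂ) : Matrix (Fin 2) (Fin 2) ℂ))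
        (((((p.1 : ↥K) : ↥(unitaryGroupOfForm (starRingEnd ℂ) J)) : GL (Fin 2) ℂ) : Matrix (Fin 2) (Fin 2) ℂ) * (((hypBlockGL x θ : GL (Fin 2) ℂ) : Matrix (Fin 2) (Fin 2) ℂ) * ((((p.2 : ↥(unipotentU (starRingEnd ℂ) J)) : ↥(unitaryGroupOfForm (starRingEnd ℂ) J)) : GL (Fin 2) ℂ) : Matrix (Fin 2) (Fin 2) ℂ) * ((Complex.cosh (s₀ : ℂ) • (1 : Matrix (Fin 2) (Fin 2) ℂ) + Complex.sinh (s₀ : ℂ) • !![1, 0; 0, -1]) * !![1, 0; 0, -1])) * (((((p.1 : ↥K) : ↥(unitaryGroupOfForm (starRingEnd ℂ) J))⁻¹ : ↥(unitaryGroupOfForm (starRingEnd ℂ) J)) : GL (Fin 2) ℂ) : Matrix (Fin 2) (Fin 2) ℂ)) ∂(κ.prod μN)) s₀ := by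
    intro s₀ hs₀
    have hU : closedBall (0 : ℝ) 1 ∈ 𝓝 s₀ := by
      refine mem_of_superset (closedBall_mem_nhds s₀ (by norm_num : (0 : ℝ) < 1 / 2)) fun r hr => ?_
      simp only [mem_closedBall, dist_zero_right, Real.norm_eq_abs] at hr hs₀ ⊢
      have := abs_sub_abs_le_abs_sub r s₀
      rw [Real.dist_eq] at hr
      linarith
    have h := (contDiffAt_hasDerivAt_integral_prod_of_support κ μN hΦ₁ hsN hU ?_).2
    · refine h.congr_deriv ?_
      refine integral_congr_ae (Eventually.of_forall fun p => ?_)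
      exact (ConjugationCurve.hasDerivAt_comp_conj_curve g (contDiff_infty.1 hg 1) ((((p.1 : ↥K) : ↥(unitaryGroupOfForm (starRingEnd ℂ) J)) : GL (Fin 2) ℂ) : Matrix (Fin 2) (Fin 2) ℂ) (((((p.1 : ↥K) : ↥(unitaryGroupOfForm (starRingEnd ℂ) J))⁻¹ : ↥(unitaryGroupOfForm (starRingEnd ℂ) J)) : GL (Fin 2) ℂ) : Matrix (Fin 2) (Fin 2) ℂ)
        ((hasDerivAt_boost_splitFrame s₀).const_mul (((hypBlockGL x θ : GL (Fin 2) ℂ) : Matrix (Fin 2) (Fin 2) ℂ) * ((((p.2 : ↥(unipotentU (starRingEnd ℂ) J)) : ↥(unitaryGroupOfForm (starRingEnd ℂ) J)) : GL (Fin 2) ℂ) : Matrix (Fin 2) (Fin 2) ℂ)))).deriv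
    · intro r hr p hp
      have hw : ((p.1 : ↥K) : ↥(unitaryGroupOfForm (starRingEnd ℂ) J)) * (tU x * ((p.2 : ↥(unipotentU (starRingEnd ℂ) J)) : ↥(unitaryGroupOfForm (starRingEnd ℂ) J)) * hB r) * ((p.1 : ↥K) : ↥(unitaryGroupOfForm (starRingEnd ℂ) J))⁻¹ ∉ {u : ↥(unitaryGroupOfForm (starRingEnd ℂ) J) | ((u : GL (Fin 2) ℂ) : Matrix (Fin 2) (Fin 2) ℂ) ∈ tsupport g} := fun hmem => hp (hsuppN r hr p hmem)
      refine (hvan _ _ ?_ hw).1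
      rw [hcoe3, htUval, hhBval]
  -- (N-b) closed form
  have hNb : ∀ s : ℝ, (∫ p : ↥K × ↥(unipotentU (starRingEnd ℂ) J), g (((((p.1 : ↥K) : ↥(unitaryGroupOfForm (starRingEnd ℂ) J)) : GL (Fin 2) ℂ) : Matrix (Fin 2) (Fin 2) ℂ) * (((hypBlockGL x θ : GL (Fin 2) ℂ) : Matrix (Fin 2) (Fin 2) ℂ) * ((((p.2 : ↥(unipotentU (starRingEnd ℂ) J)) : ↥(unitaryGroupOfForm (starRingEnd ℂ) J)) : GL (Fin 2) ℂ) : Matrix (Fin 2) (Fin 2) ℂ) * (Complex.cosh (s : ℂ) • (1 : Matrix (Fin 2) (Fin 2) ℂ) + Complex.sinh (s : ℂ) • !![1, 0; 0, -1])) * (((((p.1 : ↥K) : ↥(unitaryGroupOfForm (starRingEnd ℂ) J))⁻¹ : ↥(unitaryGroupOfForm (starRingEnd ℂ) J)) : GL (Fin 2) ℂ) : Matrix (Fin 2) (Fin 2) ℂ)) ∂(κ.prod μN)) = Real.exp (2 * s) • Ψ (x + s) := by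
    intro s
    have h := integral_prod_conj_mul_hypBlockGL_eq_exp_smul hJ κ μN (fun u : ↥(unitaryGroupOfForm (starRingEnd ℂ) J) => g ((u : GL (Fin 2) ℂ) : Matrix (Fin 2) (Fin 2) ℂ)) x θ s
    rw [hΨ (x + s)]
    refine Eq.trans (integral_congr_ae (Eventually.of_forall fun p => ?_)) h
    show g _ = g _
    rw [hcoe3, ← hhBval s, hhB]
  have hNfun : (fun s : ℝ => ∫ p : ↥K × ↥(unipotentU (starRingEnd ℂ) J), g (((((p.1 : ↥K) : ↥(unitaryGroupOfForm (starRingEnd ℂ) J)) : GL (Fin 2) ℂ) : Matrix (Fin 2) (Fin 2) ℂ) * (((hypBlockGL x θ : GL (Fin 2) ℂ) : Matrix (Fin 2) (Fin 2) ℂ) * ((((p.2 : ↥(unipotentU (starRingEnd ℂ) J)) : ↥(unitaryGroupOfForm (starRingEnd ℂ) J)) : GL (Fin 2) ℂ) : Matrix (Fin 2) (Fin 2) ℂ) * (Complex.cosh (s : ℂ) • (1 : Matrix (Fin 2) (Fin 2) ℂ) + Complex.sinh (s : ℂ) • !![1, 0; 0, -1])) * (((((p.1 : ↥K) : ↥(unitaryGroupOfForm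 (starRingEnd ℂ) J))⁻¹ : ↥(unitaryGroupOfForm (starRingEnd ℂ) J)) : GL (Fin 2) ℂ) : Matrix (Fin 2) (Fin 2) ℂ)) ∂(κ.prod μN)) = fun s => Real.exp (2 * s) • Ψ (x + s) :=
    funext hNb
  -- (N-d) derivatives of the closed form
  have he : ∀ s : ℝ, HasDerivAt (fun s : ℝ => Real.exp (2 * s)) (Real.exp (2 * s) * (2 * 1)) s := fun s => ((hasDerivAt_id s).const_mul (2 : ℝ)).exp
  have hΨs : ∀ s : ℝ, HasDerivAt (fun s : ℝ => Ψ (x + s)) (deriv Ψ (x + s)) s := fun s => HasDerivAt.comp_const_add x s (hΨd (x + s))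
  have hΨ's : ∀ s : ℝ, HasDerivAt (fun s : ℝ => deriv Ψ (x + s)) (deriv (deriv Ψ) (x + s)) s := fun s =>
    HasDerivAt.comp_const_add x s (hΨ'd (x + s))
  -- (N-e) `N₁ s = e^{2s} Ψ′(x+s) + 2 e^{2s} Ψ(x+s)` on `|s| ≤ 1∕2`
  have hNe : ∀ s : ℝ, s ∈ closedBall (0 : ℝ) (1 / 2) →
      (∫ p : ↥K × ↥(unipotentU (starRingEnd ℂ) J), fderiv ℝ g (((((p.1 : ↥K) : ↥(unitaryGroupOfForm (starRingEnd ℂ) J)) : GL (Fin 2) ℂ) : Matrix (Fin 2) (Fin 2) ℂ) * (((hypBlockGL x θ : GL (Fin 2) ℂ) : Matrix (Fin 2) (Fin 2) ℂ) * ((((p.2 : ↥(unipotentU (starRingEnd ℂ) J)) : ↥(unitaryGroupOfForm (starRingEnd ℂ) J)) : GL (Fin 2) ℂ) : Matrix (Fin 2) (Fin 2) ℂ) * (Complex.cosh (s : ℂ) • (1 : Matrix (Fin 2) (Fin 2) ℂ) + Complex.sinh (s : ℂ) • !![1, 0; 0, -1])) * (((((p.1 : ↥K) : ↥(unitaryGroupOfForm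 (starRingEnd ℂ) J))⁻¹ : ↥(unitaryGroupOfForm (starRingEnd ℂ) J)) : GL (Fin 2) ℂ) : Matrix (Fin 2) (Fin 2) ℂ))
        (((((p.1 : ↥K) : ↥(unitaryGroupOfForm (starRingEnd ℂ) J)) : GL (Fin 2) ℂ) : Matrix (Fin 2) (Fin 2) ℂ) * (((hypBlockGL x θ : GL (Fin 2) ℂ) : Matrix (Fin 2) (Fin 2) ℂ) * ((((p.2 : ↥(unipotentU (starRingEnd ℂ) J)) : ↥(unitaryGroupOfForm (starRingEnd ℂ) J)) : GL (Fin 2) ℂ) : Matrix (Fin 2) (Fin 2) ℂ) * ((Complex.cosh (s : ℂ) • (1 : Matrix (Fin 2) (Fin 2) ℂ) + Complex.sinh (s : ℂ) • !![1, 0; 0, -1]) * !![1, 0; 0, -1])) * (((((p.1 : ↥K) : ↥(unitaryGroupOfForm (starRingEnd ℂ) J))⁻¹ : ↥(unitaryGroupOfForm (starRingEnd ℂ) J)) : GL (Fin 2) ℂ) : Matrix (Fin 2) (Fin 2) ℂ)) ∂(κ.prod μN)) =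
      Real.exp (2 * s) • deriv Ψ (x + s) + (Real.exp (2 * s) * (2 * 1)) • Ψ (x + s) := by
    intro s hs
    have h1 := hNa s hs
    rw [hNfun] at h1
    exact h1.unique ((he s).smul (hΨs s))
  -- (N-f) second derivative at `0`
  have hΦ₂ : ContDiff ℝ ∞ fun q : (Matrix (Fin 2) (Fin 2) ℂ × Matrix (Fin 2) (Fin 2) ℂ × Matrix (Fin 2) (Fin 2) ℂ) × ℝ =>
      fderiv ℝ g (q.1.1 * (((hypBlockGL x θ : GL (Fin 2) ℂ) : Matrix (Fin 2) (Fin 2) ℂ) * q.1.2.2 * (Complex.cosh (q.2 : ℂ) • (1 : Matrix (Fin 2) (Fin 2) ℂ) + Complex.sinh (q.2 : ℂ) • !![1, 0; 0, -1])) * q.1.2.1)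
        (q.1.1 * (((hypBlockGL x θ : GL (Fin 2) ℂ) : Matrix (Fin 2) (Fin 2) ℂ) * q.1.2.2 * ((Complex.cosh (q.2 : ℂ) • (1 : Matrix (Fin 2) (Fin 2) ℂ) + Complex.sinh (q.2 : ℂ) • !![1, 0; 0, -1]) * !![1, 0; 0, -1])) * q.1.2.1) := by
    have hb : ContDiff ℝ ∞ fun q : (Matrix (Fin 2) (Fin 2) ℂ × Matrix (Fin 2) (Fin 2) ℂ × Matrix (Fin 2) (Fin 2) ℂ) × ℝ => Complex.cosh (q.2 : ℂ) • (1 : Matrix (Fin 2) (Fin 2) ℂ) + Complex.sinh (q.2 : ℂ) • (!![1, 0; 0, -1] : Matrix (Fin 2) (Fin 2) ℂ) :=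
      (((Complex.contDiff_cosh.restrict_scalars ℝ).comp (ofRealCLM.contDiff.comp contDiff_snd)).smul contDiff_const).add
        (((Complex.contDiff_sinh.restrict_scalars ℝ).comp (ofRealCLM.contDiff.comp contDiff_snd)).smul contDiff_const)
    have hpt : ContDiff ℝ ∞ fun q : (Matrix (Fin 2) (Fin 2) ℂ × Matrix (Fin 2) (Fin 2) ℂ × Matrix (Fin 2) (Fin 2) ℂ) × ℝ =>
        q.1.1 * (((hypBlockGL x θ : GL (Fin 2) ℂ) : Matrix (Fin 2) (Fin 2) ℂ) * q.1.2.2 * (Complex.cosh (q.2 : ℂ) • (1 : Matrix (Fin 2) (Fin 2) ℂ) + Complex.sinh (q.2 : ℂ) • !![1, 0; 0, -1])) * q.1.2.1 :=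
      ((contDiff_fst.comp contDiff_fst).mul (((contDiff_const.mul (contDiff_snd.comp (contDiff_snd.comp contDiff_fst))).mul hb))).mul
        (contDiff_fst.comp (contDiff_snd.comp contDiff_fst))
    have hdir : ContDiff ℝ ∞ fun q : (Matrix (Fin 2) (Fin 2) ℂ × Matrix (Fin 2) (Fin 2) ℂ × Matrix (Fin 2) (Fin 2) ℂ) × ℝ =>
        q.1.1 * (((hypBlockGL x θ : GL (Fin 2) ℂ) : Matrix (Fin 2) (Fin 2) ℂ) * q.1.2.2 * ((Complex.cosh (q.2 : ℂ) • (1 : Matrix (Fin 2) (Fin 2) ℂ) + Complex.sinh (q.2 : ℂ) • !![1, 0; 0, -1]) * !![1, 0; 0, -1])) * q.1.2.1 :=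
      ((contDiff_fst.comp contDiff_fst).mul (((contDiff_const.mul (contDiff_snd.comp (contDiff_snd.comp contDiff_fst))).mul (hb.mul contDiff_const)))).mul
        (contDiff_fst.comp (contDiff_snd.comp contDiff_fst))
    exact (hg'.comp hpt).clm_apply hdir
  have hNf : HasDerivAt
      (fun s : ℝ => ∫ p : ↥K × ↥(unipotentU (starRingEnd ℂ) J), fderiv ℝ g (((((p.1 : ↥K) : ↥(unitaryGroupOfForm (starRingEnd ℂ) J)) : GL (Fin 2) ℂ) : Matrix (Fin 2) (Fin 2) ℂ) * (((hypBlockGL x θ : GL (Fin 2) ℂ) : Matrix (Fin 2) (Fin 2) ℂ) * ((((p.2 : ↥(unipotentU (starRingEnd ℂ) J)) : ↥(unitaryGroupOfForm (starRingEnd ℂ) J)) : GL (Fin 2) ℂ) : Matrix (Fin 2) (Fin 2) ℂ) * (Complex.cosh (s : ℂ) • (1 : Matrix (Fin 2) (Fin 2) ℂ) + Complex.sinh (s : ℂ) • !![1, 0; 0, -1])) * (((((p.1 : ↥K) : ↥(unitaryGroupOfForm (starRingEnd ℂ) J))⁻¹ : ↥(unitaryGroupOfForm (starRingEnd ℂ)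 J)) : GL (Fin 2) ℂ) : Matrix (Fin 2) (Fin 2) ℂ))
        (((((p.1 : ↥K) : ↥(unitaryGroupOfForm (starRingEnd ℂ) J)) : GL (Fin 2) ℂ) : Matrix (Fin 2) (Fin 2) ℂ) * (((hypBlockGL x θ : GL (Fin 2) ℂ) : Matrix (Fin 2) (Fin 2) ℂ) * ((((p.2 : ↥(unipotentU (starRingEnd ℂ) J)) : ↥(unitaryGroupOfForm (starRingEnd ℂ) J)) : GL (Fin 2) ℂ) : Matrix (Fin 2) (Fin 2) ℂ) * ((Complex.cosh (s : ℂ) • (1 : Matrix (Fin 2) (Fin 2) ℂ) + Complex.sinh (s : ℂ) • !![1, 0; 0, -1]) * !![1, 0; 0, -1])) * (((((p.1 : ↥K) : ↥(unitaryGroupOfForm (starRingEnd ℂ) J))⁻¹ : ↥(unitaryGroupOfForm (starRingEnd ℂ) J)) : GL (Fin 2) ℂ) : Matrix (Fin 2) (Fin 2) ℂ)) ∂(κ.prod μN))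
      (∫ p : ↥K × ↥(unipotentU (starRingEnd ℂ) J), (fderiv ℝ (fderiv ℝ g) (((((p.1 : ↥K) : ↥(unitaryGroupOfForm (starRingEnd ℂ) J)) : GL (Fin 2) ℂ) : Matrix (Fin 2) (Fin 2) ℂ) * (((hypBlockGL x θ : GL (Fin 2) ℂ) : Matrix (Fin 2) (Fin 2) ℂ) * ((((p.2 : ↥(unipotentU (starRingEnd ℂ) J)) : ↥(unitaryGroupOfForm (starRingEnd ℂ) J)) : GL (Fin 2) ℂ) : Matrix (Fin 2) (Fin 2) ℂ) * (Complex.cosh ((0 : ℝ) : ℂ) • (1 : Matrix (Fin 2) (Fin 2) ℂ) + Complex.sinh ((0 : ℝ) : ℂ) • !![1, 0; 0, -1])) * (((((p.1 : ↥K) : ↥(unitaryGroupOfForm (starRingEnd ℂ) J))⁻¹ : ↥(unitaryGroupOfForm (starRingEnd ℂ) J)) : GL (Fin 2) ℂ) : Matrix (Fin 2) (Fin 2) ℂ))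
          (((((p.1 : ↥K) : ↥(unitaryGroupOfForm (starRingEnd ℂ) J)) : GL (Fin 2) ℂ) : Matrix (Fin 2) (Fin 2) ℂ) * (((hypBlockGL x θ : GL (Fin 2) ℂ) : Matrix (Fin 2) (Fin 2) ℂ) * ((((p.2 : ↥(unipotentU (starRingEnd ℂ) J)) : ↥(unitaryGroupOfForm (starRingEnd ℂ) J)) : GL (Fin 2) ℂ) : Matrix (Fin 2) (Fin 2) ℂ) * ((Complex.cosh ((0 : ℝ) : ℂ) • (1 : Matrix (Fin 2) (Fin 2) ℂ) + Complex.sinh ((0 : ℝ) : ℂ) • !![1, 0; 0, -1]) * !![1, 0; 0, -1])) * (((((p.1 : ↥K) : ↥(unitaryGroupOfForm (starRingEnd ℂ) J))⁻¹ : ↥(unitaryGroupOfForm (starRingEnd ℂ) J)) : GL (Fin 2) ℂ) : Matrix (Fin 2) (Fin 2) ℂ))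
          (((((p.1 : ↥K) : ↥(unitaryGroupOfForm (starRingEnd ℂ) J)) : GL (Fin 2) ℂ) : Matrix (Fin 2) (Fin 2) ℂ) * (((hypBlockGL x θ : GL (Fin 2) ℂ) : Matrix (Fin 2) (Fin 2) ℂ) * ((((p.2 : ↥(unipotentU (starRingEnd ℂ) J)) : ↥(unitaryGroupOfForm (starRingEnd ℂ) J)) : GL (Fin 2) ℂ) : Matrix (Fin 2) (Fin 2) ℂ) * ((Complex.cosh ((0 : ℝ) : ℂ) • (1 : Matrix (Fin 2) (Fin 2) ℂ) + Complex.sinh ((0 : ℝ) : ℂ) • !![1, 0; 0, -1]) * !![1, 0; 0, -1])) * (((((p.1 : ↥K) : ↥(unitaryGroupOfForm (starRingEnd ℂ) J))⁻¹ : ↥(unitaryGroupOfForm (starRingEnd ℂ) J)) : GL (Fin 2) ℂ) : Matrix (Fin 2) (Fin 2) ℂ)) +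
        fderiv ℝ g (((((p.1 : ↥K) : ↥(unitaryGroupOfForm (starRingEnd ℂ) J)) : GL (Fin 2) ℂ) : Matrix (Fin 2) (Fin 2) ℂ) * (((hypBlockGL x θ : GL (Fin 2) ℂ) : Matrix (Fin 2) (Fin 2) ℂ) * ((((p.2 : ↥(unipotentU (starRingEnd ℂ) J)) : ↥(unitaryGroupOfForm (starRingEnd ℂ) J)) : GL (Fin 2) ℂ) : Matrix (Fin 2) (Fin 2) ℂ) * (Complex.cosh ((0 : ℝ) : ℂ) • (1 : Matrix (Fin 2) (Fin 2) ℂ) + Complex.sinh ((0 : ℝ) : ℂ) • !![1, 0; 0, -1])) * (((((p.1 : ↥K) : ↥(unitaryGroupOfForm (starRingEnd ℂ) J))⁻¹ : ↥(unitaryGroupOfForm (starRingEnd ℂ) J)) : GL (Fin 2) ℂ) : Matrix (Fin 2) (Fin 2) ℂ))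
          (((((p.1 : ↥K) : ↥(unitaryGroupOfForm (starRingEnd ℂ) J)) : GL (Fin 2) ℂ) : Matrix (Fin 2) (Fin 2) ℂ) * (((hypBlockGL x θ : GL (Fin 2) ℂ) : Matrix (Fin 2) (Fin 2) ℂ) * ((((p.2 : ↥(unipotentU (starRingEnd ℂ) J)) : ↥(unitaryGroupOfForm (starRingEnd ℂ) J)) : GL (Fin 2) ℂ) : Matrix (Fin 2) (Fin 2) ℂ) * ((Complex.cosh ((0 : ℝ) : ℂ) • (1 : Matrix (Fin 2) (Fin 2) ℂ) + Complex.sinh ((0 : ℝ) : ℂ) • !![1, 0; 0, -1]) * !![1, 0; 0, -1] * !![1, 0; 0, -1])) * (((((p.1 : ↥K) : ↥(unitaryGroupOfForm (starRingEnd ℂ) J))⁻¹ : ↥(unitaryGroupOfForm (starRingEnd ℂ) J)) : GL (Fin 2) ℂ) : Matrix (Fin 2) (Fin 2) ℂ))) ∂(κ.prod μN)) 0 := by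
    have h := (contDiffAt_hasDerivAt_integral_prod_of_support κ μN hΦ₂ hsN (closedBall_mem_nhds (0 : ℝ) one_pos) ?_).2
    · refine h.congr_deriv (integral_congr_ae (Eventually.of_forall fun p => ?_))
      exact (ConjugationCurve.hasDerivAt_fderiv_comp_conj_curve g (contDiff_infty.1 hg 2) ((((p.1 : ↥K) : ↥(unitaryGroupOfForm (starRingEnd ℂ) J)) : GL (Fin 2) ℂ) : Matrix (Fin 2) (Fin 2) ℂ) (((((p.1 : ↥K) : ↥(unitaryGroupOfForm (starRingEnd ℂ) J))⁻¹ : ↥(unitaryGroupOfForm (starRingEnd ℂ) J)) : GL (Fin 2) ℂ) : Matrix (Fin 2) (Fin 2) ℂ)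
        (c₁ := fun s : ℝ => ((hypBlockGL x θ : GL (Fin 2) ℂ) : Matrix (Fin 2) (Fin 2) ℂ) * ((((p.2 : ↥(unipotentU (starRingEnd ℂ) J)) : ↥(unitaryGroupOfForm (starRingEnd ℂ) J)) : GL (Fin 2) ℂ) : Matrix (Fin 2) (Fin 2) ℂ) * ((Complex.cosh (s : ℂ) • (1 : Matrix (Fin 2) (Fin 2) ℂ) + Complex.sinh (s : ℂ) • !![1, 0; 0, -1]) * !![1, 0; 0, -1]))
        ((hasDerivAt_boost_splitFrame 0).const_mul (((hypBlockGL x θ : GL (Fin 2) ℂ) : Matrix (Fin 2) (Fin 2) ℂ) * ((((p.2 : ↥(unipotentU (starRingEnd ℂ) J)) : ↥(unitaryGroupOfForm (starRingEnd ℂ) J)) : GL (Fin 2) ℂ) : Matrix (Fin 2) (Fin 2) ℂ))) ((hasDerivAt_boost_splitFrame_mul_H 0).const_mul (((hypBlockGL x θ : GL (Fin 2) ℂ) : Matrix (Fin 2) (Fin 2) ℂ) * ((((p.2 : ↥(unipotentU (starRingEnd ℂ) J)) : ↥(unitaryGroupOfForm (starRingEnd ℂ) J)) : GL (Fin 2)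 ℂ) : Matrix (Fin 2) (Fin 2) ℂ)))).deriv
    · intro r hr p hp
      have hw : ((p.1 : ↥K) : ↥(unitaryGroupOfForm (starRingEnd ℂ) J)) * (tU x * ((p.2 : ↥(unipotentU (starRingEnd ℂ) J)) : ↥(unitaryGroupOfForm (starRingEnd ℂ) J)) * hB r) * ((p.1 : ↥K) : ↥(unitaryGroupOfForm (starRingEnd ℂ) J))⁻¹ ∉ {u : ↥(unitaryGroupOfForm (starRingEnd ℂ) J) | ((u : GL (Fin 2) ℂ) : Matrix (Fin 2) (Fin 2) ℂ) ∈ tsupport g} := fun hmem => hp (hsuppN r hr p hmem)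
      have hz := (hvan _ _ (by rw [hcoe3, htUval, hhBval]) hw).2
      simp only [hz, _root_.zero_apply]
  have hN1fun : ∀ᶠ s : ℝ in 𝓝 (0 : ℝ), (∫ p : ↥K × ↥(unipotentU (starRingEnd ℂ) J), fderiv ℝ g (((((p.1 : ↥K) : ↥(unitaryGroupOfForm (starRingEnd ℂ) J)) : GL (Fin 2) ℂ) : Matrix (Fin 2) (Fin 2) ℂ) * (((hypBlockGL x θ : GL (Fin 2) ℂ) : Matrix (Fin 2) (Fin 2) ℂ) * ((((p.2 : ↥(unipotentU (starRingEnd ℂ) J)) : ↥(unitaryGroupOfForm (starRingEnd ℂ) J)) : GL (Fin 2) ℂ) : Matrix (Fin 2) (Fin 2) ℂ) * (Complex.cosh (s : ℂ) • (1 : Matrix (Fin 2) (Fin 2) ℂ) + Complex.sinh (s : ℂ) • !![1, 0; 0, -1])) * (((((p.1 : ↥K) : ↥(unitaryGroupOfForm (starRingEnd ℂ) J))⁻¹ : ↥(unitaryGroupOfForm (starRingEnd ℂ) J)) : GL (Fin 2) ℂ) : Matrix (Fin 2) (Fin 2) ℂ))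
        (((((p.1 : ↥K) : ↥(unitaryGroupOfForm (starRingEnd ℂ) J)) : GL (Fin 2) ℂ) : Matrix (Fin 2) (Fin 2) ℂ) * (((hypBlockGL x θ : GL (Fin 2) ℂ) : Matrix (Fin 2) (Fin 2) ℂ) * ((((p.2 : ↥(unipotentU (starRingEnd ℂ) J)) : ↥(unitaryGroupOfForm (starRingEnd ℂ) J)) : GL (Fin 2) ℂ) : Matrix (Fin 2) (Fin 2) ℂ) * ((Complex.cosh (s : ℂ) • (1 : Matrix (Fin 2) (Fin 2) ℂ) + Complex.sinh (s : ℂ) • !![1, 0; 0, -1]) * !![1, 0; 0, -1])) * (((((p.1 : ↥K) : ↥(unitaryGroupOfForm (starRingEnd ℂ) J))⁻¹ : ↥(unitaryGroupOfForm (starRingEnd ℂ) J)) : GL (Fin 2) ℂ) : Matrix (Fin 2) (Fin 2) ℂ)) ∂(κ.prod μN)) =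
      Real.exp (2 * s) • deriv Ψ (x + s) + (Real.exp (2 * s) * (2 * 1)) • Ψ (x + s) := by
    filter_upwards [closedBall_mem_nhds (0 : ℝ) (by norm_num : (0 : ℝ) < 1 / 2)] with s hs
    exact hNe s hs
  have hclosed2 : HasDerivAt (fun s : ℝ => Real.exp (2 * s) • deriv Ψ (x + s) + (Real.exp (2 * s) * (2 * 1)) • Ψ (x + s))
      (Real.exp (2 * 0) • deriv (deriv Ψ) (x + 0) + (Real.exp (2 * 0) * (2 * 1)) • deriv Ψ (x + 0) +
        ((Real.exp (2 * 0) * (2 * 1)) • deriv Ψ (x + 0) + (Real.exp (2 * 0) * (2 * 1) * (2 * 1)) • Ψ (x + 0))) 0 :=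
    ((he 0).smul (hΨ's 0)).add (((he 0).mul_const (2 * 1)).smul (hΨs 0))
  have hN2 := hNf.unique (hclosed2.congr_of_eventuallyEq hN1fun)
  have hN1 := hNe 0 (mem_closedBall_self (by norm_num))
  ------------------------------------------------------------------
  -- (E) the `Ẽ`-flow is constant in `r`
  ------------------------------------------------------------------
  obtain ⟨sE, hsE, hsuppE⟩ := exists_isCompact_carrier_conj hK (fun _ => tU x) (fun r => ((uN r : ↥(unipotentU (starRingEnd ℂ) J)) : ↥(unitaryGroupOfForm (starRingEnd ℂ) J))) continuous_const huNc hS₀ (0 : ℝ)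
  have hΦ₃ : ContDiff ℝ ∞ fun q : (Matrix (Fin 2) (Fin 2) ℂ × Matrix (Fin 2) (Fin 2) ℂ × Matrix (Fin 2) (Fin 2) ℂ) × ℝ =>
      fderiv ℝ g (q.1.1 * (((hypBlockGL x θ : GL (Fin 2) ℂ) : Matrix (Fin 2) (Fin 2) ℂ) * q.1.2.2 * ((1 : Matrix (Fin 2) (Fin 2) ℂ) + (q.2 : ℂ) • !![0, I; 0, 0])) * q.1.2.1)
        (q.1.1 * (((hypBlockGL x θ : GL (Fin 2) ℂ) : Matrix (Fin 2) (Fin 2) ℂ) * q.1.2.2 * (((1 : Matrix (Fin 2) (Fin 2) ℂ) + (q.2 : ℂ) • !![0, I; 0, 0]) * !![0, 0; I, 0])) * q.1.2.1) := by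
    have hu : ContDiff ℝ ∞ fun q : (Matrix (Fin 2) (Fin 2) ℂ × Matrix (Fin 2) (Fin 2) ℂ × Matrix (Fin 2) (Fin 2) ℂ) × ℝ => (1 : Matrix (Fin 2) (Fin 2) ℂ) + (q.2 : ℂ) • (!![0, I; 0, 0] : Matrix (Fin 2) (Fin 2) ℂ) :=
      contDiff_const.add ((ofRealCLM.contDiff.comp contDiff_snd).smul contDiff_const)
    have hpt : ContDiff ℝ ∞ fun q : (Matrix (Fin 2) (Fin 2) ℂ × Matrix (Fin 2) (Fin 2) ℂ × Matrix (Fin 2) (Fin 2) ℂ) × ℝ => q.1.1 * (((hypBlockGL x θ : GL (Fin 2) ℂ) : Matrix (Fin 2) (Fin 2) ℂ) * q.1.2.2 * ((1 : Matrix (Fin 2) (Fin 2) ℂ) + (q.2 : ℂ) • !![0, I; 0, 0])) * q.1.2.1 :=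
      ((contDiff_fst.comp contDiff_fst).mul (((contDiff_const.mul (contDiff_snd.comp (contDiff_snd.comp contDiff_fst))).mul hu))).mul
        (contDiff_fst.comp (contDiff_snd.comp contDiff_fst))
    have hdir : ContDiff ℝ ∞ fun q : (Matrix (Fin 2) (Fin 2) ℂ × Matrix (Fin 2) (Fin 2) ℂ × Matrix (Fin 2) (Fin 2) ℂ) × ℝ => q.1.1 * (((hypBlockGL x θ : GL (Fin 2) ℂ) : Matrix (Fin 2) (Fin 2) ℂ) * q.1.2.2 * (((1 : Matrix (Fin 2) (Fin 2) ℂ) + (q.2 : ℂ) • !![0, I; 0, 0]) * !![0, 0; I, 0])) * q.1.2.1 :=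
      ((contDiff_fst.comp contDiff_fst).mul (((contDiff_const.mul (contDiff_snd.comp (contDiff_snd.comp contDiff_fst))).mul (hu.mul contDiff_const)))).mul
        (contDiff_fst.comp (contDiff_snd.comp contDiff_fst))
    exact (hg'.comp hpt).clm_apply hdir
  have hEa : HasDerivAt
      (fun r : ℝ => ∫ p : ↥K × ↥(unipotentU (starRingEnd ℂ) J), fderiv ℝ g (((((p.1 : ↥K) : ↥(unitaryGroupOfForm (starRingEnd ℂ) J)) : GL (Fin 2) ℂ) : Matrix (Fin 2) (Fin 2) ℂ) * (((hypBlockGL x θ : GL (Fin 2) ℂ) : Matrix (Fin 2) (Fin 2) ℂ) * ((((p.2 : ↥(unipotentU (starRingEnd ℂ) J)) : ↥(unitaryGroupOfForm (starRingEnd ℂ) J)) : GL (Fin 2) ℂ) : Matrix (Fin 2) (Fin 2) ℂ) * ((1 : Matrix (Fin 2) (Fin 2) ℂ) + (r : ℂ) • !![0, I; 0, 0])) * (((((p.1 : ↥K) : ↥(unitaryGroupOfForm (starRingEnd ℂ) J))⁻¹ : ↥(unitaryGroupOfForm (starRingEnd ℂ) J)) : GL (Fin 2) ℂ) : Matrix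 (Fin 2) (Fin 2) ℂ))
        (((((p.1 : ↥K) : ↥(unitaryGroupOfForm (starRingEnd ℂ) J)) : GL (Fin 2) ℂ) : Matrix (Fin 2) (Fin 2) ℂ) * (((hypBlockGL x θ : GL (Fin 2) ℂ) : Matrix (Fin 2) (Fin 2) ℂ) * ((((p.2 : ↥(unipotentU (starRingEnd ℂ) J)) : ↥(unitaryGroupOfForm (starRingEnd ℂ) J)) : GL (Fin 2) ℂ) : Matrix (Fin 2) (Fin 2) ℂ) * (((1 : Matrix (Fin 2) (Fin 2) ℂ) + (r : ℂ) • !![0, I; 0, 0]) * !![0, 0; I, 0])) * (((((p.1 : ↥K) : ↥(unitaryGroupOfForm (starRingEnd ℂ) J))⁻¹ : ↥(unitaryGroupOfForm (starRingEnd ℂ) J)) : GL (Fin 2) ℂ) : Matrix (Fin 2) (Fin 2) ℂ)) ∂(κ.prod μN))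
      (∫ p : ↥K × ↥(unipotentU (starRingEnd ℂ) J), (fderiv ℝ (fderiv ℝ g) (((((p.1 : ↥K) : ↥(unitaryGroupOfForm (starRingEnd ℂ) J)) : GL (Fin 2) ℂ) : Matrix (Fin 2) (Fin 2) ℂ) * (((hypBlockGL x θ : GL (Fin 2) ℂ) : Matrix (Fin 2) (Fin 2) ℂ) * ((((p.2 : ↥(unipotentU (starRingEnd ℂ) J)) : ↥(unitaryGroupOfForm (starRingEnd ℂ) J)) : GL (Fin 2) ℂ) : Matrix (Fin 2) (Fin 2) ℂ) * ((1 : Matrix (Fin 2) (Fin 2) ℂ) + ((0 : ℝ) : ℂ) • !![0, I; 0, 0])) * (((((p.1 : ↥K) : ↥(unitaryGroupOfForm (starRingEnd ℂ) J))⁻¹ : ↥(unitaryGroupOfForm (starRingEnd ℂ) J)) : GL (Fin 2) ℂ) : Matrix (Fin 2) (Fin 2) ℂ)) (((((p.1 : ↥K) : ↥(unitaryGroupOfForm (starRingEnd ℂ) J)) : GL (Fin 2) ℂ) : Matrix (Fin 2) (Fin 2) ℂ) * (((hypBlockGL x θ : GL (Fin 2) ℂ) : Matrix (Fin 2) (Fin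 2) ℂ) * ((((p.2 : ↥(unipotentU (starRingEnd ℂ) J)) : ↥(unitaryGroupOfForm (starRingEnd ℂ) J)) : GL (Fin 2) ℂ) : Matrix (Fin 2) (Fin 2) ℂ) * !![0, I; 0, 0]) * (((((p.1 : ↥K) : ↥(unitaryGroupOfForm (starRingEnd ℂ) J))⁻¹ : ↥(unitaryGroupOfForm (starRingEnd ℂ) J)) : GL (Fin 2) ℂ) : Matrix (Fin 2) (Fin 2) ℂ))
          (((((p.1 : ↥K) : ↥(unitaryGroupOfForm (starRingEnd ℂ) J)) : GL (Fin 2) ℂ) : Matrix (Fin 2) (Fin 2) ℂ) * (((hypBlockGL x θ : GL (Fin 2) ℂ) : Matrix (Fin 2) (Fin 2) ℂ) * ((((p.2 : ↥(unipotentU (starRingEnd ℂ) J)) : ↥(unitaryGroupOfForm (starRingEnd ℂ) J)) : GL (Fin 2) ℂ) : Matrix (Fin 2) (Fin 2) ℂ) * (((1 : Matrix (Fin 2) (Fin 2) ℂ) + ((0 : ℝ) : ℂ) • !![0, I; 0, 0]) * !![0, 0; I, 0])) * (((((p.1 : ↥K) : ↥(unitaryGroupOfForm (starRingEnd ℂ)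 J))⁻¹ : ↥(unitaryGroupOfForm (starRingEnd ℂ) J)) : GL (Fin 2) ℂ) : Matrix (Fin 2) (Fin 2) ℂ)) +
        fderiv ℝ g (((((p.1 : ↥K) : ↥(unitaryGroupOfForm (starRingEnd ℂ) J)) : GL (Fin 2) ℂ) : Matrix (Fin 2) (Fin 2) ℂ) * (((hypBlockGL x θ : GL (Fin 2) ℂ) : Matrix (Fin 2) (Fin 2) ℂ) * ((((p.2 : ↥(unipotentU (starRingEnd ℂ) J)) : ↥(unitaryGroupOfForm (starRingEnd ℂ) J)) : GL (Fin 2) ℂ) : Matrix (Fin 2) (Fin 2) ℂ) * ((1 : Matrix (Fin 2) (Fin 2) ℂ) + ((0 : ℝ) : ℂ) • !![0, I; 0, 0])) * (((((p.1 : ↥K) : ↥(unitaryGroupOfForm (starRingEnd ℂ) J))⁻¹ : ↥(unitaryGroupOfForm (starRingEnd ℂ) J)) : GL (Fin 2) ℂ) : Matrix (Fin 2) (Fin 2) ℂ)) (((((p.1 : ↥K) : ↥(unitaryGroupOfForm (starRingEnd ℂ) J)) : GL (Fin 2) ℂ) : Matrix (Fin 2) (Fin 2) ℂ) * (((hypBlockGL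 x θ : GL (Fin 2) ℂ) : Matrix (Fin 2) (Fin 2) ℂ) * ((((p.2 : ↥(unipotentU (starRingEnd ℂ) J)) : ↥(unitaryGroupOfForm (starRingEnd ℂ) J)) : GL (Fin 2) ℂ) : Matrix (Fin 2) (Fin 2) ℂ) * (!![0, I; 0, 0] * !![0, 0; I, 0])) * (((((p.1 : ↥K) : ↥(unitaryGroupOfForm (starRingEnd ℂ) J))⁻¹ : ↥(unitaryGroupOfForm (starRingEnd ℂ) J)) : GL (Fin 2) ℂ) : Matrix (Fin 2) (Fin 2) ℂ))) ∂(κ.prod μN)) 0 := by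
    have h := (contDiffAt_hasDerivAt_integral_prod_of_support κ μN hΦ₃ hsE (closedBall_mem_nhds (0 : ℝ) one_pos) ?_).2
    · refine h.congr_deriv (integral_congr_ae (Eventually.of_forall fun p => ?_))
      exact (hasDerivAt_fderiv_comp_conj_unipotent hg ((((p.1 : ↥K) : ↥(unitaryGroupOfForm (starRingEnd ℂ) J)) : GL (Fin 2) ℂ) : Matrix (Fin 2) (Fin 2) ℂ) (((hypBlockGL x θ : GL (Fin 2) ℂ) : Matrix (Fin 2) (Fin 2) ℂ) * ((((p.2 : ↥(unipotentU (starRingEnd ℂ) J)) : ↥(unitaryGroupOfForm (starRingEnd ℂ) J)) : GL (Fin 2) ℂ) : Matrix (Fin 2) (Fin 2) ℂ)) (((((p.1 : ↥K) : ↥(unitaryGroupOfForm (starRingEnd ℂ) J))⁻¹ : ↥(unitaryGroupOfForm (starRingEnd ℂ) J)) : GL (Fin 2) ℂ) : Matrix (Fin 2) (Fin 2) ℂ) 0).deriv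
    · intro r hr p hp
      have hw : ((p.1 : ↥K) : ↥(unitaryGroupOfForm (starRingEnd ℂ) J)) * (tU x * ((p.2 : ↥(unipotentU (starRingEnd ℂ) J)) : ↥(unitaryGroupOfForm (starRingEnd ℂ) J)) * ((uN r : ↥(unipotentU (starRingEnd ℂ) J)) : ↥(unitaryGroupOfForm (starRingEnd ℂ) J))) * ((p.1 : ↥K) : ↥(unitaryGroupOfForm (starRingEnd ℂ) J))⁻¹ ∉ {u : ↥(unitaryGroupOfForm (starRingEnd ℂ) J) | ((u : GL (Fin 2) ℂ) : Matrix (Fin 2) (Fin 2) ℂ) ∈ tsupport g} :=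
        fun hmem => hp (hsuppE r hr p hmem)
      have hz := (hvan _ _ (by rw [hcoe3, htUval, huNval]) hw).2
      simp only [hz, _root_.zero_apply]
  have hEconst : ∀ r : ℝ, (∫ p : ↥K × ↥(unipotentU (starRingEnd ℂ) J), fderiv ℝ g (((((p.1 : ↥K) : ↥(unitaryGroupOfForm (starRingEnd ℂ) J)) : GL (Fin 2) ℂ) : Matrix (Fin 2) (Fin 2) ℂ) * (((hypBlockGL x θ : GL (Fin 2) ℂ) : Matrix (Fin 2) (Fin 2) ℂ) * ((((p.2 : ↥(unipotentU (starRingEnd ℂ) J)) : ↥(unitaryGroupOfForm (starRingEnd ℂ) J)) : GL (Fin 2) ℂ) : Matrix (Fin 2) (Fin 2) ℂ) * ((1 : Matrix (Fin 2) (Fin 2) ℂ) + (r : ℂ) • !![0, I; 0, 0])) * (((((p.1 : ↥K) : ↥(unitaryGroupOfForm (starRingEnd ℂ) J))⁻¹ : ↥(unitaryGroupOfForm (starRingEnd ℂ) J)) : GL (Fin 2) ℂ) : Matrix (Fin 2) (Fin 2) ℂ))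
        (((((p.1 : ↥K) : ↥(unitaryGroupOfForm (starRingEnd ℂ) J)) : GL (Fin 2) ℂ) : Matrix (Fin 2) (Fin 2) ℂ) * (((hypBlockGL x θ : GL (Fin 2) ℂ) : Matrix (Fin 2) (Fin 2) ℂ) * ((((p.2 : ↥(unipotentU (starRingEnd ℂ) J)) : ↥(unitaryGroupOfForm (starRingEnd ℂ) J)) : GL (Fin 2) ℂ) : Matrix (Fin 2) (Fin 2) ℂ) * (((1 : Matrix (Fin 2) (Fin 2) ℂ) + (r : ℂ) • !![0, I; 0, 0]) * !![0, 0; I, 0])) * (((((p.1 : ↥K) : ↥(unitaryGroupOfForm (starRingEnd ℂ) J))⁻¹ : ↥(unitaryGroupOfForm (starRingEnd ℂ) J)) : GL (Fin 2) ℂ) : Matrix (Fin 2) (Fin 2) ℂ)) ∂(κ.prod μN)) =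
      ∫ p : ↥K × ↥(unipotentU (starRingEnd ℂ) J), fderiv ℝ g (((((p.1 : ↥K) : ↥(unitaryGroupOfForm (starRingEnd ℂ) J)) : GL (Fin 2) ℂ) : Matrix (Fin 2) (Fin 2) ℂ) * (((hypBlockGL x θ : GL (Fin 2) ℂ) : Matrix (Fin 2) (Fin 2) ℂ) * ((((p.2 : ↥(unipotentU (starRingEnd ℂ) J)) : ↥(unitaryGroupOfForm (starRingEnd ℂ) J)) : GL (Fin 2) ℂ) : Matrix (Fin 2) (Fin 2) ℂ)) * (((((p.1 : ↥K) : ↥(unitaryGroupOfForm (starRingEnd ℂ) J))⁻¹ : ↥(unitaryGroupOfForm (starRingEnd ℂ) J)) : GL (Fin 2) ℂ) : Matrix (Fin 2) (Fin 2) ℂ)) (((((p.1 : ↥K) : ↥(unitaryGroupOfForm (starRingEnd ℂ) J)) : GL (Fin 2) ℂ) : Matrix (Fin 2) (Fin 2) ℂ) * (((hypBlockGL x θ : GL (Fin 2) ℂ) : Matrix (Fin 2) (Fin 2) ℂ) * (((((p.2 : ↥(unipotentU (starRingEnd ℂ) J)) : ↥(unitaryGroupOfForm (starRingEnd ℂ)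 J)) : GL (Fin 2) ℂ) : Matrix (Fin 2) (Fin 2) ℂ) * !![0, 0; I, 0])) * (((((p.1 : ↥K) : ↥(unitaryGroupOfForm (starRingEnd ℂ) J))⁻¹ : ↥(unitaryGroupOfForm (starRingEnd ℂ) J)) : GL (Fin 2) ℂ) : Matrix (Fin 2) (Fin 2) ℂ)) ∂(κ.prod μN) := by
    intro r
    have h := integral_prod_comp_mul_right_eq κ μN (uN r)
      (fun p : ↥K × ↥(unipotentU (starRingEnd ℂ) J) => fderiv ℝ g (((((p.1 : ↥K) : ↥(unitaryGroupOfForm (starRingEnd ℂ) J)) : GL (Fin 2) ℂ) : Matrix (Fin 2) (Fin 2) ℂ) * (((hypBlockGL x θ : GL (Fin 2) ℂ) : Matrix (Fin 2) (Fin 2) ℂ) * ((((p.2 : ↥(unipotentU (starRingEnd ℂ) J)) : ↥(unitaryGroupOfForm (starRingEnd ℂ) J)) : GL (Fin 2) ℂ) : Matrix (Fin 2) (Fin 2) ℂ)) * (((((p.1 : ↥K) : ↥(unitaryGroupOfForm (starRingEnd ℂ) J))⁻¹ : ↥(unitaryGroupOfForm (starRingEnd ℂ) J)) : GL (Fin 2)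 ℂ) : Matrix (Fin 2) (Fin 2) ℂ)) (((((p.1 : ↥K) : ↥(unitaryGroupOfForm (starRingEnd ℂ) J)) : GL (Fin 2) ℂ) : Matrix (Fin 2) (Fin 2) ℂ) * (((hypBlockGL x θ : GL (Fin 2) ℂ) : Matrix (Fin 2) (Fin 2) ℂ) * (((((p.2 : ↥(unipotentU (starRingEnd ℂ) J)) : ↥(unitaryGroupOfForm (starRingEnd ℂ) J)) : GL (Fin 2) ℂ) : Matrix (Fin 2) (Fin 2) ℂ) * !![0, 0; I, 0])) * (((((p.1 : ↥K) : ↥(unitaryGroupOfForm (starRingEnd ℂ) J))⁻¹ : ↥(unitaryGroupOfForm (starRingEnd ℂ) J)) : GL (Fin 2) ℂ) : Matrix (Fin 2) (Fin 2) ℂ)))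
    refine Eq.trans (integral_congr_ae (Eventually.of_forall fun p => ?_)) h
    simp only [Subgroup.coe_mul, Units.val_mul, huNval, Matrix.mul_assoc]
  have hE0 : HasDerivAt (fun r : ℝ => ∫ p : ↥K × ↥(unipotentU (starRingEnd ℂ) J), fderiv ℝ g (((((p.1 : ↥K) : ↥(unitaryGroupOfForm (starRingEnd ℂ) J)) : GL (Fin 2) ℂ) : Matrix (Fin 2) (Fin 2) ℂ) * (((hypBlockGL x θ : GL (Fin 2) ℂ) : Matrix (Fin 2) (Fin 2) ℂ) * ((((p.2 : ↥(unipotentU (starRingEnd ℂ) J)) : ↥(unitaryGroupOfForm (starRingEnd ℂ) J)) : GL (Fin 2) ℂ) : Matrix (Fin 2) (Fin 2) ℂ) * ((1 : Matrix (Fin 2) (Fin 2) ℂ) + (r : ℂ) • !![0, I; 0, 0])) * (((((p.1 : ↥K) : ↥(unitaryGroupOfForm (starRingEnd ℂ) J))⁻¹ : ↥(unitaryGroupOfForm (starRingEnd ℂ) J)) : GL (Fin 2) ℂ) : Matrix (Fin 2) (Fin 2) ℂ))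
        (((((p.1 : ↥K) : ↥(unitaryGroupOfForm (starRingEnd ℂ) J)) : GL (Fin 2) ℂ) : Matrix (Fin 2) (Fin 2) ℂ) * (((hypBlockGL x θ : GL (Fin 2) ℂ) : Matrix (Fin 2) (Fin 2) ℂ) * ((((p.2 : ↥(unipotentU (starRingEnd ℂ) J)) : ↥(unitaryGroupOfForm (starRingEnd ℂ) J)) : GL (Fin 2) ℂ) : Matrix (Fin 2) (Fin 2) ℂ) * (((1 : Matrix (Fin 2) (Fin 2) ℂ) + (r : ℂ) • !![0, I; 0, 0]) * !![0, 0; I, 0])) * (((((p.1 : ↥K) : ↥(unitaryGroupOfForm (starRingEnd ℂ) J))⁻¹ : ↥(unitaryGroupOfForm (starRingEnd ℂ) J)) : GL (Fin 2) ℂ) : Matrix (Fin 2) (Fin 2) ℂ)) ∂(κ.prod μN)) 0 0 := by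
    rw [funext hEconst]
    exact hasDerivAt_const _ _
  have hE := hEa.unique hE0
  ------------------------------------------------------------------
  -- (Σ) assembly
  ------------------------------------------------------------------
  have hb0 : Complex.cosh ((0 : ℝ) : ℂ) • (1 : Matrix (Fin 2) (Fin 2) ℂ) + Complex.sinh ((0 : ℝ) : ℂ) • (!![1, 0; 0, -1] : Matrix (Fin 2) (Fin 2) ℂ) = 1 := by
    rw [Complex.ofReal_zero, Complex.cosh_zero, Complex.sinh_zero, one_smul, zero_smul, add_zero]
  have hu0 : (1 : Matrix (Fin 2) (Fin 2) ℂ) + ((0 : ℝ) : ℂ) • (!![0, I; 0, 0] : Matrix (Fin 2) (Fin 2) ℂ) = 1 := by rw [Complex.ofReal_zero, zero_smul, add_zero]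
  have hHH : ∀ Z : Matrix (Fin 2) (Fin 2) ℂ, ((hypBlockGL x θ : GL (Fin 2) ℂ) : Matrix (Fin 2) (Fin 2) ℂ) * Z * (!![1, 0; 0, -1] * !![1, 0; 0, -1]) = ((hypBlockGL x θ : GL (Fin 2) ℂ) : Matrix (Fin 2) (Fin 2) ℂ) * Z * !![1, 0; 0, -1] * !![1, 0; 0, -1] := fun Z => (Matrix.mul_assoc _ _ _).symm
  simp only [hb0, hu0, Real.exp_zero, mul_zero, add_zero, one_smul, one_mul, mul_one, hHH] at hN2 hN1 hE
  -- pointwise flows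
  have hpt : ∀ p : ↥K × ↥(unipotentU (starRingEnd ℂ) J), Ω g (((((p.1 : ↥K) : ↥(unitaryGroupOfForm (starRingEnd ℂ) J)) * ((⟨hypBlockGL x θ, hypBlockGL_mem_of_eq_over hJ x θ⟩ : ↥(unitaryGroupOfForm (starRingEnd ℂ) J)) * ((p.2 : ↥(unipotentU (starRingEnd ℂ) J)) : ↥(unitaryGroupOfForm (starRingEnd ℂ) J))) * ((p.1 : ↥K) : ↥(unitaryGroupOfForm (starRingEnd ℂ) J))⁻¹ : ↥(unitaryGroupOfForm (starRingEnd ℂ) J)) : GL (Fin 2) ℂ) : Matrix (Fin 2) (Fin 2) ℂ) =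
      (fderiv ℝ (fderiv ℝ g) (((((p.1 : ↥K) : ↥(unitaryGroupOfForm (starRingEnd ℂ) J)) : GL (Fin 2) ℂ) : Matrix (Fin 2) (Fin 2) ℂ) * (((hypBlockGL x θ : GL (Fin 2) ℂ) : Matrix (Fin 2) (Fin 2) ℂ) * ((((p.2 : ↥(unipotentU (starRingEnd ℂ) J)) : ↥(unitaryGroupOfForm (starRingEnd ℂ) J)) : GL (Fin 2) ℂ) : Matrix (Fin 2) (Fin 2) ℂ)) * (((((p.1 : ↥K) : ↥(unitaryGroupOfForm (starRingEnd ℂ) J))⁻¹ : ↥(unitaryGroupOfForm (starRingEnd ℂ) J)) : GL (Fin 2) ℂ) : Matrix (Fin 2) (Fin 2) ℂ)) (((((p.1 : ↥K) : ↥(unitaryGroupOfForm (starRingEnd ℂ) J)) : GL (Fin 2) ℂ) : Matrix (Fin 2) (Fin 2) ℂ) * (((hypBlockGL x θ : GL (Fin 2) ℂ) : Matrix (Fin 2) (Fin 2) ℂ) * ((((p.2 : ↥(unipotentU (starRingEnd ℂ) J)) : ↥(unitaryGroupOfForm (starRingEnd ℂ) J)) : GL (Fin 2) ℂ) : Matrix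 (Fin 2) (Fin 2) ℂ) * !![1, 0; 0, -1]) * (((((p.1 : ↥K) : ↥(unitaryGroupOfForm (starRingEnd ℂ) J))⁻¹ : ↥(unitaryGroupOfForm (starRingEnd ℂ) J)) : GL (Fin 2) ℂ) : Matrix (Fin 2) (Fin 2) ℂ)) (((((p.1 : ↥K) : ↥(unitaryGroupOfForm (starRingEnd ℂ) J)) : GL (Fin 2) ℂ) : Matrix (Fin 2) (Fin 2) ℂ) * (((hypBlockGL x θ : GL (Fin 2) ℂ) : Matrix (Fin 2) (Fin 2) ℂ) * ((((p.2 : ↥(unipotentU (starRingEnd ℂ) J)) : ↥(unitaryGroupOfForm (starRingEnd ℂ) J)) : GL (Fin 2) ℂ) : Matrix (Fin 2) (Fin 2) ℂ) * !![1, 0; 0, -1]) * (((((p.1 : ↥K) : ↥(unitaryGroupOfForm (starRingEnd ℂ) J))⁻¹ : ↥(unitaryGroupOfForm (starRingEnd ℂ) J)) : GL (Fin 2) ℂ) : Matrix (Fin 2) (Fin 2) ℂ)) +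
          fderiv ℝ g (((((p.1 : ↥K) : ↥(unitaryGroupOfForm (starRingEnd ℂ) J)) : GL (Fin 2) ℂ) : Matrix (Fin 2) (Fin 2) ℂ) * (((hypBlockGL x θ : GL (Fin 2) ℂ) : Matrix (Fin 2) (Fin 2) ℂ) * ((((p.2 : ↥(unipotentU (starRingEnd ℂ) J)) : ↥(unitaryGroupOfForm (starRingEnd ℂ) J)) : GL (Fin 2) ℂ) : Matrix (Fin 2) (Fin 2) ℂ)) * (((((p.1 : ↥K) : ↥(unitaryGroupOfForm (starRingEnd ℂ) J))⁻¹ : ↥(unitaryGroupOfForm (starRingEnd ℂ) J)) : GL (Fin 2) ℂ) : Matrix (Fin 2) (Fin 2) ℂ)) (((((p.1 : ↥K) : ↥(unitaryGroupOfForm (starRingEnd ℂ) J)) : GL (Fin 2) ℂ) : Matrix (Fin 2) (Fin 2) ℂ) * (((hypBlockGL x θ : GL (Fin 2) ℂ) : Matrix (Fin 2) (Fin 2) ℂ) * ((((p.2 : ↥(unipotentU (starRingEnd ℂ) J)) : ↥(unitaryGroupOfForm (starRingEnd ℂ) J)) : GL (Fin 2) ℂ) : Matrix (Fin 2) (Fin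 2) ℂ) * !![1, 0; 0, -1] * !![1, 0; 0, -1]) * (((((p.1 : ↥K) : ↥(unitaryGroupOfForm (starRingEnd ℂ) J))⁻¹ : ↥(unitaryGroupOfForm (starRingEnd ℂ) J)) : GL (Fin 2) ℂ) : Matrix (Fin 2) (Fin 2) ℂ))) -
        (2 : ℝ) • fderiv ℝ g (((((p.1 : ↥K) : ↥(unitaryGroupOfForm (starRingEnd ℂ) J)) : GL (Fin 2) ℂ) : Matrix (Fin 2) (Fin 2) ℂ) * (((hypBlockGL x θ : GL (Fin 2) ℂ) : Matrix (Fin 2) (Fin 2) ℂ) * ((((p.2 : ↥(unipotentU (starRingEnd ℂ) J)) : ↥(unitaryGroupOfForm (starRingEnd ℂ) J)) : GL (Fin 2) ℂ) : Matrix (Fin 2) (Fin 2) ℂ)) * (((((p.1 : ↥K) : ↥(unitaryGroupOfForm (starRingEnd ℂ) J))⁻¹ : ↥(unitaryGroupOfForm (starRingEnd ℂ) J)) : GL (Fin 2) ℂ) : Matrix (Fin 2) (Fin 2) ℂ)) (((((p.1 : ↥K) : ↥(unitaryGroupOfForm (starRingEnd ℂ) J)) : GL (Fin 2) ℂ) :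 Matrix (Fin 2) (Fin 2) ℂ) * (((hypBlockGL x θ : GL (Fin 2) ℂ) : Matrix (Fin 2) (Fin 2) ℂ) * ((((p.2 : ↥(unipotentU (starRingEnd ℂ) J)) : ↥(unitaryGroupOfForm (starRingEnd ℂ) J)) : GL (Fin 2) ℂ) : Matrix (Fin 2) (Fin 2) ℂ) * !![1, 0; 0, -1]) * (((((p.1 : ↥K) : ↥(unitaryGroupOfForm (starRingEnd ℂ) J))⁻¹ : ↥(unitaryGroupOfForm (starRingEnd ℂ) J)) : GL (Fin 2) ℂ) : Matrix (Fin 2) (Fin 2) ℂ)) -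
        (4 : ℝ) • (fderiv ℝ (fderiv ℝ g) (((((p.1 : ↥K) : ↥(unitaryGroupOfForm (starRingEnd ℂ) J)) : GL (Fin 2) ℂ) : Matrix (Fin 2) (Fin 2) ℂ) * (((hypBlockGL x θ : GL (Fin 2) ℂ) : Matrix (Fin 2) (Fin 2) ℂ) * ((((p.2 : ↥(unipotentU (starRingEnd ℂ) J)) : ↥(unitaryGroupOfForm (starRingEnd ℂ) J)) : GL (Fin 2) ℂ) : Matrix (Fin 2) (Fin 2) ℂ)) * (((((p.1 : ↥K) : ↥(unitaryGroupOfForm (starRingEnd ℂ) J))⁻¹ : ↥(unitaryGroupOfForm (starRingEnd ℂ) J)) : GL (Fin 2) ℂ) : Matrix (Fin 2) (Fin 2) ℂ)) (((((p.1 : ↥K) : ↥(unitaryGroupOfForm (starRingEnd ℂ) J)) : GL (Fin 2) ℂ) : Matrix (Fin 2) (Fin 2) ℂ) * (((hypBlockGL x θ : GL (Fin 2) ℂ) : Matrix (Fin 2) (Fin 2) ℂ) * ((((p.2 : ↥(unipotentU (starRingEnd ℂ) J)) : ↥(unitaryGroupOfForm (starRingEnd ℂ) J)) : GL (Fin 2)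 ℂ) : Matrix (Fin 2) (Fin 2) ℂ) * !![0, I; 0, 0]) * (((((p.1 : ↥K) : ↥(unitaryGroupOfForm (starRingEnd ℂ) J))⁻¹ : ↥(unitaryGroupOfForm (starRingEnd ℂ) J)) : GL (Fin 2) ℂ) : Matrix (Fin 2) (Fin 2) ℂ)) (((((p.1 : ↥K) : ↥(unitaryGroupOfForm (starRingEnd ℂ) J)) : GL (Fin 2) ℂ) : Matrix (Fin 2) (Fin 2) ℂ) * (((hypBlockGL x θ : GL (Fin 2) ℂ) : Matrix (Fin 2) (Fin 2) ℂ) * ((((p.2 : ↥(unipotentU (starRingEnd ℂ) J)) : ↥(unitaryGroupOfForm (starRingEnd ℂ) J)) : GL (Fin 2) ℂ) : Matrix (Fin 2) (Fin 2) ℂ) * !![0, 0; I, 0]) * (((((p.1 : ↥K) : ↥(unitaryGroupOfForm (starRingEnd ℂ) J))⁻¹ : ↥(unitaryGroupOfForm (starRingEnd ℂ) J)) : GL (Fin 2) ℂ) : Matrix (Fin 2) (Fin 2) ℂ)) +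
          fderiv ℝ g (((((p.1 : ↥K) : ↥(unitaryGroupOfForm (starRingEnd ℂ) J)) : GL (Fin 2) ℂ) : Matrix (Fin 2) (Fin 2) ℂ) * (((hypBlockGL x θ : GL (Fin 2) ℂ) : Matrix (Fin 2) (Fin 2) ℂ) * ((((p.2 : ↥(unipotentU (starRingEnd ℂ) J)) : ↥(unitaryGroupOfForm (starRingEnd ℂ) J)) : GL (Fin 2) ℂ) : Matrix (Fin 2) (Fin 2) ℂ)) * (((((p.1 : ↥K) : ↥(unitaryGroupOfForm (starRingEnd ℂ) J))⁻¹ : ↥(unitaryGroupOfForm (starRingEnd ℂ) J)) : GL (Fin 2) ℂ) : Matrix (Fin 2) (Fin 2) ℂ)) (((((p.1 : ↥K) : ↥(unitaryGroupOfForm (starRingEnd ℂ) J)) : GL (Fin 2) ℂ) : Matrix (Fin 2) (Fin 2) ℂ) * (((hypBlockGL x θ : GL (Fin 2) ℂ) : Matrix (Fin 2) (Fin 2) ℂ) * ((((p.2 : ↥(unipotentU (starRingEnd ℂ) J)) : ↥(unitaryGroupOfForm (starRingEnd ℂ) J)) : GL (Fin 2) ℂ) : Matrix (Fin 2) (Fin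 2) ℂ) * (!![0, I; 0, 0] * !![0, 0; I, 0])) * (((((p.1 : ↥K) : ↥(unitaryGroupOfForm (starRingEnd ℂ) J))⁻¹ : ↥(unitaryGroupOfForm (starRingEnd ℂ) J)) : GL (Fin 2) ℂ) : Matrix (Fin 2) (Fin 2) ℂ))) := fun p => by
    rw [hcoe2]
    exact casimirJ_apply_conj_eq_flows hJ hg hΩ ((p.1 : ↥K) : ↥(unitaryGroupOfForm (starRingEnd ℂ) J)) (((hypBlockGL x θ : GL (Fin 2) ℂ) : Matrix (Fin 2) (Fin 2) ℂ) * ((((p.2 : ↥(unipotentU (starRingEnd ℂ) J)) : ↥(unitaryGroupOfForm (starRingEnd ℂ) J)) : GL (Fin 2) ℂ) : Matrix (Fin 2) (Fin 2) ℂ))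
  -- integrability of the three integrands (continuous, supported in the compact carriers at parameter 0)
  have hint1 : Integrable (fun p : ↥K × ↥(unipotentU (starRingEnd ℂ) J) => fderiv ℝ g (((((p.1 : ↥K) : ↥(unitaryGroupOfForm (starRingEnd ℂ) J)) : GL (Fin 2) ℂ) : Matrix (Fin 2) (Fin 2) ℂ) * (((hypBlockGL x θ : GL (Fin 2) ℂ) : Matrix (Fin 2) (Fin 2) ℂ) * ((((p.2 : ↥(unipotentU (starRingEnd ℂ) J)) : ↥(unitaryGroupOfForm (starRingEnd ℂ) J)) : GL (Fin 2) ℂ) : Matrix (Fin 2) (Fin 2) ℂ)) * (((((p.1 : ↥K) : ↥(unitaryGroupOfForm (starRingEnd ℂ) J))⁻¹ : ↥(unitaryGroupOfForm (starRingEnd ℂ) J)) : GL (Fin 2) ℂ) : Matrix (Fin 2) (Fin 2) ℂ)) (((((p.1 : ↥K) : ↥(unitaryGroupOfForm (starRingEnd ℂ) J)) : GL (Fin 2) ℂ) : Matrix (Fin 2) (Fin 2) ℂ) * (((hypBlockGL x θ : GL (Fin 2) ℂ) : Matrix (Fin 2) (Fin 2) ℂ) * ((((p.2 : ↥(unipotentU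 (starRingEnd ℂ) J)) : ↥(unitaryGroupOfForm (starRingEnd ℂ) J)) : GL (Fin 2) ℂ) : Matrix (Fin 2) (Fin 2) ℂ) * !![1, 0; 0, -1]) * (((((p.1 : ↥K) : ↥(unitaryGroupOfForm (starRingEnd ℂ) J))⁻¹ : ↥(unitaryGroupOfForm (starRingEnd ℂ) J)) : GL (Fin 2) ℂ) : Matrix (Fin 2) (Fin 2) ℂ))) (κ.prod μN) := by
    have hc : Continuous fun p : ↥K × ↥(unipotentU (starRingEnd ℂ) J) => fderiv ℝ g (((((p.1 : ↥K) : ↥(unitaryGroupOfForm (starRingEnd ℂ) J)) : GL (Fin 2) ℂ) : Matrix (Fin 2) (Fin 2) ℂ) * (((hypBlockGL x θ : GL (Fin 2) ℂ) : Matrix (Fin 2) (Fin 2) ℂ) * ((((p.2 : ↥(unipotentU (starRingEnd ℂ) J)) : ↥(unitaryGroupOfForm (starRingEnd ℂ) J)) : GL (Fin 2) ℂ) : Matrix (Fin 2) (Fin 2) ℂ)) * (((((p.1 : ↥K) : ↥(unitaryGroupOfForm (starRingEnd ℂ) J))⁻¹ : ↥(unitaryGroupOfForm (starRingEnd ℂ)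 J)) : GL (Fin 2) ℂ) : Matrix (Fin 2) (Fin 2) ℂ)) (((((p.1 : ↥K) : ↥(unitaryGroupOfForm (starRingEnd ℂ) J)) : GL (Fin 2) ℂ) : Matrix (Fin 2) (Fin 2) ℂ) * (((hypBlockGL x θ : GL (Fin 2) ℂ) : Matrix (Fin 2) (Fin 2) ℂ) * ((((p.2 : ↥(unipotentU (starRingEnd ℂ) J)) : ↥(unitaryGroupOfForm (starRingEnd ℂ) J)) : GL (Fin 2) ℂ) : Matrix (Fin 2) (Fin 2) ℂ) * !![1, 0; 0, -1]) * (((((p.1 : ↥K) : ↥(unitaryGroupOfForm (starRingEnd ℂ) J))⁻¹ : ↥(unitaryGroupOfForm (starRingEnd ℂ) J)) : GL (Fin 2) ℂ) : Matrix (Fin 2) (Fin 2) ℂ)) := by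
      have hk : Continuous fun p : ↥K × ↥(unipotentU (starRingEnd ℂ) J) => ((((p.1 : ↥K) : ↥(unitaryGroupOfForm (starRingEnd ℂ) J)) : GL (Fin 2) ℂ) : Matrix (Fin 2) (Fin 2) ℂ) := (Units.continuous_val.comp continuous_subtype_val).comp (continuous_subtype_val.comp continuous_fst)
      have hki : Continuous fun p : ↥K × ↥(unipotentU (starRingEnd ℂ) J) => (((((p.1 : ↥K) : ↥(unitaryGroupOfForm (starRingEnd ℂ) J))⁻¹ : ↥(unitaryGroupOfForm (starRingEnd ℂ) J)) : GL (Fin 2) ℂ) : Matrix (Fin 2) (Fin 2) ℂ) :=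
        (Units.continuous_val.comp continuous_subtype_val).comp ((continuous_subtype_val.comp continuous_fst).inv)
      have hn : Continuous fun p : ↥K × ↥(unipotentU (starRingEnd ℂ) J) => ((((p.2 : ↥(unipotentU (starRingEnd ℂ) J)) : ↥(unitaryGroupOfForm (starRingEnd ℂ) J)) : GL (Fin 2) ℂ) : Matrix (Fin 2) (Fin 2) ℂ) := (Units.continuous_val.comp continuous_subtype_val).comp (continuous_subtype_val.comp continuous_snd)
      exact (hDgcont.comp ((hk.mul (continuous_const.mul hn)).mul hki)).clm_apply ((hk.mul ((continuous_const.mul hn).mul continuous_const)).mul hki)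
    refine hc.integrable_of_hasCompactSupport (HasCompactSupport.intro hsN fun p hp => ?_)
    have hw : ((p.1 : ↥K) : ↥(unitaryGroupOfForm (starRingEnd ℂ) J)) * (tU x * ((p.2 : ↥(unipotentU (starRingEnd ℂ) J)) : ↥(unitaryGroupOfForm (starRingEnd ℂ) J)) * hB 0) * ((p.1 : ↥K) : ↥(unitaryGroupOfForm (starRingEnd ℂ) J))⁻¹ ∉ {u : ↥(unitaryGroupOfForm (starRingEnd ℂ) J) | ((u : GL (Fin 2) ℂ) : Matrix (Fin 2) (Fin 2) ℂ) ∈ tsupport g} := fun hmem => hp (hsuppN 0 (mem_closedBall_self zero_le_one) p hmem)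
    have hz := (hvan _ _ (by rw [hcoe3, htUval, hhBval, hb0, Matrix.mul_one]) hw).2
    simp only [hz, _root_.zero_apply]
  have hint2 : Integrable (fun p : ↥K × ↥(unipotentU (starRingEnd ℂ) J) =>
      fderiv ℝ (fderiv ℝ g) (((((p.1 : ↥K) : ↥(unitaryGroupOfForm (starRingEnd ℂ) J)) : GL (Fin 2) ℂ) : Matrix (Fin 2) (Fin 2) ℂ) * (((hypBlockGL x θ : GL (Fin 2) ℂ) : Matrix (Fin 2) (Fin 2) ℂ) * ((((p.2 : ↥(unipotentU (starRingEnd ℂ) J)) : ↥(unitaryGroupOfForm (starRingEnd ℂ) J)) : GL (Fin 2) ℂ) : Matrix (Fin 2) (Fin 2) ℂ)) * (((((p.1 : ↥K) : ↥(unitaryGroupOfForm (starRingEnd ℂ) J))⁻¹ : ↥(unitaryGroupOfForm (starRingEnd ℂ) J)) : GL (Fin 2) ℂ) : Matrix (Fin 2) (Fin 2) ℂ)) (((((p.1 : ↥K) : ↥(unitaryGroupOfForm (starRingEnd ℂ) J)) : GL (Fin 2) ℂ) : Matrix (Fin 2) (Fin 2) ℂ) * (((hypBlockGL x θ : GL (Fin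 2) ℂ) : Matrix (Fin 2) (Fin 2) ℂ) * ((((p.2 : ↥(unipotentU (starRingEnd ℂ) J)) : ↥(unitaryGroupOfForm (starRingEnd ℂ) J)) : GL (Fin 2) ℂ) : Matrix (Fin 2) (Fin 2) ℂ) * !![1, 0; 0, -1]) * (((((p.1 : ↥K) : ↥(unitaryGroupOfForm (starRingEnd ℂ) J))⁻¹ : ↥(unitaryGroupOfForm (starRingEnd ℂ) J)) : GL (Fin 2) ℂ) : Matrix (Fin 2) (Fin 2) ℂ)) (((((p.1 : ↥K) : ↥(unitaryGroupOfForm (starRingEnd ℂ) J)) : GL (Fin 2) ℂ) : Matrix (Fin 2) (Fin 2) ℂ) * (((hypBlockGL x θ : GL (Fin 2) ℂ) : Matrix (Fin 2) (Fin 2) ℂ) * ((((p.2 : ↥(unipotentU (starRingEnd ℂ) J)) : ↥(unitaryGroupOfForm (starRingEnd ℂ) J)) : GL (Fin 2) ℂ) : Matrix (Fin 2) (Fin 2) ℂ) * !![1, 0; 0, -1]) * (((((p.1 : ↥K) : ↥(unitaryGroupOfForm (starRingEnd ℂ) J))⁻¹ : ↥(unitaryGroupOfForm (starRingEnd ℂ)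 J)) : GL (Fin 2) ℂ) : Matrix (Fin 2) (Fin 2) ℂ)) +
        fderiv ℝ g (((((p.1 : ↥K) : ↥(unitaryGroupOfForm (starRingEnd ℂ) J)) : GL (Fin 2) ℂ) : Matrix (Fin 2) (Fin 2) ℂ) * (((hypBlockGL x θ : GL (Fin 2) ℂ) : Matrix (Fin 2) (Fin 2) ℂ) * ((((p.2 : ↥(unipotentU (starRingEnd ℂ) J)) : ↥(unitaryGroupOfForm (starRingEnd ℂ) J)) : GL (Fin 2) ℂ) : Matrix (Fin 2) (Fin 2) ℂ)) * (((((p.1 : ↥K) : ↥(unitaryGroupOfForm (starRingEnd ℂ) J))⁻¹ : ↥(unitaryGroupOfForm (starRingEnd ℂ) J)) : GL (Fin 2) ℂ) : Matrix (Fin 2) (Fin 2) ℂ)) (((((p.1 : ↥K) : ↥(unitaryGroupOfForm (starRingEnd ℂ) J)) : GL (Fin 2) ℂ) : Matrix (Fin 2) (Fin 2) ℂ) * (((hypBlockGL x θ : GL (Fin 2) ℂ) : Matrix (Fin 2) (Fin 2) ℂ) * ((((p.2 : ↥(unipotentU (starRingEnd ℂ) J)) : ↥(unitaryGroupOfForm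 (starRingEnd ℂ) J)) : GL (Fin 2) ℂ) : Matrix (Fin 2) (Fin 2) ℂ) * !![1, 0; 0, -1] * !![1, 0; 0, -1]) * (((((p.1 : ↥K) : ↥(unitaryGroupOfForm (starRingEnd ℂ) J))⁻¹ : ↥(unitaryGroupOfForm (starRingEnd ℂ) J)) : GL (Fin 2) ℂ) : Matrix (Fin 2) (Fin 2) ℂ))) (κ.prod μN) := by
    have hk : Continuous fun p : ↥K × ↥(unipotentU (starRingEnd ℂ) J) => ((((p.1 : ↥K) : ↥(unitaryGroupOfForm (starRingEnd ℂ) J)) : GL (Fin 2) ℂ) : Matrix (Fin 2) (Fin 2) ℂ) := (Units.continuous_val.comp continuous_subtype_val).comp (continuous_subtype_val.comp continuous_fst)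
    have hki : Continuous fun p : ↥K × ↥(unipotentU (starRingEnd ℂ) J) => (((((p.1 : ↥K) : ↥(unitaryGroupOfForm (starRingEnd ℂ) J))⁻¹ : ↥(unitaryGroupOfForm (starRingEnd ℂ) J)) : GL (Fin 2) ℂ) : Matrix (Fin 2) (Fin 2) ℂ) :=
      (Units.continuous_val.comp continuous_subtype_val).comp ((continuous_subtype_val.comp continuous_fst).inv)
    have hn : Continuous fun p : ↥K × ↥(unipotentU (starRingEnd ℂ) J) => ((((p.2 : ↥(unipotentU (starRingEnd ℂ) J)) : ↥(unitaryGroupOfForm (starRingEnd ℂ) J)) : GL (Fin 2) ℂ) : Matrix (Fin 2) (Fin 2) ℂ) := (Units.continuous_val.comp continuous_subtype_val).comp (continuous_subtype_val.comp continuous_snd)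
    have hY : Continuous fun p : ↥K × ↥(unipotentU (starRingEnd ℂ) J) => ((((p.1 : ↥K) : ↥(unitaryGroupOfForm (starRingEnd ℂ) J)) : GL (Fin 2) ℂ) : Matrix (Fin 2) (Fin 2) ℂ) * (((hypBlockGL x θ : GL (Fin 2) ℂ) : Matrix (Fin 2) (Fin 2) ℂ) * ((((p.2 : ↥(unipotentU (starRingEnd ℂ) J)) : ↥(unitaryGroupOfForm (starRingEnd ℂ) J)) : GL (Fin 2) ℂ) : Matrix (Fin 2) (Fin 2) ℂ)) * (((((p.1 : ↥K) : ↥(unitaryGroupOfForm (starRingEnd ℂ) J))⁻¹ : ↥(unitaryGroupOfForm (starRingEnd ℂ) J)) : GL (Fin 2) ℂ) : Matrix (Fin 2) (Fin 2) ℂ) := (hk.mul (continuous_const.mul hn)).mul hki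
    have hV : Continuous fun p : ↥K × ↥(unipotentU (starRingEnd ℂ) J) => ((((p.1 : ↥K) : ↥(unitaryGroupOfForm (starRingEnd ℂ) J)) : GL (Fin 2) ℂ) : Matrix (Fin 2) (Fin 2) ℂ) * (((hypBlockGL x θ : GL (Fin 2) ℂ) : Matrix (Fin 2) (Fin 2) ℂ) * ((((p.2 : ↥(unipotentU (starRingEnd ℂ) J)) : ↥(unitaryGroupOfForm (starRingEnd ℂ) J)) : GL (Fin 2) ℂ) : Matrix (Fin 2) (Fin 2) ℂ) * !![1, 0; 0, -1]) * (((((p.1 : ↥K) : ↥(unitaryGroupOfForm (starRingEnd ℂ) J))⁻¹ : ↥(unitaryGroupOfForm (starRingEnd ℂ) J)) : GL (Fin 2) ℂ) : Matrix (Fin 2) (Fin 2) ℂ) := (hk.mul ((continuous_const.mul hn).mul continuous_const)).mul hki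
    have hV2 : Continuous fun p : ↥K × ↥(unipotentU (starRingEnd ℂ) J) => ((((p.1 : ↥K) : ↥(unitaryGroupOfForm (starRingEnd ℂ) J)) : GL (Fin 2) ℂ) : Matrix (Fin 2) (Fin 2) ℂ) * (((hypBlockGL x θ : GL (Fin 2) ℂ) : Matrix (Fin 2) (Fin 2) ℂ) * ((((p.2 : ↥(unipotentU (starRingEnd ℂ) J)) : ↥(unitaryGroupOfForm (starRingEnd ℂ) J)) : GL (Fin 2) ℂ) : Matrix (Fin 2) (Fin 2) ℂ) * !![1, 0; 0, -1] * !![1, 0; 0, -1]) * (((((p.1 : ↥K) : ↥(unitaryGroupOfForm (starRingEnd ℂ) J))⁻¹ : ↥(unitaryGroupOfForm (starRingEnd ℂ) J)) : GL (Fin 2) ℂ) : Matrix (Fin 2) (Fin 2) ℂ) :=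
      (hk.mul (((continuous_const.mul hn).mul continuous_const).mul continuous_const)).mul hki
    have hD2cont := ((contDiff_infty_iff_fderiv.1 hg').2).continuous
    have hc : Continuous fun p : ↥K × ↥(unipotentU (starRingEnd ℂ) J) =>
        fderiv ℝ (fderiv ℝ g) (((((p.1 : ↥K) : ↥(unitaryGroupOfForm (starRingEnd ℂ) J)) : GL (Fin 2) ℂ) : Matrix (Fin 2) (Fin 2) ℂ) * (((hypBlockGL x θ : GL (Fin 2) ℂ) : Matrix (Fin 2) (Fin 2) ℂ) * ((((p.2 : ↥(unipotentU (starRingEnd ℂ) J)) : ↥(unitaryGroupOfForm (starRingEnd ℂ) J)) : GL (Fin 2) ℂ) : Matrix (Fin 2) (Fin 2) ℂ)) * (((((p.1 : ↥K) : ↥(unitaryGroupOfForm (starRingEnd ℂ) J))⁻¹ : ↥(unitaryGroupOfForm (starRingEnd ℂ) J)) : GL (Fin 2) ℂ) : Matrix (Fin 2) (Fin 2) ℂ)) (((((p.1 : ↥K) : ↥(unitaryGroupOfForm (starRingEnd ℂ) J)) : GL (Fin 2) ℂ) : Matrix (Fin 2) (Fin 2) ℂ) * (((hypBlockGL x θ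 : GL (Fin 2) ℂ) : Matrix (Fin 2) (Fin 2) ℂ) * ((((p.2 : ↥(unipotentU (starRingEnd ℂ) J)) : ↥(unitaryGroupOfForm (starRingEnd ℂ) J)) : GL (Fin 2) ℂ) : Matrix (Fin 2) (Fin 2) ℂ) * !![1, 0; 0, -1]) * (((((p.1 : ↥K) : ↥(unitaryGroupOfForm (starRingEnd ℂ) J))⁻¹ : ↥(unitaryGroupOfForm (starRingEnd ℂ) J)) : GL (Fin 2) ℂ) : Matrix (Fin 2) (Fin 2) ℂ)) (((((p.1 : ↥K) : ↥(unitaryGroupOfForm (starRingEnd ℂ) J)) : GL (Fin 2) ℂ) : Matrix (Fin 2) (Fin 2) ℂ) * (((hypBlockGL x θ : GL (Fin 2) ℂ) : Matrix (Fin 2) (Fin 2) ℂ) * ((((p.2 : ↥(unipotentU (starRingEnd ℂ) J)) : ↥(unitaryGroupOfForm (starRingEnd ℂ) J)) : GL (Fin 2) ℂ) : Matrix (Fin 2) (Fin 2) ℂ) * !![1, 0; 0, -1]) * (((((p.1 : ↥K) : ↥(unitaryGroupOfForm (starRingEnd ℂ) J))⁻¹ : ↥(unitaryGroupOfForm (starRingEnd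 ℂ) J)) : GL (Fin 2) ℂ) : Matrix (Fin 2) (Fin 2) ℂ)) +
          fderiv ℝ g (((((p.1 : ↥K) : ↥(unitaryGroupOfForm (starRingEnd ℂ) J)) : GL (Fin 2) ℂ) : Matrix (Fin 2) (Fin 2) ℂ) * (((hypBlockGL x θ : GL (Fin 2) ℂ) : Matrix (Fin 2) (Fin 2) ℂ) * ((((p.2 : ↥(unipotentU (starRingEnd ℂ) J)) : ↥(unitaryGroupOfForm (starRingEnd ℂ) J)) : GL (Fin 2) ℂ) : Matrix (Fin 2) (Fin 2) ℂ)) * (((((p.1 : ↥K) : ↥(unitaryGroupOfForm (starRingEnd ℂ) J))⁻¹ : ↥(unitaryGroupOfForm (starRingEnd ℂ) J)) : GL (Fin 2) ℂ) : Matrix (Fin 2) (Fin 2) ℂ)) (((((p.1 : ↥K) : ↥(unitaryGroupOfForm (starRingEnd ℂ) J)) : GL (Fin 2) ℂ) : Matrix (Fin 2) (Fin 2) ℂ) * (((hypBlockGL x θ : GL (Fin 2) ℂ) : Matrix (Fin 2) (Fin 2) ℂ) * ((((p.2 : ↥(unipotentU (starRingEnd ℂ) J)) : ↥(unitaryGroupOfForm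 (starRingEnd ℂ) J)) : GL (Fin 2) ℂ) : Matrix (Fin 2) (Fin 2) ℂ) * !![1, 0; 0, -1] * !![1, 0; 0, -1]) * (((((p.1 : ↥K) : ↥(unitaryGroupOfForm (starRingEnd ℂ) J))⁻¹ : ↥(unitaryGroupOfForm (starRingEnd ℂ) J)) : GL (Fin 2) ℂ) : Matrix (Fin 2) (Fin 2) ℂ)) :=
      (((hD2cont.comp hY).clm_apply hV).clm_apply hV).add ((hDgcont.comp hY).clm_apply hV2)
    refine hc.integrable_of_hasCompactSupport (HasCompactSupport.intro hsN fun p hp => ?_)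
    have hw : ((p.1 : ↥K) : ↥(unitaryGroupOfForm (starRingEnd ℂ) J)) * (tU x * ((p.2 : ↥(unipotentU (starRingEnd ℂ) J)) : ↥(unitaryGroupOfForm (starRingEnd ℂ) J)) * hB 0) * ((p.1 : ↥K) : ↥(unitaryGroupOfForm (starRingEnd ℂ) J))⁻¹ ∉ {u : ↥(unitaryGroupOfForm (starRingEnd ℂ) J) | ((u : GL (Fin 2) ℂ) : Matrix (Fin 2) (Fin 2) ℂ) ∈ tsupport g} := fun hmem => hp (hsuppN 0 (mem_closedBall_self zero_le_one) p hmem)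
    have hZ : ((((p.1 : ↥K) : ↥(unitaryGroupOfForm (starRingEnd ℂ) J)) : GL (Fin 2) ℂ) : Matrix (Fin 2) (Fin 2) ℂ) * (((hypBlockGL x θ : GL (Fin 2) ℂ) : Matrix (Fin 2) (Fin 2) ℂ) * ((((p.2 : ↥(unipotentU (starRingEnd ℂ) J)) : ↥(unitaryGroupOfForm (starRingEnd ℂ) J)) : GL (Fin 2) ℂ) : Matrix (Fin 2) (Fin 2) ℂ)) * (((((p.1 : ↥K) : ↥(unitaryGroupOfForm (starRingEnd ℂ) J))⁻¹ : ↥(unitaryGroupOfForm (starRingEnd ℂ) J)) : GL (Fin 2) ℂ) : Matrix (Fin 2) (Fin 2) ℂ) ∉ tsupport g := by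
      have e : (((((p.1 : ↥K) : ↥(unitaryGroupOfForm (starRingEnd ℂ) J)) * (tU x * ((p.2 : ↥(unipotentU (starRingEnd ℂ) J)) : ↥(unitaryGroupOfForm (starRingEnd ℂ) J)) * hB 0) * ((p.1 : ↥K) : ↥(unitaryGroupOfForm (starRingEnd ℂ) J))⁻¹ : ↥(unitaryGroupOfForm (starRingEnd ℂ) J)) : GL (Fin 2) ℂ) : Matrix (Fin 2) (Fin 2) ℂ) = ((((p.1 : ↥K) : ↥(unitaryGroupOfForm (starRingEnd ℂ) J)) : GL (Fin 2) ℂ) : Matrix (Fin 2) (Fin 2) ℂ) * (((hypBlockGL x θ : GL (Fin 2) ℂ) : Matrix (Fin 2) (Fin 2) ℂ) * ((((p.2 : ↥(unipotentU (starRingEnd ℂ) J)) : ↥(unitaryGroupOfForm (starRingEnd ℂ) J)) : GL (Fin 2) ℂ) : Matrix (Fin 2) (Fin 2) ℂ)) * (((((p.1 : ↥K) : ↥(unitaryGroupOfForm (starRingEnd ℂ) J))⁻¹ : ↥(unitaryGroupOfForm (starRingEnd ℂ) J)) : GL (Fin 2) ℂ) : Matrix (Fin 2) (Fin 2) ℂ)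 := by
        rw [hcoe3, htUval, hhBval, hb0, Matrix.mul_one]
      rw [← e]; exact hw
    obtain ⟨-, h1, h2⟩ := ConjugationCurve.eq_zero_of_notMem_tsupport g hZ
    simp only [h1, h2, _root_.zero_apply, add_zero]
  have hint3 : Integrable (fun p : ↥K × ↥(unipotentU (starRingEnd ℂ) J) =>
      fderiv ℝ (fderiv ℝ g) (((((p.1 : ↥K) : ↥(unitaryGroupOfForm (starRingEnd ℂ) J)) : GL (Fin 2) ℂ) : Matrix (Fin 2) (Fin 2) ℂ) * (((hypBlockGL x θ : GL (Fin 2) ℂ) : Matrix (Fin 2) (Fin 2) ℂ) * ((((p.2 : ↥(unipotentU (starRingEnd ℂ) J)) : ↥(unitaryGroupOfForm (starRingEnd ℂ) J)) : GL (Fin 2) ℂ) : Matrix (Fin 2) (Fin 2) ℂ)) * (((((p.1 : ↥K) : ↥(unitaryGroupOfForm (starRingEnd ℂ) J))⁻¹ : ↥(unitaryGroupOfForm (starRingEnd ℂ) J)) : GL (Fin 2) ℂ) : Matrix (Fin 2) (Fin 2) ℂ)) (((((p.1 : ↥K) : ↥(unitaryGroupOfForm (starRingEnd ℂ) J)) :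 GL (Fin 2) ℂ) : Matrix (Fin 2) (Fin 2) ℂ) * (((hypBlockGL x θ : GL (Fin 2) ℂ) : Matrix (Fin 2) (Fin 2) ℂ) * ((((p.2 : ↥(unipotentU (starRingEnd ℂ) J)) : ↥(unitaryGroupOfForm (starRingEnd ℂ) J)) : GL (Fin 2) ℂ) : Matrix (Fin 2) (Fin 2) ℂ) * !![0, I; 0, 0]) * (((((p.1 : ↥K) : ↥(unitaryGroupOfForm (starRingEnd ℂ) J))⁻¹ : ↥(unitaryGroupOfForm (starRingEnd ℂ) J)) : GL (Fin 2) ℂ) : Matrix (Fin 2) (Fin 2) ℂ)) (((((p.1 : ↥K) : ↥(unitaryGroupOfForm (starRingEnd ℂ) J)) : GL (Fin 2) ℂ) : Matrix (Fin 2) (Fin 2) ℂ) * (((hypBlockGL x θ : GL (Fin 2) ℂ) : Matrix (Fin 2) (Fin 2) ℂ) * ((((p.2 : ↥(unipotentU (starRingEnd ℂ) J)) : ↥(unitaryGroupOfForm (starRingEnd ℂ) J)) : GL (Fin 2) ℂ) : Matrix (Fin 2) (Fin 2) ℂ) * !![0, 0; I, 0]) * (((((p.1 : ↥K) : ↥(unitaryGroupOfForm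 (starRingEnd ℂ) J))⁻¹ : ↥(unitaryGroupOfForm (starRingEnd ℂ) J)) : GL (Fin 2) ℂ) : Matrix (Fin 2) (Fin 2) ℂ)) +
        fderiv ℝ g (((((p.1 : ↥K) : ↥(unitaryGroupOfForm (starRingEnd ℂ) J)) : GL (Fin 2) ℂ) : Matrix (Fin 2) (Fin 2) ℂ) * (((hypBlockGL x θ : GL (Fin 2) ℂ) : Matrix (Fin 2) (Fin 2) ℂ) * ((((p.2 : ↥(unipotentU (starRingEnd ℂ) J)) : ↥(unitaryGroupOfForm (starRingEnd ℂ) J)) : GL (Fin 2) ℂ) : Matrix (Fin 2) (Fin 2) ℂ)) * (((((p.1 : ↥K) : ↥(unitaryGroupOfForm (starRingEnd ℂ) J))⁻¹ : ↥(unitaryGroupOfForm (starRingEnd ℂ) J)) : GL (Fin 2) ℂ) : Matrix (Fin 2) (Fin 2) ℂ)) (((((p.1 : ↥K) : ↥(unitaryGroupOfForm (starRingEnd ℂ) J)) : GL (Fin 2) ℂ) : Matrix (Fin 2) (Fin 2) ℂ) * (((hypBlockGL x θ : GL (Fin 2) ℂ) : Matrix (Fin 2) (Fin 2) ℂ) *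 ((((p.2 : ↥(unipotentU (starRingEnd ℂ) J)) : ↥(unitaryGroupOfForm (starRingEnd ℂ) J)) : GL (Fin 2) ℂ) : Matrix (Fin 2) (Fin 2) ℂ) * (!![0, I; 0, 0] * !![0, 0; I, 0])) * (((((p.1 : ↥K) : ↥(unitaryGroupOfForm (starRingEnd ℂ) J))⁻¹ : ↥(unitaryGroupOfForm (starRingEnd ℂ) J)) : GL (Fin 2) ℂ) : Matrix (Fin 2) (Fin 2) ℂ))) (κ.prod μN) := by
    have hk : Continuous fun p : ↥K × ↥(unipotentU (starRingEnd ℂ) J) => ((((p.1 : ↥K) : ↥(unitaryGroupOfForm (starRingEnd ℂ) J)) : GL (Fin 2) ℂ) : Matrix (Fin 2) (Fin 2) ℂ) := (Units.continuous_val.comp continuous_subtype_val).comp (continuous_subtype_val.comp continuous_fst)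
    have hki : Continuous fun p : ↥K × ↥(unipotentU (starRingEnd ℂ) J) => (((((p.1 : ↥K) : ↥(unitaryGroupOfForm (starRingEnd ℂ) J))⁻¹ : ↥(unitaryGroupOfForm (starRingEnd ℂ) J)) : GL (Fin 2) ℂ) : Matrix (Fin 2) (Fin 2) ℂ) :=
      (Units.continuous_val.comp continuous_subtype_val).comp ((continuous_subtype_val.comp continuous_fst).inv)
    have hn : Continuous fun p : ↥K × ↥(unipotentU (starRingEnd ℂ) J) => ((((p.2 : ↥(unipotentU (starRingEnd ℂ) J)) : ↥(unitaryGroupOfForm (starRingEnd ℂ) J)) : GL (Fin 2) ℂ) : Matrix (Fin 2) (Fin 2) ℂ) := (Units.continuous_val.comp continuous_subtype_val).comp (continuous_subtype_val.comp continuous_snd)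
    have hY : Continuous fun p : ↥K × ↥(unipotentU (starRingEnd ℂ) J) => ((((p.1 : ↥K) : ↥(unitaryGroupOfForm (starRingEnd ℂ) J)) : GL (Fin 2) ℂ) : Matrix (Fin 2) (Fin 2) ℂ) * (((hypBlockGL x θ : GL (Fin 2) ℂ) : Matrix (Fin 2) (Fin 2) ℂ) * ((((p.2 : ↥(unipotentU (starRingEnd ℂ) J)) : ↥(unitaryGroupOfForm (starRingEnd ℂ) J)) : GL (Fin 2) ℂ) : Matrix (Fin 2) (Fin 2) ℂ)) * (((((p.1 : ↥K) : ↥(unitaryGroupOfForm (starRingEnd ℂ) J))⁻¹ : ↥(unitaryGroupOfForm (starRingEnd ℂ) J)) : GL (Fin 2) ℂ) : Matrix (Fin 2) (Fin 2) ℂ) := (hk.mul (continuous_const.mul hn)).mul hki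
    have hVE : Continuous fun p : ↥K × ↥(unipotentU (starRingEnd ℂ) J) => ((((p.1 : ↥K) : ↥(unitaryGroupOfForm (starRingEnd ℂ) J)) : GL (Fin 2) ℂ) : Matrix (Fin 2) (Fin 2) ℂ) * (((hypBlockGL x θ : GL (Fin 2) ℂ) : Matrix (Fin 2) (Fin 2) ℂ) * ((((p.2 : ↥(unipotentU (starRingEnd ℂ) J)) : ↥(unitaryGroupOfForm (starRingEnd ℂ) J)) : GL (Fin 2) ℂ) : Matrix (Fin 2) (Fin 2) ℂ) * !![0, I; 0, 0]) * (((((p.1 : ↥K) : ↥(unitaryGroupOfForm (starRingEnd ℂ) J))⁻¹ : ↥(unitaryGroupOfForm (starRingEnd ℂ) J)) : GL (Fin 2) ℂ) : Matrix (Fin 2) (Fin 2) ℂ) := (hk.mul ((continuous_const.mul hn).mul continuous_const)).mul hki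
    have hVF : Continuous fun p : ↥K × ↥(unipotentU (starRingEnd ℂ) J) => ((((p.1 : ↥K) : ↥(unitaryGroupOfForm (starRingEnd ℂ) J)) : GL (Fin 2) ℂ) : Matrix (Fin 2) (Fin 2) ℂ) * (((hypBlockGL x θ : GL (Fin 2) ℂ) : Matrix (Fin 2) (Fin 2) ℂ) * ((((p.2 : ↥(unipotentU (starRingEnd ℂ) J)) : ↥(unitaryGroupOfForm (starRingEnd ℂ) J)) : GL (Fin 2) ℂ) : Matrix (Fin 2) (Fin 2) ℂ) * !![0, 0; I, 0]) * (((((p.1 : ↥K) : ↥(unitaryGroupOfForm (starRingEnd ℂ) J))⁻¹ : ↥(unitaryGroupOfForm (starRingEnd ℂ) J)) : GL (Fin 2) ℂ) : Matrix (Fin 2) (Fin 2) ℂ) := (hk.mul ((continuous_const.mul hn).mul continuous_const)).mul hki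
    have hVEF : Continuous fun p : ↥K × ↥(unipotentU (starRingEnd ℂ) J) => ((((p.1 : ↥K) : ↥(unitaryGroupOfForm (starRingEnd ℂ) J)) : GL (Fin 2) ℂ) : Matrix (Fin 2) (Fin 2) ℂ) * (((hypBlockGL x θ : GL (Fin 2) ℂ) : Matrix (Fin 2) (Fin 2) ℂ) * ((((p.2 : ↥(unipotentU (starRingEnd ℂ) J)) : ↥(unitaryGroupOfForm (starRingEnd ℂ) J)) : GL (Fin 2) ℂ) : Matrix (Fin 2) (Fin 2) ℂ) * (!![0, I; 0, 0] * !![0, 0; I, 0])) * (((((p.1 : ↥K) : ↥(unitaryGroupOfForm (starRingEnd ℂ) J))⁻¹ : ↥(unitaryGroupOfForm (starRingEnd ℂ) J)) : GL (Fin 2) ℂ) : Matrix (Fin 2) (Fin 2) ℂ) := (hk.mul ((continuous_const.mul hn).mul continuous_const)).mul hki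
    have hD2cont := ((contDiff_infty_iff_fderiv.1 hg').2).continuous
    have hc : Continuous fun p : ↥K × ↥(unipotentU (starRingEnd ℂ) J) =>
        fderiv ℝ (fderiv ℝ g) (((((p.1 : ↥K) : ↥(unitaryGroupOfForm (starRingEnd ℂ) J)) : GL (Fin 2) ℂ) : Matrix (Fin 2) (Fin 2) ℂ) * (((hypBlockGL x θ : GL (Fin 2) ℂ) : Matrix (Fin 2) (Fin 2) ℂ) * ((((p.2 : ↥(unipotentU (starRingEnd ℂ) J)) : ↥(unitaryGroupOfForm (starRingEnd ℂ) J)) : GL (Fin 2) ℂ) : Matrix (Fin 2) (Fin 2) ℂ)) * (((((p.1 : ↥K) : ↥(unitaryGroupOfForm (starRingEnd ℂ) J))⁻¹ : ↥(unitaryGroupOfForm (starRingEnd ℂ) J)) : GL (Fin 2) ℂ) : Matrix (Fin 2) (Fin 2) ℂ)) (((((p.1 : ↥K) : ↥(unitaryGroupOfForm (starRingEnd ℂ) J)) : GL (Fin 2) ℂ) : Matrix (Fin 2) (Fin 2) ℂ) * (((hypBlockGL x θ : GL (Fin 2) ℂ) : Matrix (Fin 2) (Fin 2) ℂ) * ((((p.2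 : ↥(unipotentU (starRingEnd ℂ) J)) : ↥(unitaryGroupOfForm (starRingEnd ℂ) J)) : GL (Fin 2) ℂ) : Matrix (Fin 2) (Fin 2) ℂ) * !![0, I; 0, 0]) * (((((p.1 : ↥K) : ↥(unitaryGroupOfForm (starRingEnd ℂ) J))⁻¹ : ↥(unitaryGroupOfForm (starRingEnd ℂ) J)) : GL (Fin 2) ℂ) : Matrix (Fin 2) (Fin 2) ℂ)) (((((p.1 : ↥K) : ↥(unitaryGroupOfForm (starRingEnd ℂ) J)) : GL (Fin 2) ℂ) : Matrix (Fin 2) (Fin 2) ℂ) * (((hypBlockGL x θ : GL (Fin 2) ℂ) : Matrix (Fin 2) (Fin 2) ℂ) * ((((p.2 : ↥(unipotentU (starRingEnd ℂ) J)) : ↥(unitaryGroupOfForm (starRingEnd ℂ) J)) : GL (Fin 2) ℂ) : Matrix (Fin 2) (Fin 2) ℂ) * !![0, 0; I, 0]) * (((((p.1 : ↥K) : ↥(unitaryGroupOfForm (starRingEnd ℂ) J))⁻¹ : ↥(unitaryGroupOfForm (starRingEnd ℂ) J)) : GL (Fin 2) ℂ) : Matrix (Fin 2) (Fin 2) ℂ))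 +
          fderiv ℝ g (((((p.1 : ↥K) : ↥(unitaryGroupOfForm (starRingEnd ℂ) J)) : GL (Fin 2) ℂ) : Matrix (Fin 2) (Fin 2) ℂ) * (((hypBlockGL x θ : GL (Fin 2) ℂ) : Matrix (Fin 2) (Fin 2) ℂ) * ((((p.2 : ↥(unipotentU (starRingEnd ℂ) J)) : ↥(unitaryGroupOfForm (starRingEnd ℂ) J)) : GL (Fin 2) ℂ) : Matrix (Fin 2) (Fin 2) ℂ)) * (((((p.1 : ↥K) : ↥(unitaryGroupOfForm (starRingEnd ℂ) J))⁻¹ : ↥(unitaryGroupOfForm (starRingEnd ℂ) J)) : GL (Fin 2) ℂ) : Matrix (Fin 2) (Fin 2) ℂ)) (((((p.1 : ↥K) : ↥(unitaryGroupOfForm (starRingEnd ℂ) J)) : GL (Fin 2) ℂ) : Matrix (Fin 2) (Fin 2) ℂ) * (((hypBlockGL x θ : GL (Fin 2) ℂ) : Matrix (Fin 2) (Fin 2) ℂ) * ((((p.2 : ↥(unipotentU (starRingEnd ℂ) J)) : ↥(unitaryGroupOfForm (starRingEnd ℂ) J)) : GL (Fin 2) ℂ) : Matrix (Fin 2) (Fin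 2) ℂ) * (!![0, I; 0, 0] * !![0, 0; I, 0])) * (((((p.1 : ↥K) : ↥(unitaryGroupOfForm (starRingEnd ℂ) J))⁻¹ : ↥(unitaryGroupOfForm (starRingEnd ℂ) J)) : GL (Fin 2) ℂ) : Matrix (Fin 2) (Fin 2) ℂ)) :=
      (((hD2cont.comp hY).clm_apply hVE).clm_apply hVF).add ((hDgcont.comp hY).clm_apply hVEF)
    refine hc.integrable_of_hasCompactSupport (HasCompactSupport.intro hsE fun p hp => ?_)
    have hw : ((p.1 : ↥K) : ↥(unitaryGroupOfForm (starRingEnd ℂ) J)) * (tU x * ((p.2 : ↥(unipotentU (starRingEnd ℂ) J)) : ↥(unitaryGroupOfForm (starRingEnd ℂ) J)) * ((uN 0 : ↥(unipotentU (starRingEnd ℂ) J)) : ↥(unitaryGroupOfForm (starRingEnd ℂ) J))) * ((p.1 : ↥K) : ↥(unitaryGroupOfForm (starRingEnd ℂ) J))⁻¹ ∉ {u : ↥(unitaryGroupOfForm (starRingEnd ℂ) J) | ((u : GL (Fin 2) ℂ) : Matrix (Fin 2) (Fin 2) ℂ) ∈ tsupport g} :=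
      fun hmem => hp (hsuppE 0 (mem_closedBall_self zero_le_one) p hmem)
    have hZ : ((((p.1 : ↥K) : ↥(unitaryGroupOfForm (starRingEnd ℂ) J)) : GL (Fin 2) ℂ) : Matrix (Fin 2) (Fin 2) ℂ) * (((hypBlockGL x θ : GL (Fin 2) ℂ) : Matrix (Fin 2) (Fin 2) ℂ) * ((((p.2 : ↥(unipotentU (starRingEnd ℂ) J)) : ↥(unitaryGroupOfForm (starRingEnd ℂ) J)) : GL (Fin 2) ℂ) : Matrix (Fin 2) (Fin 2) ℂ)) * (((((p.1 : ↥K) : ↥(unitaryGroupOfForm (starRingEnd ℂ) J))⁻¹ : ↥(unitaryGroupOfForm (starRingEnd ℂ) J)) : GL (Fin 2) ℂ) : Matrix (Fin 2) (Fin 2) ℂ) ∉ tsupport g := by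
      have e : (((((p.1 : ↥K) : ↥(unitaryGroupOfForm (starRingEnd ℂ) J)) * (tU x * ((p.2 : ↥(unipotentU (starRingEnd ℂ) J)) : ↥(unitaryGroupOfForm (starRingEnd ℂ) J)) * ((uN 0 : ↥(unipotentU (starRingEnd ℂ) J)) : ↥(unitaryGroupOfForm (starRingEnd ℂ) J))) * ((p.1 : ↥K) : ↥(unitaryGroupOfForm (starRingEnd ℂ) J))⁻¹ : ↥(unitaryGroupOfForm (starRingEnd ℂ) J)) : GL (Fin 2) ℂ) : Matrix (Fin 2) (Fin 2) ℂ) = ((((p.1 : ↥K) : ↥(unitaryGroupOfForm (starRingEnd ℂ) J)) : GL (Fin 2) ℂ) : Matrix (Fin 2) (Fin 2) ℂ) * (((hypBlockGL x θ : GL (Fin 2) ℂ) : Matrix (Fin 2) (Fin 2) ℂ) * ((((p.2 : ↥(unipotentU (starRingEnd ℂ) J)) : ↥(unitaryGroupOfForm (starRingEnd ℂ) J)) : GL (Fin 2) ℂ) : Matrix (Fin 2) (Fin 2) ℂ)) * (((((p.1 : ↥K) : ↥(unitaryGroupOfForm (starRingEnd ℂ) J))⁻¹ : ↥(unitaryGroupOfForm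 (starRingEnd ℂ) J)) : GL (Fin 2) ℂ) : Matrix (Fin 2) (Fin 2) ℂ) := by
        rw [hcoe3, htUval, huNval, hu0, Matrix.mul_one]
      rw [← e]; exact hw
    obtain ⟨-, h1, h2⟩ := ConjugationCurve.eq_zero_of_notMem_tsupport g hZ
    simp only [h1, h2, _root_.zero_apply, add_zero]
  -- integrate the pointwise identity
  have hI : ΨΩ x =
      (∫ p : ↥K × ↥(unipotentU (starRingEnd ℂ) J), (fderiv ℝ (fderiv ℝ g) (((((p.1 : ↥K) : ↥(unitaryGroupOfForm (starRingEnd ℂ) J)) : GL (Fin 2) ℂ) : Matrix (Fin 2) (Fin 2) ℂ) * (((hypBlockGL x θ : GL (Fin 2) ℂ) : Matrix (Fin 2) (Fin 2) ℂ) * ((((p.2 : ↥(unipotentU (starRingEnd ℂ) J)) : ↥(unitaryGroupOfForm (starRingEnd ℂ) J)) : GL (Fin 2) ℂ) : Matrix (Fin 2) (Fin 2) ℂ)) * (((((p.1 : ↥K) : ↥(unitaryGroupOfForm (starRingEnd ℂ) J))⁻¹ : ↥(unitaryGroupOfForm (starRingEnd ℂ) J)) : GL (Fin 2) ℂ) :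 Matrix (Fin 2) (Fin 2) ℂ)) (((((p.1 : ↥K) : ↥(unitaryGroupOfForm (starRingEnd ℂ) J)) : GL (Fin 2) ℂ) : Matrix (Fin 2) (Fin 2) ℂ) * (((hypBlockGL x θ : GL (Fin 2) ℂ) : Matrix (Fin 2) (Fin 2) ℂ) * ((((p.2 : ↥(unipotentU (starRingEnd ℂ) J)) : ↥(unitaryGroupOfForm (starRingEnd ℂ) J)) : GL (Fin 2) ℂ) : Matrix (Fin 2) (Fin 2) ℂ) * !![1, 0; 0, -1]) * (((((p.1 : ↥K) : ↥(unitaryGroupOfForm (starRingEnd ℂ) J))⁻¹ : ↥(unitaryGroupOfForm (starRingEnd ℂ) J)) : GL (Fin 2) ℂ) : Matrix (Fin 2) (Fin 2) ℂ)) (((((p.1 : ↥K) : ↥(unitaryGroupOfForm (starRingEnd ℂ) J)) : GL (Fin 2) ℂ) : Matrix (Fin 2) (Fin 2) ℂ) * (((hypBlockGL x θ : GL (Fin 2) ℂ) : Matrix (Fin 2) (Fin 2) ℂ) * ((((p.2 : ↥(unipotentU (starRingEnd ℂ) J)) : ↥(unitaryGroupOfForm (starRingEnd ℂ) J)) : GL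 (Fin 2) ℂ) : Matrix (Fin 2) (Fin 2) ℂ) * !![1, 0; 0, -1]) * (((((p.1 : ↥K) : ↥(unitaryGroupOfForm (starRingEnd ℂ) J))⁻¹ : ↥(unitaryGroupOfForm (starRingEnd ℂ) J)) : GL (Fin 2) ℂ) : Matrix (Fin 2) (Fin 2) ℂ)) +
          fderiv ℝ g (((((p.1 : ↥K) : ↥(unitaryGroupOfForm (starRingEnd ℂ) J)) : GL (Fin 2) ℂ) : Matrix (Fin 2) (Fin 2) ℂ) * (((hypBlockGL x θ : GL (Fin 2) ℂ) : Matrix (Fin 2) (Fin 2) ℂ) * ((((p.2 : ↥(unipotentU (starRingEnd ℂ) J)) : ↥(unitaryGroupOfForm (starRingEnd ℂ) J)) : GL (Fin 2) ℂ) : Matrix (Fin 2) (Fin 2) ℂ)) * (((((p.1 : ↥K) : ↥(unitaryGroupOfForm (starRingEnd ℂ) J))⁻¹ : ↥(unitaryGroupOfForm (starRingEnd ℂ) J)) : GL (Fin 2) ℂ) : Matrix (Fin 2) (Fin 2) ℂ)) (((((p.1 : ↥K) : ↥(unitaryGroupOfForm (starRingEnd ℂ) J)) : GL (Fin 2) ℂ)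 : Matrix (Fin 2) (Fin 2) ℂ) * (((hypBlockGL x θ : GL (Fin 2) ℂ) : Matrix (Fin 2) (Fin 2) ℂ) * ((((p.2 : ↥(unipotentU (starRingEnd ℂ) J)) : ↥(unitaryGroupOfForm (starRingEnd ℂ) J)) : GL (Fin 2) ℂ) : Matrix (Fin 2) (Fin 2) ℂ) * !![1, 0; 0, -1] * !![1, 0; 0, -1]) * (((((p.1 : ↥K) : ↥(unitaryGroupOfForm (starRingEnd ℂ) J))⁻¹ : ↥(unitaryGroupOfForm (starRingEnd ℂ) J)) : GL (Fin 2) ℂ) : Matrix (Fin 2) (Fin 2) ℂ))) ∂(κ.prod μN)) -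
        (2 : ℝ) • (∫ p : ↥K × ↥(unipotentU (starRingEnd ℂ) J), fderiv ℝ g (((((p.1 : ↥K) : ↥(unitaryGroupOfForm (starRingEnd ℂ) J)) : GL (Fin 2) ℂ) : Matrix (Fin 2) (Fin 2) ℂ) * (((hypBlockGL x θ : GL (Fin 2) ℂ) : Matrix (Fin 2) (Fin 2) ℂ) * ((((p.2 : ↥(unipotentU (starRingEnd ℂ) J)) : ↥(unitaryGroupOfForm (starRingEnd ℂ) J)) : GL (Fin 2) ℂ) : Matrix (Fin 2) (Fin 2) ℂ)) * (((((p.1 : ↥K) : ↥(unitaryGroupOfForm (starRingEnd ℂ) J))⁻¹ : ↥(unitaryGroupOfForm (starRingEnd ℂ) J)) : GL (Fin 2) ℂ) : Matrix (Fin 2) (Fin 2) ℂ)) (((((p.1 : ↥K) : ↥(unitaryGroupOfForm (starRingEnd ℂ) J)) : GL (Fin 2) ℂ) : Matrix (Fin 2) (Fin 2) ℂ) * (((hypBlockGL x θ : GL (Fin 2) ℂ) : Matrix (Fin 2) (Fin 2) ℂ) * ((((p.2 : ↥(unipotentU (starRingEnd ℂ) J)) : ↥(unitaryGroupOfForm (starRingEnd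 ℂ) J)) : GL (Fin 2) ℂ) : Matrix (Fin 2) (Fin 2) ℂ) * !![1, 0; 0, -1]) * (((((p.1 : ↥K) : ↥(unitaryGroupOfForm (starRingEnd ℂ) J))⁻¹ : ↥(unitaryGroupOfForm (starRingEnd ℂ) J)) : GL (Fin 2) ℂ) : Matrix (Fin 2) (Fin 2) ℂ)) ∂(κ.prod μN)) -
        (4 : ℝ) • (∫ p : ↥K × ↥(unipotentU (starRingEnd ℂ) J), (fderiv ℝ (fderiv ℝ g) (((((p.1 : ↥K) : ↥(unitaryGroupOfForm (starRingEnd ℂ) J)) : GL (Fin 2) ℂ) : Matrix (Fin 2) (Fin 2) ℂ) * (((hypBlockGL x θ : GL (Fin 2) ℂ) : Matrix (Fin 2) (Fin 2) ℂ) * ((((p.2 : ↥(unipotentU (starRingEnd ℂ) J)) : ↥(unitaryGroupOfForm (starRingEnd ℂ) J)) : GL (Fin 2) ℂ) : Matrix (Fin 2) (Fin 2) ℂ)) * (((((p.1 : ↥K) : ↥(unitaryGroupOfForm (starRingEnd ℂ) J))⁻¹ : ↥(unitaryGroupOfForm (starRingEnd ℂ) J)) : GL (Fin 2) ℂ) :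 Matrix (Fin 2) (Fin 2) ℂ)) (((((p.1 : ↥K) : ↥(unitaryGroupOfForm (starRingEnd ℂ) J)) : GL (Fin 2) ℂ) : Matrix (Fin 2) (Fin 2) ℂ) * (((hypBlockGL x θ : GL (Fin 2) ℂ) : Matrix (Fin 2) (Fin 2) ℂ) * ((((p.2 : ↥(unipotentU (starRingEnd ℂ) J)) : ↥(unitaryGroupOfForm (starRingEnd ℂ) J)) : GL (Fin 2) ℂ) : Matrix (Fin 2) (Fin 2) ℂ) * !![0, I; 0, 0]) * (((((p.1 : ↥K) : ↥(unitaryGroupOfForm (starRingEnd ℂ) J))⁻¹ : ↥(unitaryGroupOfForm (starRingEnd ℂ) J)) : GL (Fin 2) ℂ) : Matrix (Fin 2) (Fin 2) ℂ)) (((((p.1 : ↥K) : ↥(unitaryGroupOfForm (starRingEnd ℂ) J)) : GL (Fin 2) ℂ) : Matrix (Fin 2) (Fin 2) ℂ) * (((hypBlockGL x θ : GL (Fin 2) ℂ) : Matrix (Fin 2) (Fin 2) ℂ) * ((((p.2 : ↥(unipotentU (starRingEnd ℂ) J)) : ↥(unitaryGroupOfForm (starRingEnd ℂ) J)) : GL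 (Fin 2) ℂ) : Matrix (Fin 2) (Fin 2) ℂ) * !![0, 0; I, 0]) * (((((p.1 : ↥K) : ↥(unitaryGroupOfForm (starRingEnd ℂ) J))⁻¹ : ↥(unitaryGroupOfForm (starRingEnd ℂ) J)) : GL (Fin 2) ℂ) : Matrix (Fin 2) (Fin 2) ℂ)) +
          fderiv ℝ g (((((p.1 : ↥K) : ↥(unitaryGroupOfForm (starRingEnd ℂ) J)) : GL (Fin 2) ℂ) : Matrix (Fin 2) (Fin 2) ℂ) * (((hypBlockGL x θ : GL (Fin 2) ℂ) : Matrix (Fin 2) (Fin 2) ℂ) * ((((p.2 : ↥(unipotentU (starRingEnd ℂ) J)) : ↥(unitaryGroupOfForm (starRingEnd ℂ) J)) : GL (Fin 2) ℂ) : Matrix (Fin 2) (Fin 2) ℂ)) * (((((p.1 : ↥K) : ↥(unitaryGroupOfForm (starRingEnd ℂ) J))⁻¹ : ↥(unitaryGroupOfForm (starRingEnd ℂ) J)) : GL (Fin 2) ℂ) : Matrix (Fin 2) (Fin 2) ℂ)) (((((p.1 : ↥K) : ↥(unitaryGroupOfForm (starRingEnd ℂ) J)) : GL (Fin 2) ℂ)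 : Matrix (Fin 2) (Fin 2) ℂ) * (((hypBlockGL x θ : GL (Fin 2) ℂ) : Matrix (Fin 2) (Fin 2) ℂ) * ((((p.2 : ↥(unipotentU (starRingEnd ℂ) J)) : ↥(unitaryGroupOfForm (starRingEnd ℂ) J)) : GL (Fin 2) ℂ) : Matrix (Fin 2) (Fin 2) ℂ) * (!![0, I; 0, 0] * !![0, 0; I, 0])) * (((((p.1 : ↥K) : ↥(unitaryGroupOfForm (starRingEnd ℂ) J))⁻¹ : ↥(unitaryGroupOfForm (starRingEnd ℂ) J)) : GL (Fin 2) ℂ) : Matrix (Fin 2) (Fin 2) ℂ))) ∂(κ.prod μN)) := by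
    rw [hΨΩ, integral_congr_ae (Eventually.of_forall hpt), integral_sub, integral_sub, integral_smul, integral_smul]
    · exact hint2
    · exact hint1.smul (2 : ℝ)
    · exact hint2.sub (hint1.smul (2 : ℝ))
    · exact hint3.smul (4 : ℝ)
  rw [hI, hN2, hN1, hE, smul_zero, sub_zero]
  module


end SplitRadial

end UnitaryGroup

end Literature.NumberTheory.Automorphic

end
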